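import Literature.NumberTheory.Automorphic.ZhouLegendreGreenValues
import Literature.NumberTheory.Automorphic.HigherGreenFunctionProofs
import Literature.NumberTheory.LFunctions.RiemannXiShiftInequality
import Literature.Analysis.SpecialFunctions.DigammaReflection
import Literature.Analysis.SpecialFunctions.DigammaGauss
import HarnessLib

/-!
# Zhou 2015, Remark 9 — proofs: calculus of the Legendre function `P_ν`

Proved companion of `Literature/NumberTheory/Automorphic/ZhouLegendreGreenValues.lean`, which
vendors the named fact `Zhou2015_legendreP_sq_integral` (Y. Zhou, *Kontsevich–Zagier integrals for
automorphic Green's functions. I*, Ramanujan J. 38 (2015), Remark 9 and eq. (Pnu_sqr_0to1):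
`π ∫₀¹ P_ν² = (π/(2ν+1)){1 + (sin νπ/π)[ψ((ν+2)/2) − ψ((ν+1)/2)]}`, "proved by simple applications
of the Legendre differential equations", plus three CM values of weight-4 automorphic Green's
functions). This file proves, sorry-free, the bottom layers of the printed argument for the
closed form, for the tree's `legendreP ν ξ = ₂F₁(−ν, ν+1; 1; (1−ξ)/2)` (Murphy's expression,
Whittaker–Watson §15.22) built on Mathlib's `ordinaryHypergeometric`:

* **real power series with radius ≥ 1** (`∑ Aₙ xⁿ`, `Σ |Aₙ| rⁿ < ∞` for all `0 ≤ r < 1`):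
  termwise differentiation strictly inside the disc (`LegendreP.hasDerivAt_tsum_mul_pow`, via
  Mathlib's `hasDerivAt_tsum_of_isPreconnected`), stability of the class under `Aₙ ↦ (n+1)A_{n+1}`,
  and the hypergeometric differential equation from the coefficient recurrence
  `(n+1)(n+c)A_{n+1} = (n+a)(n+b)Aₙ` (`LegendreP.hypergeometric_ode_of_hasSum`, Andrews–Askey–Roy
  (2.3.5));
* **`₂F₁(a,b;c;x)` on `|x| < 1`** (real parameters): radius `≥ 1` in every case
  (`LegendreP.one_le_ordinaryHypergeometricSeries_radius`, from Mathlib's `= 1`/`= ⊤` dichotomy),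
  the `HasSum`/`tsum` forms, continuity, and the derivative formula
  `d/dx ₂F₁(a,b;c;x) = (ab/c) ₂F₁(a+1,b+1;c+1;x)` (`LegendreP.hasDerivAt_ordinaryHypergeometric`,
  Andrews–Askey–Roy (2.5.1));
* **`P_ν` on `(−1, 3)`**: continuity (hence interval-integrability of `P_ν P_σ`, `P_ν²` on
  `[0,1]`, so the integrals in the fact are genuine), differentiability of `P_ν` and `P_ν'`,
  **Legendre's differential equation** `(1−ξ²)P_ν'' − 2ξP_ν' + ν(ν+1)P_ν = 0`
  (`LegendreP.legendreP_ode`, Whittaker–Watson §15.13/§15.2) and its self-adjoint form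
  `((1−ξ²)P_ν')' = −ν(ν+1)P_ν`;
* **Green's formula on `[0,1]`** (`LegendreP.integral_legendreP_mul_legendreP`):
  `(σ−ν)(σ+ν+1) ∫₀¹ P_ν P_σ dξ = P_ν(0)P_σ'(0) − P_σ(0)P_ν'(0)` — the boundary term at `ξ = 1`
  dies with `1 − ξ²`. This is the "simple application of the Legendre differential equation"
  behind (Pnu_sqr_0to1): the closed form follows by letting `σ → ν` once `P_ν(0)`, `P_ν'(0)` are
  known in Gamma form (DLMF 14.5.1–14.5.2) together with their `ν`-derivatives.

* **contiguity and symmetry** (`LegendreP.deriv_legendreP_succ_sub`, Whittaker–Watson §15.21):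
  `P'_{ν+1} − ξP'_ν = (ν+1)P_ν` on `(−1,3)`, hence `P'_σ(0) = σ P_{σ−1}(0)`
  (`LegendreP.deriv_legendreP_zero`); `P_{−ν−1} = P_ν`;
* **Euler's integral representation** (`LegendreP.euler_integral_ordinaryHypergeometric`,
  Andrews–Askey–Roy Thm 2.2.1) for real `c > b > 0`, `|x| < 1`:
  `∫₀¹ t^{b−1}(1−t)^{c−b−1}(1−xt)^{−a} dt = Γ(b)Γ(c−b)/Γ(c) · ₂F₁(a,b;c;x)`, by termwise
  integration of the binomial series (`LegendreP.hasSum_one_sub_rpow_neg`, from Mathlib's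
  `Real.one_add_rpow_hasFPowerSeriesOnBall_zero`) against the real Beta integral (the tree's
  `Literature.NumberTheory.LFunctions.integral_rpow_mul_one_sub_rpow`);
* **`P_ν(0) = √π/(Γ((1−ν)/2)Γ(1+ν/2))` for `−1 < ν < 0`**
  (`LegendreP.legendreP_zero_of_neg_one_lt_of_neg`, DLMF 14.5.1 on this range): Euler's integral
  at `x = ½`, the substitutions `t = 1 − s`, `u = s²`, `B(−ν/2, ν+1)` and Legendre duplication;
* **analytic continuation in the degree** (`LegendreP.legendreP_zero_eq`,
  `LegendreP.deriv_legendreP_zero_eq`, DLMF 14.5.1–14.5.2 for EVERY real degree):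
  `s ↦ Σₙ cₙ(s)2⁻ⁿ` (`cₙ(s) = (−s)ₙ(s+1)ₙ/(n!)²`) is entire (Weierstrass `M`-test with the majorant
  `(R)ₙ(R+1)ₙ/(n!)² 2⁻ⁿ` on `‖s‖ ≤ R`, Mathlib's `Complex.differentiableOn_tsum_of_summable_norm`),
  equals `P_s(0)` at real `s` and `√π/(Γ((1−s)/2)Γ(1+s/2))` (entire) on `(−1,0)`, hence everywhere
  (identity theorem); with `P'_ν(0) = νP_{ν−1}(0)` and reflection this gives the pole-free forms
  `P_ν(0) = cos(πν/2)Γ((ν+1)/2)/(√πΓ(1+ν/2))`, `P_ν'(0) = 2sin(πν/2)Γ(1+ν/2)/(√πΓ((ν+1)/2))`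
  (`ν > −1`; `LegendreP.legendreP_zero_eq_cos`, `LegendreP.deriv_legendreP_zero_eq_sin`).

* **the closed form (Pnu_sqr_0to1) = conjunct (i) of the fact** (`LegendreP.integral_legendreP_sq`,
  `LegendreP.pi_mul_integral_legendreP_sq`, `LegendreP.Zhou2015_legendreP_sq_integral_closedForm`):
  for `ν > −1`, `ν ≠ −1/2`, `π∫₀¹P_ν² = (π/(2ν+1)){1 + (sin νπ/π)[ψ((ν+2)/2) − ψ((ν+1)/2)]}`.
  Proof: `σ ↦ P_σ(ξ)` and `σ ↦ ∫₀¹P_νP_σ` are continuous (dominated convergence on Murphy's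
  series, `LegendreP.continuousAt_integral_legendreP_mul`); the numerator
  `f(σ) = P_ν(0)P_σ'(0) − P_σ(0)P_ν'(0)` of Green's formula vanishes at `σ = ν` and is
  differentiable there through the closed forms (`Γ' = Γψ`, `LegendreP.hasDerivAt_Gamma_digammaReal`),
  so `∫₀¹P_ν² = lim_{σ→ν} f(σ)/((σ−ν)(σ+ν+1)) = f'(ν)/(2ν+1)`, and
  `f'(ν) = cos² + sin² + (2 sin cos/π)(ψ₂ − ψ₁)` (`LegendreP.green_limit_algebra`).

* **the three special values = conjuncts (ii)b, (iii)b, (iv)b**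
  (`LegendreP.integral_legendreP_neg_one_sixth_sq`, `…_neg_one_quarter_sq`, `…_neg_one_third_sq`):
  `∫₀¹P_{−1/6}² = 3√3 log(2+√3)/(2π)`, `∫₀¹P_{−1/4}² = 4 log(1+√2)/π`, `∫₀¹P_{−1/3}² = 3√3 log 2/π`,
  from (i) and the digamma differences `ψ(11/12) − ψ(5/12) = 2π − 2√3 log(2+√3)`,
  `ψ(7/8) − ψ(3/8) = π√2 − 2√2 log(1+√2)`, `ψ(5/6) − ψ(1/3) = 2π/√3 − 2 log 2` (Gauss's digamma
  theorem at these arguments). The last is duplication + reflection at `1/3`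
  (`Literature/Analysis/SpecialFunctions/DigammaReflection`); the first two are obtained as
  `ψ(x+½) − ψ(x) = Σₖ [1/(x+k) − 1/(x+½+k)]` (Andrews–Askey–Roy (1.2.13),
  `Literature/Analysis/SpecialFunctions/DigammaGauss`) `= q ∫₀¹ (tⁱ − tʲ)/(1 − t^q) dt` (termwise
  integration, `LegendreP.hasSum_inv_sub_inv_eq_integral`) and the elementary integrals
  `∫₀¹ t²/(1+t⁴) = (π − 2log(1+√2))/(4√2)`, `∫₀¹ t⁴/(1+t⁶) = (π − √3 log(2+√3))/6` (explicit
  antiderivatives).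

* **reduction** (`LegendreP.Zhou2015_legendreP_sq_integral_iff_green`): with all of the above, the
  named fact is EQUIVALENT to the three CM values of the weight-4 Green's functions
  `higherGreen 1 2 1 ρ i = −8√3 log(2+√3)`, `higherGreen 2 2 1 ((i−1)/2) (i/√2) = −(8/√2) log(1+√2)`,
  `higherGreen 3 2 1 ((3+i√3)/6) (i/√3) = −4 log 2`.

* **Heine's integrals in closed form** (`LegendreP.greenQ_one_eq`, `LegendreP.greenQ_two_eq`):
  for `t > 1`, `greenQ 1 t = ½ log((t+1)/(t−1)) = Q₀(t)` and
  `greenQ 2 t = (t/2) log((t+1)/(t−1)) − 1 = Q₁(t)` (explicit antiderivatives), the kernels of the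
  weight-2 and weight-4 Green's functions (`higherGreen N 2 m` sums `Q₁`).

* **Gauss's digamma theorem** (`LegendreP.digamma_rat_eq_sum_log`, `LegendreP.digammaReal_rat`;
  Andrews–Askey–Roy Thm 1.2.7 / (1.2.19)), the general statement behind the three values above:
  for `1 ≤ p ≤ q`, `ψ(p/q) = −γ + Σ_{n=1}^{q−1} (ζ^{np} − 1) log(1 − ζ^{(q−1)n})` (`ζ = e^{2πi/q}`), and
  for `1 ≤ p < q`,
  `ψ(p/q) = −γ − log q − (π/2)cot(πp/q) + ½ Σ_{n=1}^{q−1} cos(2πnp/q) log(2 − 2cos(2πn/q))`.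
  The proof avoids Abel's theorem: `ψ(p/q) = −γ − q∫₀¹ (t^{p−1} − t^{q−1})/(1 − t^q) dt` (the series
  above), Simpson's dissection `q t^r/(1 − t^q) = Σ_{n<q} ζ^{nr}/(1 − ζ^{(q−1)n}t)` on `[0,1)`
  (`LegendreP.dissection`, geometric series + orthogonality of characters), the complex primitive
  `−α⁻¹ log(1 − αt)` (`LegendreP.integral_inv_one_sub_mul`), then symmetrisation `p ↔ q − p`,
  `Π_{n=1}^{q−1}|1 − ζⁿ|² = q²` and the reflection formula; also the printed `log(2 sin(πn/q))` form
  (1.2.16) with the symmetric full sum (`LegendreP.digammaReal_rat_log_sin`) and the values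
  `ψ(1/3), ψ(2/3), ψ(1/6), ψ(5/6)`.

Not here: those three Green's-function identities ((ii)a–(iv)a of the fact; Zhou's Theorem, eqs.
(G2_z_z'_arb), (G2Hecke234_Pnu): `G₂(z,z')` as Legendre-square integrals), which rest on Ramanujan's
elliptic-function theory to alternative bases, Ramanujan's differential equations for `E₂, E₄, E₆`
and the Kontsevich–Zagier integral calculus of §§2–3 of the paper — none of it in Mathlib.

## References

* Y. Zhou, Ramanujan J. 38 (2015) 227–329, arXiv:1312.6352, Remark 9. [`Zhou2015`]
* G. E. Andrews, R. Askey, R. Roy, *Special Functions*, CUP 1999, (1.1.6), §1.2, Thm 1.2.1,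
  Thm 1.2.5 (1.2.13), Thm 1.2.7, §2.1, Thm 2.2.1, (2.3.5), (2.5.1). [`AndrewsAskeyRoy1999`]
* E. T. Whittaker, G. N. Watson, *A Course of Modern Analysis*, 4th ed., §15.13, §15.2, §15.21,
  §15.22, §15.3. [`WhittakerWatson1927`]
* NIST Digital Library of Mathematical Functions, §14.5(i), eqs. 14.5.1–14.5.2. [`DLMF`]
-/

noncomputable section

open Real Filter Set FormalMultilinearSeries
open _root_.MeasureTheory
open scoped Topology NNReal ENNReal

namespace Literature.NumberTheory.Automorphic

namespace LegendreP


/-! ### Real power series `∑ Aₙ xⁿ` converging on `|x| < 1` -/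

section PowerSeries

variable {A : ℕ → ℝ}

/-- `n qⁿ` is bounded for `0 ≤ q < 1` (it tends to `0`). [folklore] -/
theorem exists_nat_mul_pow_le {q : ℝ} (hq0 : 0 ≤ q) (hq1 : q < 1) :
    ∃ C : ℝ, ∀ n : ℕ, (n : ℝ) * q ^ n ≤ C := by
  obtain ⟨C, hC⟩ := (tendsto_self_mul_const_pow_of_lt_one hq0 hq1).bddAbove_range
  exact ⟨C, fun n => hC (Set.mem_range_self n)⟩

/-- If `Σ |Aₙ| rⁿ < ∞` for every `0 ≤ r < 1`, then also `Σ n |Aₙ| rⁿ < ∞` for every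
`0 ≤ r < 1` (compare with a slightly larger radius). [folklore] -/
theorem summable_nat_mul_abs_mul_pow
    (hA : ∀ r : ℝ, 0 ≤ r → r < 1 → Summable fun n => |A n| * r ^ n)
    {r : ℝ} (hr0 : 0 ≤ r) (hr1 : r < 1) :
    Summable fun n : ℕ => (n : ℝ) * |A n| * r ^ n := by
  obtain ⟨r', hrr', hr'1⟩ := exists_between hr1
  have hr'0 : 0 < r' := hr0.trans_lt hrr'
  have hq1 : r / r' < 1 := (div_lt_one hr'0).mpr hrr'
  have hq0 : 0 ≤ r / r' := div_nonneg hr0 hr'0.le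
  obtain ⟨C, hC⟩ := exists_nat_mul_pow_le hq0 hq1
  refine Summable.of_nonneg_of_le (fun n => by positivity) (fun n => ?_)
    ((hA r' hr'0.le hr'1).mul_left C)
  have hpow : r ^ n = (r / r') ^ n * r' ^ n := by
    rw [div_pow, div_mul_cancel₀]; exact pow_ne_zero _ hr'0.ne'
  calc (n : ℝ) * |A n| * r ^ n = ((n : ℝ) * (r / r') ^ n) * (|A n| * r' ^ n) := by rw [hpow]; ring
    _ ≤ C * (|A n| * r' ^ n) := by gcongr; exact hC n

/-- If `Σ |Aₙ| rⁿ < ∞` for every `0 ≤ r < 1`, then `Σ |A_{n+1}| rⁿ < ∞` for every `0 ≤ r < 1`.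
[folklore] -/
theorem summable_abs_succ_mul_pow
    (hA : ∀ r : ℝ, 0 ≤ r → r < 1 → Summable fun n => |A n| * r ^ n)
    {r : ℝ} (hr0 : 0 ≤ r) (hr1 : r < 1) :
    Summable fun n : ℕ => |A (n + 1)| * r ^ n := by
  obtain ⟨r', hrr', hr'1⟩ := exists_between hr1
  have hr'0 : 0 < r' := hr0.trans_lt hrr'
  have h1 : Summable fun n : ℕ => |A (n + 1)| * r' ^ (n + 1) :=
    (summable_nat_add_iff 1).mpr (hA r' hr'0.le hr'1)
  refine Summable.of_nonneg_of_le (fun n => by positivity) (fun n => ?_) (h1.mul_left r'⁻¹)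
  calc |A (n + 1)| * r ^ n ≤ |A (n + 1)| * r' ^ n := by gcongr
    _ = r'⁻¹ * (|A (n + 1)| * r' ^ (n + 1)) := by rw [pow_succ]; field_simp

/-- Stability of "radius at least one" under the termwise derivative `Aₙ ↦ (n+1) A_{n+1}`.
[folklore] -/
theorem summable_abs_deriv_coeff_mul_pow
    (hA : ∀ r : ℝ, 0 ≤ r → r < 1 → Summable fun n => |A n| * r ^ n) :
    ∀ r : ℝ, 0 ≤ r → r < 1 → Summable fun n : ℕ => |((n : ℝ) + 1) * A (n + 1)| * r ^ n := by
  intro r hr0 hr1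
  have hA' : ∀ r : ℝ, 0 ≤ r → r < 1 → Summable fun n : ℕ => |(n : ℝ) * A n| * r ^ n := by
    intro s hs0 hs1
    simpa only [abs_mul, Nat.abs_cast] using summable_nat_mul_abs_mul_pow hA hs0 hs1
  have := summable_abs_succ_mul_pow hA' hr0 hr1
  simpa only [Nat.cast_add, Nat.cast_one] using this

/-- A power series with `Σ |Aₙ| rⁿ < ∞` for all `0 ≤ r < 1` converges (absolutely) at every
`|x| < 1`. [folklore] -/
theorem summable_mul_pow_of_abs_lt_one
    (hA : ∀ r : ℝ, 0 ≤ r → r < 1 → Summable fun n => |A n| * r ^ n) {x : ℝ} (hx : |x| < 1) :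
    Summable fun n : ℕ => A n * x ^ n :=
  .of_norm <| by simpa only [Real.norm_eq_abs, abs_mul, abs_pow] using hA |x| (abs_nonneg x) hx

/-- `HasSum` form of `summable_mul_pow_of_abs_lt_one`. [folklore] -/
theorem hasSum_mul_pow_of_abs_lt_one
    (hA : ∀ r : ℝ, 0 ≤ r → r < 1 → Summable fun n => |A n| * r ^ n) {x : ℝ} (hx : |x| < 1) :
    HasSum (fun n : ℕ => A n * x ^ n) (∑' n : ℕ, A n * x ^ n) :=
  (summable_mul_pow_of_abs_lt_one hA hx).hasSum

/-- **Termwise differentiation** of a real power series with `Σ |Aₙ| rⁿ < ∞` (`0 ≤ r < 1`) at any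
`|x| < 1`: `(Σ Aₙ xⁿ)' = Σ (n+1) A_{n+1} xⁿ`. [folklore] -/
theorem hasDerivAt_tsum_mul_pow
    (hA : ∀ r : ℝ, 0 ≤ r → r < 1 → Summable fun n => |A n| * r ^ n) {x : ℝ} (hx : |x| < 1) :
    HasDerivAt (fun y => ∑' n : ℕ, A n * y ^ n)
      (∑' n : ℕ, ((n : ℝ) + 1) * A (n + 1) * x ^ n) x := by
  obtain ⟨r, hxr, hr1⟩ := exists_between (max_lt hx one_half_lt_one)
  have hr0 : 0 < r := one_half_pos.trans ((le_max_right _ _).trans_lt hxr)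
  have hxr' : |x| < r := (le_max_left _ _).trans_lt hxr
  have hu : Summable fun n : ℕ => |((n : ℝ) + 1) * A (n + 1)| * r ^ n :=
    summable_abs_deriv_coeff_mul_pow hA r hr0.le hr1
  have hderiv : ∀ n : ℕ, ∀ y ∈ Metric.ball (0 : ℝ) r,
      HasDerivAt (fun z => A (n + 1) * z ^ (n + 1)) (A (n + 1) * (((n : ℝ) + 1) * y ^ n)) y := by
    intro n y _
    have := (hasDerivAt_pow (n + 1) y).const_mul (A (n + 1))
    simpa [Nat.cast_add, Nat.cast_one, Nat.add_sub_cancel] using this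
  have hbound : ∀ n : ℕ, ∀ y ∈ Metric.ball (0 : ℝ) r,
      ‖A (n + 1) * (((n : ℝ) + 1) * y ^ n)‖ ≤ |((n : ℝ) + 1) * A (n + 1)| * r ^ n := by
    intro n y hy
    rw [Metric.mem_ball, dist_zero_right, Real.norm_eq_abs] at hy
    rw [Real.norm_eq_abs]
    calc |A (n + 1) * (((n : ℝ) + 1) * y ^ n)| = |((n : ℝ) + 1) * A (n + 1)| * |y| ^ n := by
          rw [abs_mul, abs_mul, abs_mul, abs_pow]; ring
      _ ≤ |((n : ℝ) + 1) * A (n + 1)| * r ^ n := by gcongr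
  have h0 : Summable fun n : ℕ => A (n + 1) * (0 : ℝ) ^ (n + 1) := by
    simp only [zero_pow (Nat.succ_ne_zero _), mul_zero]; exact summable_zero
  have hx_mem : x ∈ Metric.ball (0 : ℝ) r := by
    rwa [Metric.mem_ball, dist_zero_right, Real.norm_eq_abs]
  have hmain := hasDerivAt_tsum_of_isPreconnected hu Metric.isOpen_ball
    (convex_ball (0 : ℝ) r).isPreconnected hderiv hbound (Metric.mem_ball_self hr0) h0 hx_mem
  have hmain' := hmain.const_add (A 0)
  have heq : (fun y => ∑' n : ℕ, A n * y ^ n) =ᶠ[𝓝 x]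
      fun y => A 0 + ∑' n : ℕ, A (n + 1) * y ^ (n + 1) := by
    have : Metric.ball (0 : ℝ) r ∈ 𝓝 x := Metric.isOpen_ball.mem_nhds hx_mem
    filter_upwards [this] with y hy
    rw [Metric.mem_ball, dist_zero_right, Real.norm_eq_abs] at hy
    have hs := summable_mul_pow_of_abs_lt_one hA (hy.trans hr1)
    rw [hs.tsum_eq_zero_add]
    simp
  refine (hmain'.congr_of_eventuallyEq heq).congr_deriv ?_
  exact tsum_congr fun n => by ring

/-- **The hypergeometric differential equation from the coefficient recurrence**: if
`(n+1)(n+c) A_{n+1} = (n+a)(n+b) Aₙ` and `F₀ = Σ Aₙxⁿ`, `F₁ = Σ (n+1)A_{n+1}xⁿ`,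
`F₂ = Σ (n+1)(n+2)A_{n+2}xⁿ` (the series and its two termwise derivatives at `x`), then
`x(1−x)F₂ + [c − (a+b+1)x]F₁ − abF₀ = 0`. [cite: AndrewsAskeyRoy1999, (2.3.5)] -/
theorem hypergeometric_ode_of_hasSum {a b c x F₀ F₁ F₂ : ℝ}
    (hrec : ∀ n : ℕ, ((n : ℝ) + 1) * ((n : ℝ) + c) * A (n + 1) = ((n : ℝ) + a) * ((n : ℝ) + b) * A n)
    (h₀ : HasSum (fun n : ℕ => A n * x ^ n) F₀)
    (h₁ : HasSum (fun n : ℕ => ((n : ℝ) + 1) * A (n + 1) * x ^ n) F₁)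
    (h₂ : HasSum (fun n : ℕ => ((n : ℝ) + 1) * ((n : ℝ) + 2) * A (n + 2) * x ^ n) F₂) :
    x * (1 - x) * F₂ + (c - (a + b + 1) * x) * F₁ - a * b * F₀ = 0 := by
  -- realign `x F₂`, `x² F₂` and `x F₁` on the powers `x ^ m`
  set U : ℕ → ℝ := fun m => (m : ℝ) * ((m : ℝ) + 1) * A (m + 1) * x ^ m with hU_def
  set V : ℕ → ℝ := fun m => ((m : ℝ) - 1) * (m : ℝ) * A m * x ^ m with hV_def
  set W : ℕ → ℝ := fun m => (m : ℝ) * A m * x ^ m with hW_def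
  have hU' : HasSum (fun n => U (n + 1)) (x * F₂) := by
    have e : (fun n : ℕ => U (n + 1)) =
        fun n : ℕ => x * (((n : ℝ) + 1) * ((n : ℝ) + 2) * A (n + 2) * x ^ n) := by
      funext n
      rw [show n + 1 + 1 = n + 2 from rfl]
      simp only [hU_def, Nat.cast_add, Nat.cast_one, pow_succ]
      ring
    rw [e]; exact h₂.mul_left x
  have hU : HasSum U (x * F₂) := by
    have h := (hasSum_nat_add_iff 1).mp hU'
    simpa [hU_def] using h
  have hV' : HasSum (fun n => V (n + 2)) (x ^ 2 * F₂) := by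
    have e : (fun n : ℕ => V (n + 2)) =
        fun n : ℕ => x ^ 2 * (((n : ℝ) + 1) * ((n : ℝ) + 2) * A (n + 2) * x ^ n) := by
      funext n
      simp only [hV_def, Nat.cast_add, Nat.cast_ofNat, pow_add]
      ring
    rw [e]; exact h₂.mul_left (x ^ 2)
  have hV : HasSum V (x ^ 2 * F₂) := by
    have h := (hasSum_nat_add_iff 2).mp hV'
    simpa [hV_def, Finset.sum_range_succ] using h
  have hW' : HasSum (fun n => W (n + 1)) (x * F₁) := by
    have e : (fun n : ℕ => W (n + 1)) =
        fun n : ℕ => x * (((n : ℝ) + 1) * A (n + 1) * x ^ n) := by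
      funext n
      simp only [hW_def, Nat.cast_add, Nat.cast_one, pow_succ]
      ring
    rw [e]; exact h₁.mul_left x
  have hW : HasSum W (x * F₁) := by
    have h := (hasSum_nat_add_iff 1).mp hW'
    simpa [hW_def] using h
  have htot := (((hU.sub hV).add (h₁.mul_left c)).sub (hW.mul_left (a + b + 1))).sub
    (h₀.mul_left (a * b))
  have hzero : (fun m : ℕ => U m - V m + c * (((m : ℝ) + 1) * A (m + 1) * x ^ m) -
      (a + b + 1) * W m - a * b * (A m * x ^ m)) = fun _ => 0 := by
    funext m
    have := hrec m
    simp only [hU_def, hV_def, hW_def]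
    linear_combination (x ^ m) * this
  rw [hzero] at htot
  have := htot.unique hasSum_zero
  linear_combination this

end PowerSeries

/-! ### The real hypergeometric function `₂F₁(a,b;c;x)` on `|x| < 1` -/

section Hypergeometric

variable (a b c : ℝ)

/-- The radius of convergence of the real hypergeometric series `₂F₁(a,b;c;·)` is at least `1`
for all real parameters (Mathlib: `= 1` when no parameter is a non-positive integer, `= ⊤`
otherwise). [cite: AndrewsAskeyRoy1999, §2.1] -/
theorem one_le_ordinaryHypergeometricSeries_radius :
    1 ≤ (ordinaryHypergeometricSeries ℝ a b c).radius := by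
  by_cases h : ∀ kn : ℕ, (kn : ℝ) ≠ -a ∧ (kn : ℝ) ≠ -b ∧ (kn : ℝ) ≠ -c
  · rw [ordinaryHypergeometricSeries_radius_eq_one ℝ a b c h]
  · push Not at h
    obtain ⟨k, hk⟩ := h
    by_cases ha : (k : ℝ) = -a
    · obtain rfl : a = -(k : ℝ) := by linarith
      rw [ordinaryHypergeometric_radius_top_of_neg_nat₁]; exact le_top
    by_cases hb : (k : ℝ) = -b
    · obtain rfl : b = -(k : ℝ) := by linarith
      rw [ordinaryHypergeometric_radius_top_of_neg_nat₂]; exact le_top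
    · obtain rfl : c = -(k : ℝ) := by linarith [hk ha hb]
      rw [ordinaryHypergeometric_radius_top_of_neg_nat₃]; exact le_top

/-- `₂F₁(a,b;c;x) = Σₙ Aₙ xⁿ` with `Aₙ = (a)ₙ(b)ₙ/((c)ₙ n!)` (Mathlib's
`ordinaryHypergeometricCoefficient`), as real `tsum`s (both sides junk `0` where the series
diverges). [cite: AndrewsAskeyRoy1999, §2.1] -/
theorem ordinaryHypergeometric_eq_tsum_mul_pow (x : ℝ) :
    ordinaryHypergeometric a b c x =
      ∑' n : ℕ, ordinaryHypergeometricCoefficient a b c n * x ^ n := by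
  rw [ordinaryHypergeometric, ordinaryHypergeometric_sum_eq]
  rfl

/-- The norm of the `n`-th term of the hypergeometric formal series is `|Aₙ|`. [folklore] -/
theorem norm_ordinaryHypergeometricSeries (n : ℕ) :
    ‖ordinaryHypergeometricSeries ℝ a b c n‖ = |ordinaryHypergeometricCoefficient a b c n| := by
  rw [ordinaryHypergeometricSeries, ofScalars_norm, Real.norm_eq_abs]

/-- Absolute convergence of the real hypergeometric series strictly inside the unit disc: for
every `0 ≤ r < 1`, `Σ |Aₙ| rⁿ < ∞`. [cite: AndrewsAskeyRoy1999, §2.1] -/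
theorem summable_abs_ordinaryHypergeometricCoefficient_mul_pow :
    ∀ r : ℝ, 0 ≤ r → r < 1 →
      Summable fun n : ℕ => |ordinaryHypergeometricCoefficient a b c n| * r ^ n := by
  intro r hr₀ hr
  lift r to ℝ≥0 using hr₀
  have h : (r : ℝ≥0∞) < (ordinaryHypergeometricSeries ℝ a b c).radius :=
    lt_of_lt_of_le (by exact_mod_cast hr) (one_le_ordinaryHypergeometricSeries_radius a b c)
  refine ((ordinaryHypergeometricSeries ℝ a b c).summable_norm_mul_pow h).congr fun n => ?_
  rw [norm_ordinaryHypergeometricSeries]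

/-- For `|x| < 1` the hypergeometric series converges to `₂F₁(a,b;c;x)`.
[cite: AndrewsAskeyRoy1999, §2.1] -/
theorem hasSum_ordinaryHypergeometric {x : ℝ} (hx : |x| < 1) :
    HasSum (fun n : ℕ => ordinaryHypergeometricCoefficient a b c n * x ^ n)
      (ordinaryHypergeometric a b c x) := by
  rw [ordinaryHypergeometric_eq_tsum_mul_pow]
  exact hasSum_mul_pow_of_abs_lt_one (summable_abs_ordinaryHypergeometricCoefficient_mul_pow a b c) hx

/-- `₂F₁(a,b;c;·)` is continuous on `|x| < 1`. [cite: AndrewsAskeyRoy1999, §2.1] -/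
theorem continuousOn_ordinaryHypergeometric :
    ContinuousOn (ordinaryHypergeometric a b c) (Metric.ball (0 : ℝ) 1) := by
  intro x hx
  rw [Metric.mem_ball, dist_zero_right, Real.norm_eq_abs] at hx
  have h := (hasDerivAt_tsum_mul_pow
    (summable_abs_ordinaryHypergeometricCoefficient_mul_pow a b c) hx).continuousAt
  have hfun : (fun y => ∑' n : ℕ, ordinaryHypergeometricCoefficient a b c n * y ^ n) =
      ordinaryHypergeometric a b c := by
    funext y; rw [ordinaryHypergeometric_eq_tsum_mul_pow]
  rw [hfun] at h
  exact h.continuousWithinAt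

/-- The coefficient identity behind `d/dx ₂F₁(a,b;c;x) = (ab/c) ₂F₁(a+1,b+1;c+1;x)`:
`(n+1) A_{n+1}(a,b,c) = (ab/c) A_n(a+1,b+1,c+1)` (no hypothesis: both sides vanish with `c`
under Mathlib's `0⁻¹ = 0`). [cite: AndrewsAskeyRoy1999, (2.5.1)] -/
theorem succ_mul_ordinaryHypergeometricCoefficient_succ (n : ℕ) :
    ((n : ℝ) + 1) * ordinaryHypergeometricCoefficient a b c (n + 1) =
      a * b / c * ordinaryHypergeometricCoefficient (a + 1) (b + 1) (c + 1) n := by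
  simp only [ordinaryHypergeometricCoefficient, ascPochhammer_succ_left, Polynomial.eval_mul,
    Polynomial.eval_X, Polynomial.eval_comp, Polynomial.eval_add, Polynomial.eval_one,
    Nat.factorial_succ, Nat.cast_mul, Nat.cast_add, Nat.cast_one, mul_inv]
  have hn : ((n : ℝ) + 1) * ((n : ℝ) + 1)⁻¹ = 1 := mul_inv_cancel₀ (by positivity)
  calc ((n : ℝ) + 1) * (((n : ℝ) + 1)⁻¹ * ((n.factorial : ℝ))⁻¹ *
        (a * Polynomial.eval (a + 1) (ascPochhammer ℝ n)) *
        (b * Polynomial.eval (b + 1) (ascPochhammer ℝ n)) *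
        (c⁻¹ * (Polynomial.eval (c + 1) (ascPochhammer ℝ n))⁻¹))
      = (((n : ℝ) + 1) * ((n : ℝ) + 1)⁻¹) * (a * b * c⁻¹ * (((n.factorial : ℝ))⁻¹ *
        Polynomial.eval (a + 1) (ascPochhammer ℝ n) * Polynomial.eval (b + 1) (ascPochhammer ℝ n) *
        (Polynomial.eval (c + 1) (ascPochhammer ℝ n))⁻¹)) := by ring
    _ = _ := by rw [hn, one_mul, div_eq_mul_inv]

/-- The coefficient recurrence `(n+1)(n+c) A_{n+1} = (n+a)(n+b) A_n` of the hypergeometric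
series (valid as long as `c + n ≠ 0`). [cite: AndrewsAskeyRoy1999, §2.3 (series solution of (2.3.5))] -/
theorem ordinaryHypergeometricCoefficient_succ_rec (n : ℕ) (hc : (n : ℝ) + c ≠ 0) :
    ((n : ℝ) + 1) * ((n : ℝ) + c) * ordinaryHypergeometricCoefficient a b c (n + 1) =
      ((n : ℝ) + a) * ((n : ℝ) + b) * ordinaryHypergeometricCoefficient a b c n := by
  simp only [ordinaryHypergeometricCoefficient, ascPochhammer_succ_eval, Nat.factorial_succ,
    Nat.cast_mul, Nat.cast_add, Nat.cast_one, mul_inv]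
  have hn : ((n : ℝ) + 1) * ((n : ℝ) + 1)⁻¹ = 1 := mul_inv_cancel₀ (by positivity)
  have hc' : ((n : ℝ) + c) * (c + (n : ℝ))⁻¹ = 1 := by rw [add_comm c]; exact mul_inv_cancel₀ hc
  calc ((n : ℝ) + 1) * ((n : ℝ) + c) * (((n : ℝ) + 1)⁻¹ * ((n.factorial : ℝ))⁻¹ *
        (Polynomial.eval a (ascPochhammer ℝ n) * (a + n)) *
        (Polynomial.eval b (ascPochhammer ℝ n) * (b + n)) *
        ((Polynomial.eval c (ascPochhammer ℝ n))⁻¹ * (c + (n : ℝ))⁻¹))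
      = (((n : ℝ) + 1) * ((n : ℝ) + 1)⁻¹) * (((n : ℝ) + c) * (c + (n : ℝ))⁻¹) *
        (((n : ℝ) + a) * ((n : ℝ) + b) * (((n.factorial : ℝ))⁻¹ *
        Polynomial.eval a (ascPochhammer ℝ n) * Polynomial.eval b (ascPochhammer ℝ n) *
        (Polynomial.eval c (ascPochhammer ℝ n))⁻¹)) := by ring
    _ = _ := by rw [hn, hc', one_mul, one_mul]

variable {a b c}

/-- **`d/dx ₂F₁(a,b;c;x) = (ab/c) ₂F₁(a+1,b+1;c+1;x)`** for real parameters and real `|x| < 1`.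
[cite: AndrewsAskeyRoy1999, (2.5.1)] -/
theorem hasDerivAt_ordinaryHypergeometric {x : ℝ} (hx : |x| < 1) :
    HasDerivAt (ordinaryHypergeometric a b c)
      (a * b / c * ordinaryHypergeometric (a + 1) (b + 1) (c + 1) x) x := by
  have h := hasDerivAt_tsum_mul_pow (summable_abs_ordinaryHypergeometricCoefficient_mul_pow a b c) hx
  have hfun : (fun y => ∑' n : ℕ, ordinaryHypergeometricCoefficient a b c n * y ^ n) =
      ordinaryHypergeometric a b c := by
    funext y; rw [ordinaryHypergeometric_eq_tsum_mul_pow]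
  rw [hfun] at h
  refine h.congr_deriv ?_
  rw [ordinaryHypergeometric_eq_tsum_mul_pow, ← tsum_mul_left]
  refine tsum_congr fun n => ?_
  rw [succ_mul_ordinaryHypergeometricCoefficient_succ, mul_assoc]

/-- `deriv` form of the derivative formula (2.5.1). [cite: AndrewsAskeyRoy1999, (2.5.1)] -/
theorem deriv_ordinaryHypergeometric {x : ℝ} (hx : |x| < 1) :
    deriv (ordinaryHypergeometric a b c) x =
      a * b / c * ordinaryHypergeometric (a + 1) (b + 1) (c + 1) x :=
  (hasDerivAt_ordinaryHypergeometric hx).deriv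

end Hypergeometric

/-! ### The Legendre function `P_ν`: continuity, derivatives, differential equation -/

section Legendre

/-- `-1 < ξ < 3 ↔ |(1-ξ)/2| < 1`: the hypergeometric variable of `P_ν` lies in the unit disc.
[folklore] -/
theorem abs_half_sub_lt_one {ξ : ℝ} (h1 : -1 < ξ) (h3 : ξ < 3) : |(1 - ξ) / 2| < 1 := by
  rw [abs_lt]; constructor <;> linarith

/-- Murphy's series: `P_ν(ξ) = Σₙ (−ν)ₙ(ν+1)ₙ/(n!)² ((1−ξ)/2)ⁿ` (as `tsum`s).
[cite: WhittakerWatson1927, §15.22] -/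
theorem legendreP_eq_tsum (ν ξ : ℝ) :
    legendreP ν ξ = ∑' n : ℕ,
      ordinaryHypergeometricCoefficient (-ν) (ν + 1) 1 n * ((1 - ξ) / 2) ^ n :=
  ordinaryHypergeometric_eq_tsum_mul_pow _ _ _ _

/-- `P_ν` is continuous on `(−1, 3)` (where `|1−ξ| < 2`). [cite: WhittakerWatson1927, §15.22] -/
theorem continuousOn_legendreP (ν : ℝ) : ContinuousOn (legendreP ν) (Set.Ioo (-1) 3) := by
  have hg : Continuous fun ξ : ℝ => (1 - ξ) / 2 := by fun_prop
  refine (continuousOn_ordinaryHypergeometric (-ν) (ν + 1) 1).comp hg.continuousOn ?_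
  intro ξ hξ
  rw [Metric.mem_ball, dist_zero_right, Real.norm_eq_abs]
  exact abs_half_sub_lt_one hξ.1 hξ.2

/-- `P_ν` is continuous on `[0, 1]`. [cite: WhittakerWatson1927, §15.22] -/
theorem continuousOn_legendreP_Icc (ν : ℝ) : ContinuousOn (legendreP ν) (Set.Icc 0 1) :=
  (continuousOn_legendreP ν).mono (Set.Icc_subset_Ioo (by norm_num) (by norm_num))

/-- `P_ν P_σ` is integrable on `[0, 1]`. [folklore] -/
theorem intervalIntegrable_legendreP_mul (ν σ : ℝ) :
    IntervalIntegrable (fun ξ => legendreP ν ξ * legendreP σ ξ) MeasureTheory.volume 0 1 :=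
  ((continuousOn_legendreP_Icc ν).mul (continuousOn_legendreP_Icc σ)).intervalIntegrable_of_Icc
    zero_le_one

/-- `P_ν²` is integrable on `[0, 1]` (the integral in (Pnu_sqr_0to1) is a genuine one).
[cite: Zhou2015, Remark 9] -/
theorem intervalIntegrable_legendreP_sq (ν : ℝ) :
    IntervalIntegrable (fun ξ => legendreP ν ξ ^ 2) MeasureTheory.volume 0 1 := by
  simpa only [sq] using intervalIntegrable_legendreP_mul ν ν

/-- The coefficient recurrence of Murphy's series: `(n+1)² A_{n+1} = (n−ν)(n+ν+1) A_n`.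
[cite: WhittakerWatson1927, §15.22] -/
theorem legendre_coeff_rec (ν : ℝ) (n : ℕ) :
    ((n : ℝ) + 1) * ((n : ℝ) + 1) * ordinaryHypergeometricCoefficient (-ν) (ν + 1) 1 (n + 1) =
      ((n : ℝ) + -ν) * ((n : ℝ) + (ν + 1)) * ordinaryHypergeometricCoefficient (-ν) (ν + 1) 1 n :=
  ordinaryHypergeometricCoefficient_succ_rec (-ν) (ν + 1) 1 n (by positivity)

/-- `P_ν(ξ)`, `P_ν'(ξ)` and `P_ν''(ξ)` through Murphy's series and its two termwise derivatives at
`x = (1 − ξ)/2`, for `−1 < ξ < 3`: `P_ν = F₀`, `P_ν' = −F₁/2`, `P_ν'' = F₂/4`.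
[cite: WhittakerWatson1927, §15.22] -/
theorem legendreP_deriv_data {ν ξ : ℝ} (h1 : -1 < ξ) (h3 : ξ < 3) :
    ∃ F₀ F₁ F₂ : ℝ,
      HasSum (fun n : ℕ => ordinaryHypergeometricCoefficient (-ν) (ν + 1) 1 n *
        ((1 - ξ) / 2) ^ n) F₀ ∧
      HasSum (fun n : ℕ => ((n : ℝ) + 1) *
        ordinaryHypergeometricCoefficient (-ν) (ν + 1) 1 (n + 1) * ((1 - ξ) / 2) ^ n) F₁ ∧
      HasSum (fun n : ℕ => ((n : ℝ) + 1) * ((n : ℝ) + 2) *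
        ordinaryHypergeometricCoefficient (-ν) (ν + 1) 1 (n + 2) * ((1 - ξ) / 2) ^ n) F₂ ∧
      legendreP ν ξ = F₀ ∧
      HasDerivAt (legendreP ν) (-(1 / 2) * F₁) ξ ∧
      HasDerivAt (deriv (legendreP ν)) ((1 / 4) * F₂) ξ := by
  set A : ℕ → ℝ := ordinaryHypergeometricCoefficient (-ν) (ν + 1) 1 with hA_def
  set A₁ : ℕ → ℝ := fun n => ((n : ℝ) + 1) * A (n + 1) with hA₁_def
  have hA : ∀ r : ℝ, 0 ≤ r → r < 1 → Summable fun n => |A n| * r ^ n :=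
    summable_abs_ordinaryHypergeometricCoefficient_mul_pow _ _ _
  have hA₁ : ∀ r : ℝ, 0 ≤ r → r < 1 → Summable fun n => |A₁ n| * r ^ n :=
    summable_abs_deriv_coeff_mul_pow hA
  -- the change of variable
  set g : ℝ → ℝ := fun η => (1 - η) / 2 with hg_def
  have hg : ∀ η, HasDerivAt g (-1 / 2) η := fun η => by
    simpa [hg_def] using ((hasDerivAt_id η).const_sub 1).div_const 2
  have hgx : ∀ {η}, -1 < η → η < 3 → |g η| < 1 := fun h1 h3 => abs_half_sub_lt_one h1 h3
  -- the three series
  set F₀ : ℝ → ℝ := fun y => ∑' n : ℕ, A n * y ^ n with hF₀_def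
  set F₁ : ℝ → ℝ := fun y => ∑' n : ℕ, ((n : ℝ) + 1) * A (n + 1) * y ^ n with hF₁_def
  set F₂ : ℝ → ℝ := fun y => ∑' n : ℕ, ((n : ℝ) + 1) * A₁ (n + 1) * y ^ n with hF₂_def
  have hP : legendreP ν = F₀ ∘ g := by
    funext η; simp only [Function.comp_apply, hF₀_def, hg_def, hA_def]; exact legendreP_eq_tsum ν η
  have hd₀ : ∀ {y}, |y| < 1 → HasDerivAt F₀ (F₁ y) y := fun hy => hasDerivAt_tsum_mul_pow hA hy
  have hd₁ : ∀ {y}, |y| < 1 → HasDerivAt F₁ (F₂ y) y := fun hy => by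
    have := hasDerivAt_tsum_mul_pow hA₁ hy
    simpa only [hA₁_def] using this
  -- first derivative of `P_ν` on `(-1, 3)`
  have hP' : ∀ {η}, -1 < η → η < 3 → HasDerivAt (legendreP ν) (-(1 / 2) * F₁ (g η)) η := by
    intro η h1 h3
    rw [hP]
    exact ((hd₀ (hgx h1 h3)).comp η (hg η)).congr_deriv (by ring)
  -- second derivative
  have hP'' : HasDerivAt (deriv (legendreP ν)) ((1 / 4) * F₂ (g ξ)) ξ := by
    have heq : (fun η => -(1 / 2) * F₁ (g η)) =ᶠ[𝓝 ξ] deriv (legendreP ν) := by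
      filter_upwards [Ioo_mem_nhds h1 h3] with η hη
      exact ((hP' hη.1 hη.2).deriv).symm
    have h := (((hd₁ (hgx h1 h3)).comp ξ (hg ξ)).const_mul (-(1 / 2))).congr_of_eventuallyEq heq.symm
    exact h.congr_deriv (by ring)
  refine ⟨F₀ (g ξ), F₁ (g ξ), F₂ (g ξ), ?_, ?_, ?_, ?_, hP' h1 h3, hP''⟩
  · exact hasSum_mul_pow_of_abs_lt_one hA (hgx h1 h3)
  · exact hasSum_mul_pow_of_abs_lt_one hA₁ (hgx h1 h3)
  · have h := hasSum_mul_pow_of_abs_lt_one (summable_abs_deriv_coeff_mul_pow hA₁) (hgx h1 h3)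
    convert h using 2 with n
    rw [show n + 2 = n + 1 + 1 from rfl]
    simp only [hA₁_def, Nat.cast_add, Nat.cast_one]
    ring
  · rw [hP]; rfl

/-- `P_ν` is differentiable on `(−1, 3)`. [cite: WhittakerWatson1927, §15.2] -/
theorem differentiableAt_legendreP {ν ξ : ℝ} (h1 : -1 < ξ) (h3 : ξ < 3) :
    DifferentiableAt ℝ (legendreP ν) ξ := by
  obtain ⟨_, _, _, -, -, -, -, h, -⟩ := legendreP_deriv_data (ν := ν) h1 h3
  exact h.differentiableAt

/-- `P_ν'` is differentiable on `(−1, 3)`. [cite: WhittakerWatson1927, §15.2] -/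
theorem hasDerivAt_deriv_legendreP {ν ξ : ℝ} (h1 : -1 < ξ) (h3 : ξ < 3) :
    HasDerivAt (deriv (legendreP ν)) (deriv (deriv (legendreP ν)) ξ) ξ := by
  obtain ⟨_, _, _, -, -, -, -, -, h⟩ := legendreP_deriv_data (ν := ν) h1 h3
  exact h.differentiableAt.hasDerivAt

/-- **Legendre's differential equation** for `P_ν` of arbitrary real degree on `(−1, 3)`:
`(1 − ξ²) P_ν'' − 2ξ P_ν' + ν(ν+1) P_ν = 0`. [cite: WhittakerWatson1927, §15.13 and §15.2] -/
theorem legendreP_ode {ν ξ : ℝ} (h1 : -1 < ξ) (h3 : ξ < 3) :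
    (1 - ξ ^ 2) * deriv (deriv (legendreP ν)) ξ - 2 * ξ * deriv (legendreP ν) ξ +
      ν * (ν + 1) * legendreP ν ξ = 0 := by
  obtain ⟨F₀, F₁, F₂, h₀, h₁, h₂, hP, hP', hP''⟩ := legendreP_deriv_data (ν := ν) h1 h3
  have hode := hypergeometric_ode_of_hasSum (legendre_coeff_rec ν) h₀ h₁ h₂
  rw [hP, hP'.deriv, hP''.deriv]
  linear_combination hode

/-- The self-adjoint form of Legendre's equation: `d/dξ [(1 − ξ²) P_ν'(ξ)] = −ν(ν+1) P_ν(ξ)` on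
`(−1, 3)`. [cite: WhittakerWatson1927, §15.13] -/
theorem hasDerivAt_one_sub_sq_mul_deriv_legendreP {ν ξ : ℝ} (h1 : -1 < ξ) (h3 : ξ < 3) :
    HasDerivAt (fun η => (1 - η ^ 2) * deriv (legendreP ν) η)
      (-(ν * (ν + 1)) * legendreP ν ξ) ξ := by
  have hq : HasDerivAt (fun η : ℝ => 1 - η ^ 2) (-(2 * ξ)) ξ := by
    simpa using (hasDerivAt_pow 2 ξ).const_sub 1
  have h := hq.mul (hasDerivAt_deriv_legendreP (ν := ν) h1 h3)
  refine h.congr_deriv ?_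
  linear_combination legendreP_ode (ν := ν) h1 h3

/-- **Green's formula for two Legendre functions on `[0, 1]`**:
`(σ−ν)(σ+ν+1) ∫₀¹ P_ν P_σ dξ = P_ν(0) P_σ'(0) − P_σ(0) P_ν'(0)` — integrate
`(W)' = (ν(ν+1) − σ(σ+1)) P_ν P_σ`, `W = (1−ξ²)(P_σ' P_ν − P_ν' P_σ)`, over `[0,1]`; the boundary
term at `ξ = 1` vanishes with `1 − ξ²`. This is the "simple application of the Legendre
differential equations" behind Zhou's (Pnu_sqr_0to1) (let `σ → ν`). [cite: Zhou2015, Remark 9 (arXiv p. 19)] -/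
theorem integral_legendreP_mul_legendreP (ν σ : ℝ) :
    (σ - ν) * (σ + ν + 1) * ∫ ξ in (0 : ℝ)..1, legendreP ν ξ * legendreP σ ξ =
      legendreP ν 0 * deriv (legendreP σ) 0 - legendreP σ 0 * deriv (legendreP ν) 0 := by
  -- the Wronskian `W = (1-ξ²) P_σ' P_ν - (1-ξ²) P_ν' P_σ`
  set W : ℝ → ℝ := fun ξ => (1 - ξ ^ 2) * deriv (legendreP σ) ξ * legendreP ν ξ -
    (1 - ξ ^ 2) * deriv (legendreP ν) ξ * legendreP σ ξ with hW_def
  have hW : ∀ ξ ∈ Set.uIcc (0 : ℝ) 1, HasDerivAt W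
      ((ν * (ν + 1) - σ * (σ + 1)) * (legendreP ν ξ * legendreP σ ξ)) ξ := by
    intro ξ hξ
    rw [Set.uIcc_of_le zero_le_one] at hξ
    have h1 : (-1 : ℝ) < ξ := by linarith [hξ.1]
    have h3 : ξ < 3 := by linarith [hξ.2]
    have hν := hasDerivAt_one_sub_sq_mul_deriv_legendreP (ν := ν) h1 h3
    have hσ := hasDerivAt_one_sub_sq_mul_deriv_legendreP (ν := σ) h1 h3
    have hPν := (differentiableAt_legendreP (ν := ν) h1 h3).hasDerivAt
    have hPσ := (differentiableAt_legendreP (ν := σ) h1 h3).hasDerivAt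
    have h := (hσ.mul hPν).sub (hν.mul hPσ)
    have hfun : W = (fun η => (1 - η ^ 2) * deriv (legendreP σ) η) * legendreP ν -
        (fun η => (1 - η ^ 2) * deriv (legendreP ν) η) * legendreP σ := by
      funext η; simp only [hW_def, Pi.sub_apply, Pi.mul_apply]
    rw [hfun]
    exact h.congr_deriv (by ring)
  have hint : IntervalIntegrable (fun ξ => (ν * (ν + 1) - σ * (σ + 1)) *
      (legendreP ν ξ * legendreP σ ξ)) MeasureTheory.volume 0 1 :=
    (intervalIntegrable_legendreP_mul ν σ).const_mul _
  have hftc := intervalIntegral.integral_eq_sub_of_hasDerivAt hW hint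
  rw [intervalIntegral.integral_const_mul] at hftc
  have hW1 : W 1 = 0 := by simp [hW_def]
  have hW0 : W 0 = deriv (legendreP σ) 0 * legendreP ν 0 - deriv (legendreP ν) 0 * legendreP σ 0 := by
    simp [hW_def]
  rw [hW1, hW0] at hftc
  linear_combination -hftc

end Legendre


/-! ### Contiguity: `P'_{ν+1} − ξ P'_ν = (ν+1) P_ν`, symmetry `P_{−ν−1} = P_ν` -/

/-- Reading the Pochhammer symbol `(k)_{n+1}` from either end:
`(k)_n (k + n) = k (k+1)_n`. [folklore] -/
theorem ascPochhammer_eval_mul_add (k : ℝ) (n : ℕ) :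
    (ascPochhammer ℝ n).eval k * (k + n) = k * (ascPochhammer ℝ n).eval (k + 1) := by
  rw [← ascPochhammer_succ_eval]
  rw [ascPochhammer_succ_left, Polynomial.eval_mul, Polynomial.eval_X, Polynomial.eval_comp,
    Polynomial.eval_add, Polynomial.eval_X, Polynomial.eval_one]

/-- Degree shift of Murphy's coefficients: `(ν+1−n) Aₙ(ν+1) = (n+ν+1) Aₙ(ν)`.
[cite: WhittakerWatson1927, §15.21] -/
theorem legendre_coeff_shift (ν : ℝ) (n : ℕ) :
    (ν + 1 - n) * ordinaryHypergeometricCoefficient (-(ν + 1)) (ν + 1 + 1) 1 n =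
      ((n : ℝ) + ν + 1) * ordinaryHypergeometricCoefficient (-ν) (ν + 1) 1 n := by
  have R1 := ascPochhammer_eval_mul_add (-(ν + 1)) n
  have R2 := ascPochhammer_eval_mul_add (ν + 1) n
  rw [show -(ν + 1) + 1 = -ν by ring] at R1
  simp only [ordinaryHypergeometricCoefficient]
  linear_combination ((n.factorial : ℝ))⁻¹ * (Polynomial.eval 1 (ascPochhammer ℝ n))⁻¹ *
    (-(Polynomial.eval (ν + 1 + 1) (ascPochhammer ℝ n)) * R1 -
      Polynomial.eval (-ν) (ascPochhammer ℝ n) * R2)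

/-- The coefficient identity behind `P'_{ν+1} − ξP'_ν = (ν+1)P_ν`:
`(n+1) A_{n+1}(ν+1) = (n+1) A_{n+1}(ν) − 2(n+ν+1) Aₙ(ν)`. [cite: WhittakerWatson1927, §15.21] -/
theorem legendre_coeff_contiguous (ν : ℝ) (n : ℕ) :
    ((n : ℝ) + 1) * ordinaryHypergeometricCoefficient (-(ν + 1)) (ν + 1 + 1) 1 (n + 1) =
      ((n : ℝ) + 1) * ordinaryHypergeometricCoefficient (-ν) (ν + 1) 1 (n + 1) -
        2 * ((n : ℝ) + ν + 1) * ordinaryHypergeometricCoefficient (-ν) (ν + 1) 1 n := by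
  have hrec := legendre_coeff_rec ν n
  have hrec' := legendre_coeff_rec (ν + 1) n
  have hshift := legendre_coeff_shift ν n
  have hn : ((n : ℝ) + 1) ≠ 0 := by positivity
  have key : ((n : ℝ) + 1) * (((n : ℝ) + 1) *
      ordinaryHypergeometricCoefficient (-(ν + 1)) (ν + 1 + 1) 1 (n + 1) -
      (((n : ℝ) + 1) * ordinaryHypergeometricCoefficient (-ν) (ν + 1) 1 (n + 1) -
        2 * ((n : ℝ) + ν + 1) * ordinaryHypergeometricCoefficient (-ν) (ν + 1) 1 n)) = 0 := by
    linear_combination hrec' - hrec - ((n : ℝ) + ν + 2) * hshift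
  have := (mul_eq_zero.mp key).resolve_left hn
  linarith

/-- Series form of the contiguous relation: with `F₀ = Σ Aₙ(ν)xⁿ`, `F₁ = Σ (n+1)A_{n+1}(ν)xⁿ` and
`G₁ = Σ (n+1)A_{n+1}(ν+1)xⁿ`, one has `G₁ = (1 − 2x)F₁ − 2(ν+1)F₀`. [cite: WhittakerWatson1927, §15.21] -/
theorem legendre_contiguous_of_hasSum {ν x F₀ F₁ G₁ : ℝ}
    (h₀ : HasSum (fun n : ℕ => ordinaryHypergeometricCoefficient (-ν) (ν + 1) 1 n * x ^ n) F₀)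
    (h₁ : HasSum (fun n : ℕ => ((n : ℝ) + 1) *
      ordinaryHypergeometricCoefficient (-ν) (ν + 1) 1 (n + 1) * x ^ n) F₁)
    (h₁' : HasSum (fun n : ℕ => ((n : ℝ) + 1) *
      ordinaryHypergeometricCoefficient (-(ν + 1)) (ν + 1 + 1) 1 (n + 1) * x ^ n) G₁) :
    G₁ = (1 - 2 * x) * F₁ - 2 * (ν + 1) * F₀ := by
  set A : ℕ → ℝ := ordinaryHypergeometricCoefficient (-ν) (ν + 1) 1 with hA_def
  set W : ℕ → ℝ := fun m => (m : ℝ) * A m * x ^ m with hW_def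
  have hW' : HasSum (fun n => W (n + 1)) (x * F₁) := by
    have e : (fun n : ℕ => W (n + 1)) =
        fun n : ℕ => x * (((n : ℝ) + 1) * A (n + 1) * x ^ n) := by
      funext n
      simp only [hW_def, Nat.cast_add, Nat.cast_one, pow_succ]
      ring
    rw [e]; exact h₁.mul_left x
  have hW : HasSum W (x * F₁) := by
    have h := (hasSum_nat_add_iff 1).mp hW'
    simpa [hW_def] using h
  have htot := (h₁.sub (hW.mul_left 2)).sub (h₀.mul_left (2 * (ν + 1)))
  have hfun : (fun n : ℕ => ((n : ℝ) + 1) * A (n + 1) * x ^ n - 2 * W n -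
      2 * (ν + 1) * (A n * x ^ n)) = fun n : ℕ => ((n : ℝ) + 1) *
      ordinaryHypergeometricCoefficient (-(ν + 1)) (ν + 1 + 1) 1 (n + 1) * x ^ n := by
    funext n
    simp only [hW_def, hA_def]
    have := legendre_coeff_contiguous ν n
    linear_combination (-(x ^ n)) * this
  rw [hfun] at htot
  have := h₁'.unique htot
  linear_combination this

/-- **Contiguous relation** `P'_{ν+1}(ξ) − ξ P'_ν(ξ) = (ν+1) P_ν(ξ)` on `(−1, 3)`, for every real
degree. [cite: WhittakerWatson1927, §15.21] -/
theorem deriv_legendreP_succ_sub {ν ξ : ℝ} (h1 : -1 < ξ) (h3 : ξ < 3) :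
    deriv (legendreP (ν + 1)) ξ - ξ * deriv (legendreP ν) ξ = (ν + 1) * legendreP ν ξ := by
  obtain ⟨F₀, F₁, F₂, h₀, h₁, -, hP, hP', -⟩ := legendreP_deriv_data (ν := ν) h1 h3
  obtain ⟨G₀, G₁, G₂, -, g₁, -, -, hQ', -⟩ := legendreP_deriv_data (ν := ν + 1) h1 h3
  have key := legendre_contiguous_of_hasSum h₀ h₁ g₁
  rw [hP, hP'.deriv, hQ'.deriv, key]
  ring

/-- At `ξ = 0`: `P'_{ν+1}(0) = (ν+1) P_ν(0)`. [cite: WhittakerWatson1927, §15.21] -/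
theorem deriv_legendreP_succ_zero (ν : ℝ) :
    deriv (legendreP (ν + 1)) 0 = (ν + 1) * legendreP ν 0 := by
  have := deriv_legendreP_succ_sub (ν := ν) (ξ := 0) (by norm_num) (by norm_num)
  simpa using this

/-- `P'_σ(0) = σ P_{σ−1}(0)`. [cite: WhittakerWatson1927, §15.21] -/
theorem deriv_legendreP_zero (σ : ℝ) :
    deriv (legendreP σ) 0 = σ * legendreP (σ - 1) 0 := by
  have := deriv_legendreP_succ_zero (σ - 1)
  rwa [sub_add_cancel] at this

/-- The degree symmetry `P_{−ν−1} = P_ν` (Murphy's series is symmetric under `ν ↦ −ν−1`).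
[cite: WhittakerWatson1927, §15.22 (Corollary 15.2.1)] -/
theorem legendreP_neg_sub_one (ν : ℝ) : legendreP (-ν - 1) = legendreP ν := by
  funext ξ
  rw [legendreP_def, legendreP_def, ordinaryHypergeometric, ordinaryHypergeometric,
    show -(-ν - 1) = ν + 1 by ring, show -ν - 1 + 1 = -ν by ring,
    ordinaryHypergeometricSeries_symm]


/-! ### Euler's integral representation of `₂F₁` -/

/-- **Binomial series** in Pochhammer form: `(1 − y)^{−a} = Σₙ (a)ₙ/n! · yⁿ` for real `a` and
`|y| < 1`. [cite: AndrewsAskeyRoy1999, §2.1] -/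
theorem hasSum_one_sub_rpow_neg (a : ℝ) {y : ℝ} (hy : |y| < 1) :
    HasSum (fun n : ℕ => (n.factorial : ℝ)⁻¹ * (ascPochhammer ℝ n).eval a * y ^ n)
      ((1 - y) ^ (-a)) := by
  have hps := Real.one_add_rpow_hasFPowerSeriesOnBall_zero (a := -a)
  have h1 : ∀ k : ℕ, (k : ℝ) ≠ -1 := fun k =>
    (by have := (Nat.cast_nonneg k : (0 : ℝ) ≤ k); linarith : (-1 : ℝ) < k).ne'
  rw [binomialSeries_eq_ordinaryHypergeometricSeries (𝔸 := ℝ) (b := (1 : ℝ)) h1] at hps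
  have hmem : -y ∈ Metric.eball (0 : ℝ) 1 := by
    rw [Metric.mem_eball, edist_zero_right, enorm_eq_nnnorm]
    have : ‖-y‖₊ < 1 := by
      rw [← NNReal.coe_lt_coe, coe_nnnorm, norm_neg, Real.norm_eq_abs]; exact_mod_cast hy
    exact_mod_cast this
  have h := hps.hasSum hmem
  simp only [FormalMultilinearSeries.compContinuousLinearMap_apply, zero_add, neg_neg] at h
  have e : (fun n : ℕ => (ordinaryHypergeometricSeries ℝ a 1 1 n)
      (⇑(-ContinuousLinearMap.id ℝ ℝ) ∘ fun _ : Fin n => -y)) =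
      fun n : ℕ => (n.factorial : ℝ)⁻¹ * (ascPochhammer ℝ n).eval a * y ^ n := by
    funext n
    have hc : (⇑(-ContinuousLinearMap.id ℝ ℝ) ∘ fun _ : Fin n => -y) = fun _ => y := by
      funext i; simp
    rw [hc, ordinaryHypergeometricSeries_apply_eq, smul_eq_mul, ascPochhammer_eval_one]
    have hn : (n.factorial : ℝ) ≠ 0 := by positivity
    field_simp
  rw [e, ← sub_eq_add_neg] at h
  exact h

/-- Integrability of the real Beta integrand on `[0, 1]` for `p, q > 0`. [folklore] -/
theorem intervalIntegrable_rpow_mul_one_sub_rpow {p q : ℝ} (hp : 0 < p) (hq : 0 < q) :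
    IntervalIntegrable (fun t : ℝ => t ^ (p - 1) * (1 - t) ^ (q - 1)) volume 0 1 := by
  have h := (Complex.betaIntegral_convergent (u := p) (v := q) (by simpa) (by simpa)).norm
  refine h.congr fun t ht => ?_
  rw [Set.uIoc_of_le zero_le_one] at ht
  have h1t : 0 ≤ 1 - t := by linarith [ht.2]
  rw [norm_mul, show (p : ℂ) - 1 = ((p - 1 : ℝ) : ℂ) by push_cast; ring,
    show (1 : ℂ) - (t : ℂ) = ((1 - t : ℝ) : ℂ) by push_cast; ring,
    show (q : ℂ) - 1 = ((q - 1 : ℝ) : ℂ) by push_cast; ring,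
    ← Complex.ofReal_cpow ht.1.le, ← Complex.ofReal_cpow h1t, Complex.norm_real, Complex.norm_real,
    Real.norm_eq_abs, Real.norm_eq_abs, abs_of_nonneg (Real.rpow_nonneg ht.1.le _),
    abs_of_nonneg (Real.rpow_nonneg h1t _)]

/-- `Γ(b + n) = (b)ₙ Γ(b)` for `b > 0`. [cite: AndrewsAskeyRoy1999, (1.1.6)] -/
theorem Gamma_add_nat_eq_ascPochhammer_mul {b : ℝ} (hb : 0 < b) (n : ℕ) :
    Real.Gamma (b + n) = (ascPochhammer ℝ n).eval b * Real.Gamma b := by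
  induction n with
  | zero => simp
  | succ n ih =>
    rw [ascPochhammer_succ_eval, Nat.cast_succ, ← add_assoc,
      Real.Gamma_add_one (by positivity : b + n ≠ 0), ih]
    ring

/-- **Euler's integral representation of the hypergeometric function** for real parameters
`c > b > 0` and real `|x| < 1`:
`∫₀¹ t^{b−1} (1−t)^{c−b−1} (1−xt)^{−a} dt = Γ(b)Γ(c−b)/Γ(c) · ₂F₁(a,b;c;x)`.
[cite: AndrewsAskeyRoy1999, Thm 2.2.1] -/
theorem euler_integral_ordinaryHypergeometric {a b c x : ℝ} (hb : 0 < b) (hbc : b < c)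
    (hx : |x| < 1) :
    ∫ t in (0 : ℝ)..1, t ^ (b - 1) * (1 - t) ^ (c - b - 1) * (1 - x * t) ^ (-a) =
      Real.Gamma b * Real.Gamma (c - b) / Real.Gamma c * ordinaryHypergeometric a b c x := by
  have hcb : 0 < c - b := sub_pos.mpr hbc
  have hc : 0 < c := hb.trans hbc
  set K : ℕ → ℝ := fun n => (n.factorial : ℝ)⁻¹ * (ascPochhammer ℝ n).eval a with hK
  set w : ℝ → ℝ := fun t => t ^ (b - 1) * (1 - t) ^ (c - b - 1) with hw
  set F : ℕ → ℝ → ℝ := fun n t => K n * x ^ n * (t ^ n * w t) with hF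
  set bound : ℕ → ℝ → ℝ := fun n t => |K n| * |x| ^ n * w t with hbound
  have hw_int : IntervalIntegrable w volume 0 1 := by
    have := intervalIntegrable_rpow_mul_one_sub_rpow hb hcb
    simpa only [hw] using this
  have hw_nonneg : ∀ t ∈ Set.Ioc (0 : ℝ) 1, 0 ≤ w t := fun t ht =>
    mul_nonneg (Real.rpow_nonneg ht.1.le _) (Real.rpow_nonneg (by linarith [ht.2]) _)
  -- `Σ |Kₙ| |x|ⁿ` converges: it is the hypergeometric series `₂F₁(a,1;1;|x|)` up to signs
  have hKx : Summable fun n : ℕ => |K n| * |x| ^ n := by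
    have h := summable_abs_ordinaryHypergeometricCoefficient_mul_pow a 1 1 |x| (abs_nonneg x) hx
    refine h.congr fun n => ?_
    congr 1
    simp only [hK, ordinaryHypergeometricCoefficient, ascPochhammer_eval_one]
    have hn : (n.factorial : ℝ) ≠ 0 := by positivity
    rw [mul_assoc ((n.factorial : ℝ)⁻¹ * Polynomial.eval a (ascPochhammer ℝ n)),
      mul_inv_cancel₀ hn, mul_one]
  have hF_meas : ∀ n, AEStronglyMeasurable (F n) (volume.restrict (Set.uIoc (0 : ℝ) 1)) := by
    intro n
    apply Measurable.aestronglyMeasurable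
    simp only [hF, hw]
    fun_prop
  have h_bound : ∀ n, ∀ᵐ t ∂volume, t ∈ Set.uIoc (0 : ℝ) 1 → ‖F n t‖ ≤ bound n t := by
    intro n
    refine ae_of_all _ fun t ht => ?_
    rw [Set.uIoc_of_le zero_le_one] at ht
    have hwt := hw_nonneg t ht
    have htn : t ^ n ≤ 1 := pow_le_one₀ ht.1.le ht.2
    have htn0 : 0 ≤ t ^ n := pow_nonneg ht.1.le n
    simp only [hF, hbound, Real.norm_eq_abs, abs_mul, abs_pow, abs_of_nonneg hwt,
      abs_of_nonneg htn0]
    calc |K n| * |x| ^ n * (t ^ n * w t) ≤ |K n| * |x| ^ n * (1 * w t) := by gcongr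
      _ = |K n| * |x| ^ n * w t := by rw [one_mul]
  have bound_summable : ∀ᵐ t ∂volume, t ∈ Set.uIoc (0 : ℝ) 1 → Summable fun n => bound n t :=
    ae_of_all _ fun t _ => by simpa only [hbound] using hKx.mul_right (w t)
  have bound_integrable : IntervalIntegrable (fun t => ∑' n, bound n t) volume 0 1 := by
    have e : (fun t => ∑' n, bound n t) = fun t => (∑' n : ℕ, |K n| * |x| ^ n) * w t := by
      funext t; simp only [hbound]; exact tsum_mul_right
    rw [e]
    exact hw_int.const_mul _
  have h_lim : ∀ᵐ t ∂volume, t ∈ Set.uIoc (0 : ℝ) 1 →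
      HasSum (fun n => F n t) (w t * (1 - x * t) ^ (-a)) := by
    refine ae_of_all _ fun t ht => ?_
    rw [Set.uIoc_of_le zero_le_one] at ht
    have hxt : |x * t| < 1 := by
      rw [abs_mul, abs_of_pos ht.1]
      calc |x| * t ≤ |x| * 1 := by gcongr; exact ht.2
        _ < 1 := by rw [mul_one]; exact hx
    have h := (hasSum_one_sub_rpow_neg a hxt).mul_left (w t)
    have e : (fun n => F n t) = fun i : ℕ =>
        w t * ((i.factorial : ℝ)⁻¹ * (ascPochhammer ℝ i).eval a * (x * t) ^ i) := by
      funext n; simp only [hF, hK, mul_pow]; ring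
    rw [e]; exact h
  have hmain := intervalIntegral.hasSum_integral_of_dominated_convergence bound hF_meas h_bound
    bound_summable bound_integrable h_lim
  -- each term integrates to a Beta value
  have hFn : ∀ n : ℕ, ∫ t in (0 : ℝ)..1, F n t =
      Real.Gamma b * Real.Gamma (c - b) / Real.Gamma c *
        (ordinaryHypergeometricCoefficient a b c n * x ^ n) := by
    intro n
    have hI : ∫ t in (0 : ℝ)..1, t ^ n * w t =
        (ascPochhammer ℝ n).eval b * Real.Gamma b * Real.Gamma (c - b) /
          ((ascPochhammer ℝ n).eval c * Real.Gamma c) := by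
      have h := LFunctions.integral_rpow_mul_one_sub_rpow (a := b + n) (b := c - b)
        (by positivity) hcb
      rw [show b + (n : ℝ) + (c - b) = c + n by ring, Gamma_add_nat_eq_ascPochhammer_mul hb,
        Gamma_add_nat_eq_ascPochhammer_mul hc] at h
      rw [← h]
      refine intervalIntegral.integral_congr_ae (ae_of_all _ fun t ht => ?_)
      rw [Set.uIoc_of_le zero_le_one] at ht
      simp only [hw]
      rw [← mul_assoc, ← Real.rpow_natCast, ← Real.rpow_add ht.1]
      ring_nf
    have hcn : (ascPochhammer ℝ n).eval c ≠ 0 := (ascPochhammer_pos n c hc).ne'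
    have hΓb : Real.Gamma b ≠ 0 := (Real.Gamma_pos_of_pos hb).ne'
    have hΓc : Real.Gamma c ≠ 0 := (Real.Gamma_pos_of_pos hc).ne'
    have hn : (n.factorial : ℝ) ≠ 0 := by positivity
    calc ∫ t in (0 : ℝ)..1, F n t = K n * x ^ n * ∫ t in (0 : ℝ)..1, t ^ n * w t := by
          simp only [hF]; exact intervalIntegral.integral_const_mul _ _
      _ = _ := by
          rw [hI]
          simp only [hK, ordinaryHypergeometricCoefficient]
          field_simp
  have e : (fun n => ∫ t in (0 : ℝ)..1, F n t) = fun n : ℕ =>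
      Real.Gamma b * Real.Gamma (c - b) / Real.Gamma c *
        (ordinaryHypergeometricCoefficient a b c n * x ^ n) := funext hFn
  rw [e] at hmain
  have h2 := (hasSum_ordinaryHypergeometric a b c hx).mul_left
    (Real.Gamma b * Real.Gamma (c - b) / Real.Gamma c)
  have := hmain.unique h2
  simpa only [hw] using this


/-! ### `P_ν(0)` for `−1 < ν < 0` via Euler's integral and a Beta integral -/

/-- The image of `(0, 1)` under squaring is `(0, 1)`. [folklore] -/
theorem sq_image_Ioo : (fun s : ℝ => s ^ 2) '' Set.Ioo 0 1 = Set.Ioo 0 1 := by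
  ext u
  constructor
  · rintro ⟨s, hs, rfl⟩
    exact ⟨pow_pos hs.1 2, pow_lt_one₀ hs.1.le hs.2 two_ne_zero⟩
  · intro hu
    exact ⟨√u, ⟨Real.sqrt_pos.2 hu.1, (Real.sqrt_lt_sqrt hu.1.le hu.2).trans_eq Real.sqrt_one⟩,
      Real.sq_sqrt hu.1.le⟩

/-- The substitution `u = s²` in a Beta integral:
`∫₀¹ s^{−ν−1} (1 − s²)^{ν} ds = ½ ∫₀¹ u^{−ν/2−1} (1 − u)^{ν} du` (`−1 < ν < 0`). [folklore] -/
theorem integral_rpow_mul_one_sub_sq_rpow {ν : ℝ} (hν : -1 < ν) (hν' : ν < 0) :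
    ∫ s in (0 : ℝ)..1, s ^ (-ν - 1) * (1 - s ^ 2) ^ ν =
      1 / 2 * (Real.Gamma (-ν / 2) * Real.Gamma (ν + 1) / Real.Gamma (1 + ν / 2)) := by
  have hp : 0 < -ν / 2 := by linarith
  have hq : 0 < ν + 1 := by linarith
  have hβ := LFunctions.integral_rpow_mul_one_sub_rpow hp hq
  rw [show -ν / 2 + (ν + 1) = 1 + ν / 2 by ring] at hβ
  -- the Beta integral as a set integral over `(0, 1)`, then pulled back along `u = s²`
  set g : ℝ → ℝ := fun u => 1 / 2 * (u ^ (-ν / 2 - 1) * (1 - u) ^ (ν + 1 - 1)) with hg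
  have hK : ∫ s in (0 : ℝ)..1, s ^ (-ν - 1) * (1 - s ^ 2) ^ ν = ∫ s in Set.Ioo (0 : ℝ) 1,
      |2 * s| • g (s ^ 2) := by
    rw [intervalIntegral.integral_of_le zero_le_one, integral_Ioc_eq_integral_Ioo]
    refine setIntegral_congr_fun measurableSet_Ioo fun s hs => ?_
    have hs0 : 0 ≤ s := hs.1.le
    have hsne : s ≠ 0 := hs.1.ne'
    have e1 : (s ^ 2) ^ (-ν / 2 - 1) = s ^ (-ν - 1) * s⁻¹ := by
      rw [← Real.rpow_natCast s 2, ← Real.rpow_mul hs0,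
        show ((2 : ℕ) : ℝ) * (-ν / 2 - 1) = (-ν - 1) + (-1) by push_cast; ring,
        Real.rpow_add hs.1, Real.rpow_neg_one]
    simp only [hg, smul_eq_mul, add_sub_cancel_right]
    rw [abs_of_pos (by linarith [hs.1]), e1]
    field_simp
  have himg := integral_image_eq_integral_abs_deriv_smul (s := Set.Ioo (0 : ℝ) 1)
    (f := fun s : ℝ => s ^ 2) (f' := fun s => 2 * s) measurableSet_Ioo
    (fun s _ => by simpa using (hasDerivAt_pow 2 s).hasDerivWithinAt)
    (fun a ha b hb h => by
      have := congrArg Real.sqrt h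
      simpa only [Real.sqrt_sq ha.1.le, Real.sqrt_sq hb.1.le] using this) g
  rw [sq_image_Ioo] at himg
  rw [hK, ← himg, ← integral_Ioc_eq_integral_Ioo, ← intervalIntegral.integral_of_le zero_le_one]
  simp only [hg]
  rw [intervalIntegral.integral_const_mul, hβ]

/-- **`P_ν(0) = √π / (Γ((1−ν)/2) Γ(1+ν/2))` for `−1 < ν < 0`** (DLMF 14.5.1), from Euler's
integral at `x = ½`, the substitutions `t = 1 − s`, `u = s²`, the Beta integral and Legendre's
duplication formula. [cite: DLMF, 14.5.1] -/
theorem legendreP_zero_of_neg_one_lt_of_neg {ν : ℝ} (hν : -1 < ν) (hν' : ν < 0) :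
    legendreP ν 0 = √π / (Real.Gamma ((1 - ν) / 2) * Real.Gamma (1 + ν / 2)) := by
  -- Euler's integral at `a = -ν`, `b = ν + 1`, `c = 1`, `x = 1/2`
  have hE := euler_integral_ordinaryHypergeometric (a := -ν) (b := ν + 1) (c := 1) (x := 1 / 2)
    (by linarith) (by linarith) (by rw [abs_of_pos one_half_pos]; norm_num)
  simp only [add_sub_cancel_right, neg_neg, Real.Gamma_one, div_one,
    show (1 : ℝ) - (ν + 1) = -ν by ring] at hE
  have hP : legendreP ν 0 = ordinaryHypergeometric (-ν) (ν + 1) 1 (1 / 2) := by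
    rw [legendreP_def]; norm_num
  -- the substitution `t = 1 - s`
  set f : ℝ → ℝ := fun t => t ^ ν * (1 - t) ^ (-ν - 1) * (1 - 1 / 2 * t) ^ ν with hf
  have hJ : ∫ t in (0 : ℝ)..1, f t = (2 : ℝ) ^ (-ν) * ∫ s in (0 : ℝ)..1, s ^ (-ν - 1) * (1 - s ^ 2) ^ ν := by
    have h1 : ∫ s in (0 : ℝ)..1, f (1 - s) = ∫ t in (0 : ℝ)..1, f t := by
      rw [intervalIntegral.integral_comp_sub_left f 1]; norm_num
    rw [← h1, ← intervalIntegral.integral_const_mul]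
    refine intervalIntegral.integral_congr_ae (ae_of_all _ fun s hs => ?_)
    rw [Set.uIoc_of_le zero_le_one] at hs
    have h1s : 0 ≤ 1 - s := by linarith [hs.2]
    have h1s' : 0 ≤ (1 + s) / 2 := by linarith [hs.1]
    simp only [hf, sub_sub_cancel]
    rw [show 1 - 1 / 2 * (1 - s) = (1 + s) / 2 by ring]
    calc (1 - s) ^ ν * s ^ (-ν - 1) * ((1 + s) / 2) ^ ν
        = s ^ (-ν - 1) * ((1 - s) * ((1 + s) / 2)) ^ ν := by rw [Real.mul_rpow h1s h1s']; ring
      _ = s ^ (-ν - 1) * ((1 - s ^ 2) / 2) ^ ν := by congr 2; ring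
      _ = (2 : ℝ) ^ (-ν) * (s ^ (-ν - 1) * (1 - s ^ 2) ^ ν) := by
          rw [Real.div_rpow (by nlinarith [hs.1, hs.2]) zero_le_two, Real.rpow_neg zero_le_two]
          field_simp
  rw [hJ, integral_rpow_mul_one_sub_sq_rpow hν hν'] at hE
  -- duplication: Γ(-ν/2) Γ((1-ν)/2) = Γ(-ν) 2^{1+ν} √π
  have hdup := Real.Gamma_mul_Gamma_add_half (-ν / 2)
  rw [show -ν / 2 + 1 / 2 = (1 - ν) / 2 by ring, show 2 * (-ν / 2) = -ν by ring,
    show (1 : ℝ) - -ν = 1 + ν by ring] at hdup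
  have hΓ1 : 0 < Real.Gamma (ν + 1) := Real.Gamma_pos_of_pos (by linarith)
  have hΓ2 : 0 < Real.Gamma (-ν) := Real.Gamma_pos_of_pos (by linarith)
  have hΓ3 : 0 < Real.Gamma (1 + ν / 2) := Real.Gamma_pos_of_pos (by linarith)
  have hΓ4 : 0 < Real.Gamma ((1 - ν) / 2) := Real.Gamma_pos_of_pos (by linarith)
  have hΓ5 : 0 < Real.Gamma (-ν / 2) := Real.Gamma_pos_of_pos (by linarith)
  have h2a : (0 : ℝ) < (2 : ℝ) ^ (-ν) := Real.rpow_pos_of_pos two_pos _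
  have h2b : (2 : ℝ) ^ (-ν) * (2 : ℝ) ^ (1 + ν) = 2 := by
    rw [← Real.rpow_add two_pos]; norm_num
  rw [hP]
  -- solve the linear equation `hE` for `₂F₁(…)(1/2)` and use duplication
  have hsol : ordinaryHypergeometric (-ν) (ν + 1) 1 (1 / 2) =
      (2 : ℝ) ^ (-ν) * (1 / 2 * (Real.Gamma (-ν / 2) * Real.Gamma (ν + 1) /
        Real.Gamma (1 + ν / 2))) / (Real.Gamma (ν + 1) * Real.Gamma (-ν)) := by
    rw [eq_div_iff (mul_pos hΓ1 hΓ2).ne', hE]; ring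
  have hΓa : Real.Gamma (-ν / 2) =
      Real.Gamma (-ν) * (2 : ℝ) ^ (1 + ν) * √π / Real.Gamma ((1 - ν) / 2) := by
    rw [eq_div_iff hΓ4.ne']; exact hdup
  have h2c : (2 : ℝ) ^ (1 + ν) = 2 / (2 : ℝ) ^ (-ν) := by
    rw [eq_div_iff h2a.ne', mul_comm]; exact h2b
  rw [hsol, hΓa, h2c]
  field_simp


/-! ### Analytic continuation in the degree: `P_ν(0)` and `P_ν'(0)` for every real `ν` -/

/-- Casting a real Pochhammer value to `ℂ`. [folklore] -/
theorem ofReal_ascPochhammer_eval (x : ℝ) (n : ℕ) :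
    (((ascPochhammer ℝ n).eval x : ℝ) : ℂ) = (ascPochhammer ℂ n).eval (x : ℂ) := by
  induction n with
  | zero => simp
  | succ n ih => rw [ascPochhammer_succ_eval, ascPochhammer_succ_eval]; push_cast; rw [ih]

/-- Murphy's coefficients are the real points of the complex-degree coefficients
`cₙ(s) = (−s)ₙ(s+1)ₙ/(n!)²`. [folklore] -/
theorem ofReal_legendre_coeff (ν : ℝ) (n : ℕ) :
    ((ordinaryHypergeometricCoefficient (-ν) (ν + 1) 1 n : ℝ) : ℂ) =
      ordinaryHypergeometricCoefficient (-(ν : ℂ)) ((ν : ℂ) + 1) 1 n := by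
  simp only [ordinaryHypergeometricCoefficient]
  push_cast
  rw [ofReal_ascPochhammer_eval, ofReal_ascPochhammer_eval, ofReal_ascPochhammer_eval]
  push_cast
  ring

/-- `‖(s)ₙ‖ ≤ (R)ₙ` for `‖s‖ ≤ R`. [folklore] -/
theorem norm_ascPochhammer_eval_le {s : ℂ} {R : ℝ} (h : ‖s‖ ≤ R) (n : ℕ) :
    ‖(ascPochhammer ℂ n).eval s‖ ≤ (ascPochhammer ℝ n).eval R := by
  induction n with
  | zero => simp
  | succ n ih =>
    rw [ascPochhammer_succ_eval, ascPochhammer_succ_eval, norm_mul]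
    have h1 : ‖s + n‖ ≤ R + n := (norm_add_le _ _).trans (by simpa using h)
    have h0 : 0 ≤ (ascPochhammer ℝ n).eval R := (norm_nonneg _).trans ih
    exact mul_le_mul ih h1 (norm_nonneg _) h0

/-- A summable majorant of the complex-degree Murphy coefficients on `‖s‖ ≤ R`:
`‖cₙ(s)‖ ≤ (R)ₙ(R+1)ₙ/(n!)²`, the `n`-th coefficient of `₂F₁(R, R+1; 1; ·)`. [folklore] -/
theorem norm_legendre_coeffC_le {s : ℂ} {R : ℝ} (h : ‖s‖ ≤ R) (n : ℕ) :
    ‖ordinaryHypergeometricCoefficient (-s) (s + 1) (1 : ℂ) n‖ ≤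
      ordinaryHypergeometricCoefficient R (R + 1) 1 n := by
  have ha : ‖(ascPochhammer ℂ n).eval (-s)‖ ≤ (ascPochhammer ℝ n).eval R :=
    norm_ascPochhammer_eval_le (by rwa [norm_neg]) n
  have hb : ‖(ascPochhammer ℂ n).eval (s + 1)‖ ≤ (ascPochhammer ℝ n).eval (R + 1) :=
    norm_ascPochhammer_eval_le ((norm_add_le _ _).trans (by simpa using h)) n
  have h1 : (ascPochhammer ℂ n).eval (1 : ℂ) = (n.factorial : ℂ) := ascPochhammer_eval_one ℂ n
  have h1' : (ascPochhammer ℝ n).eval (1 : ℝ) = (n.factorial : ℝ) := ascPochhammer_eval_one ℝ n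
  simp only [ordinaryHypergeometricCoefficient, h1, h1', norm_mul, norm_inv, Complex.norm_natCast]
  have hn : (0 : ℝ) ≤ (n.factorial : ℝ)⁻¹ := by positivity
  have h0 : 0 ≤ (ascPochhammer ℝ n).eval R := (norm_nonneg _).trans ha
  calc (n.factorial : ℝ)⁻¹ * ‖(ascPochhammer ℂ n).eval (-s)‖ *
        ‖(ascPochhammer ℂ n).eval (s + 1)‖ * (n.factorial : ℝ)⁻¹
      ≤ (n.factorial : ℝ)⁻¹ * (ascPochhammer ℝ n).eval R *
        (ascPochhammer ℝ n).eval (R + 1) * (n.factorial : ℝ)⁻¹ := by gcongr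

/-- `s ↦ cₙ(s)` is a polynomial, hence complex-differentiable. [folklore] -/
theorem differentiable_legendre_coeffC (n : ℕ) :
    Differentiable ℂ fun s : ℂ => ordinaryHypergeometricCoefficient (-s) (s + 1) (1 : ℂ) n := by
  simp only [ordinaryHypergeometricCoefficient]
  have ha : Differentiable ℂ fun s : ℂ => (ascPochhammer ℂ n).eval (-s) :=
    (Polynomial.differentiable (ascPochhammer ℂ n)).comp (f := fun s : ℂ => -s) differentiable_neg
  have hb : Differentiable ℂ fun s : ℂ => (ascPochhammer ℂ n).eval (s + 1) :=
    (Polynomial.differentiable (ascPochhammer ℂ n)).comp (f := fun s : ℂ => s + 1)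
      (differentiable_id.add_const 1)
  exact ((ha.const_mul _).mul hb).mul_const _

/-- **The generating series `s ↦ Σₙ cₙ(s) 2⁻ⁿ` of `P_s(0)` is entire.** [folklore] -/
theorem differentiable_tsum_legendre_coeffC :
    Differentiable ℂ fun s : ℂ =>
      ∑' n : ℕ, ordinaryHypergeometricCoefficient (-s) (s + 1) (1 : ℂ) n * (1 / 2 : ℂ) ^ n := by
  intro s₀
  set R : ℝ := ‖s₀‖ + 1 with hR
  have hmem : s₀ ∈ Metric.ball (0 : ℂ) R := by
    rw [Metric.mem_ball, dist_zero_right, hR]; linarith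
  have hdiff := Complex.differentiableOn_tsum_of_summable_norm
    (F := fun n (s : ℂ) => ordinaryHypergeometricCoefficient (-s) (s + 1) (1 : ℂ) n * (1 / 2 : ℂ) ^ n)
    (u := fun n => |ordinaryHypergeometricCoefficient R (R + 1) 1 n| * (1 / 2 : ℝ) ^ n)
    (U := Metric.ball (0 : ℂ) R)
    (summable_abs_ordinaryHypergeometricCoefficient_mul_pow R (R + 1) 1 (1 / 2)
      (by norm_num) (by norm_num))
    (fun n => ((differentiable_legendre_coeffC n).mul_const _).differentiableOn)
    Metric.isOpen_ball
    (fun n w hw => by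
      rw [Metric.mem_ball, dist_zero_right] at hw
      rw [norm_mul, norm_pow]
      have : ‖(1 / 2 : ℂ)‖ = 1 / 2 := by simp
      rw [this]
      gcongr
      exact (norm_legendre_coeffC_le hw.le n).trans (le_abs_self _))
  exact hdiff.differentiableAt (Metric.isOpen_ball.mem_nhds hmem)

/-- For real `ν`, the entire series at `ν` is `P_ν(0)`. [cite: WhittakerWatson1927, §15.22] -/
theorem tsum_legendre_coeffC_ofReal (ν : ℝ) :
    (∑' n : ℕ, ordinaryHypergeometricCoefficient (-(ν : ℂ)) ((ν : ℂ) + 1) (1 : ℂ) n *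
      (1 / 2 : ℂ) ^ n) = ((legendreP ν 0 : ℝ) : ℂ) := by
  rw [legendreP_eq_tsum, Complex.ofReal_tsum]
  refine tsum_congr fun n => ?_
  rw [← ofReal_legendre_coeff]
  push_cast
  norm_num

/-- **`P_ν(0) = √π / (Γ((1−ν)/2) Γ(1+ν/2))` for every real degree `ν`** (DLMF 14.5.1; at the
poles Mathlib's `Γ = 0`, `x/0 = 0` give the correct value `0`): both sides extend to entire
functions of the degree which agree on `(−1, 0)`. [cite: DLMF, 14.5.1] -/
theorem legendreP_zero_eq (ν : ℝ) :
    legendreP ν 0 = √π / (Real.Gamma ((1 - ν) / 2) * Real.Gamma (1 + ν / 2)) := by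
  -- the two entire functions
  set G : ℂ → ℂ := fun s =>
    ∑' n : ℕ, ordinaryHypergeometricCoefficient (-s) (s + 1) (1 : ℂ) n * (1 / 2 : ℂ) ^ n with hG
  set H : ℂ → ℂ := fun s =>
    (√π : ℂ) * (Complex.Gamma ((1 - s) / 2))⁻¹ * (Complex.Gamma (1 + s / 2))⁻¹ with hH
  have hGa : AnalyticOnNhd ℂ G univ :=
    Complex.analyticOnNhd_univ_iff_differentiable.mpr differentiable_tsum_legendre_coeffC
  have hHd : Differentiable ℂ H := by
    have h1 : Differentiable ℂ fun s : ℂ => (Complex.Gamma ((1 - s) / 2))⁻¹ :=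
      Complex.differentiable_one_div_Gamma.comp ((differentiable_const _ |>.sub differentiable_id).div_const 2)
    have h2 : Differentiable ℂ fun s : ℂ => (Complex.Gamma (1 + s / 2))⁻¹ :=
      Complex.differentiable_one_div_Gamma.comp ((differentiable_const _).add (differentiable_id.div_const 2))
    exact ((differentiable_const _).mul h1).mul h2
  have hHa : AnalyticOnNhd ℂ H univ := Complex.analyticOnNhd_univ_iff_differentiable.mpr hHd
  -- the real points: `G ν = P_ν(0)` and `H ν = √π/(Γ Γ)`
  have hGr : ∀ μ : ℝ, G μ = ((legendreP μ 0 : ℝ) : ℂ) := fun μ => tsum_legendre_coeffC_ofReal μ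
  have hHr : ∀ μ : ℝ, H μ =
      ((√π / (Real.Gamma ((1 - μ) / 2) * Real.Gamma (1 + μ / 2)) : ℝ) : ℂ) := by
    intro μ
    simp only [hH]
    rw [show ((1 : ℂ) - μ) / 2 = (((1 - μ) / 2 : ℝ) : ℂ) by push_cast; ring,
      show (1 : ℂ) + μ / 2 = ((1 + μ / 2 : ℝ) : ℂ) by push_cast; ring,
      Complex.Gamma_ofReal, Complex.Gamma_ofReal]
    push_cast
    ring
  -- agreement on `(-1, 0)`, transported to a punctured complex neighbourhood of `-1/2`
  have hagree : ∀ μ : ℝ, -1 < μ → μ < 0 → G μ = H μ := by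
    intro μ h1 h2
    rw [hGr, hHr, legendreP_zero_of_neg_one_lt_of_neg h1 h2]
  have hfreq : ∃ᶠ z in 𝓝[≠] ((-(1 / 2) : ℝ) : ℂ), G z = H z := by
    have hev : ∀ᶠ μ : ℝ in 𝓝[≠] (-(1 / 2)), G μ = H μ := by
      have : Set.Ioo (-1 : ℝ) 0 ∈ 𝓝[≠] (-(1 / 2) : ℝ) :=
        mem_nhdsWithin_of_mem_nhds (Ioo_mem_nhds (by norm_num) (by norm_num))
      filter_upwards [this] with μ hμ using hagree μ hμ.1 hμ.2
    have htend : Tendsto (fun μ : ℝ => (μ : ℂ)) (𝓝[≠] (-(1 / 2))) (𝓝[≠] ((-(1 / 2) : ℝ) : ℂ)) := by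
      refine tendsto_nhdsWithin_iff.mpr ⟨?_, ?_⟩
      · exact Complex.continuous_ofReal.continuousAt.tendsto.mono_left nhdsWithin_le_nhds
      · filter_upwards [self_mem_nhdsWithin] with μ hμ
        simp only [mem_compl_iff, mem_singleton_iff] at hμ ⊢
        exact fun h => hμ (by exact_mod_cast h)
    exact htend.frequently hev.frequently
  have heq := hGa.eqOn_of_preconnected_of_frequently_eq hHa isPreconnected_univ
    (Set.mem_univ _) hfreq
  have := heq (Set.mem_univ (ν : ℂ))
  rw [hGr, hHr] at this
  exact_mod_cast this


/-- Reflection, solved for `1/Γ(1−x)`: `1/Γ(1−x) = Γ(x) sin(πx)/π` whenever `x` is not a pole of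
`Γ` (at the zeros of `sin(πx)` both sides vanish, Mathlib's `Γ` being `0` at its poles).
[cite: AndrewsAskeyRoy1999, Thm 1.2.1] -/
theorem inv_Gamma_one_sub {x : ℝ} (hx : ∀ m : ℕ, x ≠ -m) :
    (Real.Gamma (1 - x))⁻¹ = Real.Gamma x * Real.sin (π * x) / π := by
  have h := Real.Gamma_mul_Gamma_one_sub x
  have hΓ : Real.Gamma x ≠ 0 := Real.Gamma_ne_zero hx
  by_cases hs : Real.sin (π * x) = 0
  · rw [hs, div_zero, mul_eq_zero] at h
    rw [h.resolve_left hΓ, hs]; simp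
  · have h2 : Real.Gamma (1 - x) * (Real.Gamma x * Real.sin (π * x)) = π := by
      rw [eq_div_iff hs] at h; linear_combination h
    have hΓ1 : Real.Gamma (1 - x) ≠ 0 := fun h0 => by
      rw [h0, zero_mul] at h2; exact Real.pi_ne_zero h2.symm
    rw [eq_div_iff Real.pi_ne_zero, inv_mul_eq_iff_eq_mul₀ hΓ1]
    exact h2.symm

/-- **`P_ν(0) = cos(πν/2) Γ((ν+1)/2) / (√π Γ(1+ν/2))` for `ν > −1`** — the pole-free form of
DLMF 14.5.1 obtained by reflection; all Gamma values here are at positive arguments.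
[cite: DLMF, 14.5.1] -/
theorem legendreP_zero_eq_cos {ν : ℝ} (hν : -1 < ν) :
    legendreP ν 0 = Real.cos (π * ν / 2) * Real.Gamma ((ν + 1) / 2) /
      (√π * Real.Gamma (1 + ν / 2)) := by
  have hx : ∀ m : ℕ, (ν + 1) / 2 ≠ -m := fun m => by
    have : (0 : ℝ) ≤ m := m.cast_nonneg
    intro h; linarith
  have hinv := inv_Gamma_one_sub hx
  rw [show 1 - (ν + 1) / 2 = (1 - ν) / 2 by ring,
    show π * ((ν + 1) / 2) = π * ν / 2 + π / 2 by ring, Real.sin_add_pi_div_two] at hinv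
  have hΓb : 0 < Real.Gamma (1 + ν / 2) := Real.Gamma_pos_of_pos (by linarith)
  have hsπ : 0 < √π := Real.sqrt_pos.mpr Real.pi_pos
  have hπ : (√π : ℝ) ^ 2 = π := Real.sq_sqrt Real.pi_pos.le
  rw [legendreP_zero_eq, div_eq_mul_inv, mul_inv, ← mul_assoc, hinv]
  field_simp
  rw [hπ]
  ring

/-- **`P_ν'(0) = 2 sin(πν/2) Γ(1+ν/2) / (√π Γ((ν+1)/2))` for `ν > −1`** — the pole-free form of
DLMF 14.5.2 (via `P'_ν(0) = ν P_{ν−1}(0)` and reflection). [cite: DLMF, 14.5.2] -/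
theorem deriv_legendreP_zero_eq_sin {ν : ℝ} (hν : -1 < ν) :
    deriv (legendreP ν) 0 = 2 * Real.sin (π * ν / 2) * Real.Gamma (1 + ν / 2) /
      (√π * Real.Gamma ((ν + 1) / 2)) := by
  rw [deriv_legendreP_zero ν, legendreP_zero_eq (ν - 1),
    show (1 - (ν - 1)) / 2 = 1 - ν / 2 by ring, show 1 + (ν - 1) / 2 = (ν + 1) / 2 by ring]
  by_cases h0 : ν = 0
  · subst h0; simp
  have hx : ∀ m : ℕ, ν / 2 ≠ -m := by
    intro m h
    rcases Nat.eq_zero_or_pos m with hm | hm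
    · subst hm; simp at h; exact h0 (by linarith)
    · have : (1 : ℝ) ≤ m := by exact_mod_cast hm
      linarith
  have hinv := inv_Gamma_one_sub hx
  rw [show π * (ν / 2) = π * ν / 2 by ring] at hinv
  have hrec : Real.Gamma (1 + ν / 2) = ν / 2 * Real.Gamma (ν / 2) := by
    rw [add_comm, Real.Gamma_add_one (by intro h; exact h0 (by linarith))]
  have hΓa : 0 < Real.Gamma ((ν + 1) / 2) := Real.Gamma_pos_of_pos (by linarith)
  have hsπ : 0 < √π := Real.sqrt_pos.mpr Real.pi_pos
  have hπ : (√π : ℝ) ^ 2 = π := Real.sq_sqrt Real.pi_pos.le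
  rw [show ν * (√π / (Real.Gamma (1 - ν / 2) * Real.Gamma ((ν + 1) / 2))) =
      ν * √π * (Real.Gamma (1 - ν / 2))⁻¹ / Real.Gamma ((ν + 1) / 2) by ring, hinv, hrec]
  field_simp
  rw [hπ]
  ring

/-- **`P_ν'(0) = −2√π / (Γ(−ν/2) Γ((ν+1)/2))` for every real degree** (DLMF 14.5.2; at the poles
Mathlib's conventions `Γ = 0`, `x/0 = 0` give the correct value `0`). [cite: DLMF, 14.5.2] -/
theorem deriv_legendreP_zero_eq (ν : ℝ) :
    deriv (legendreP ν) 0 = -(2 * √π) / (Real.Gamma (-ν / 2) * Real.Gamma ((ν + 1) / 2)) := by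
  rw [deriv_legendreP_zero ν, legendreP_zero_eq (ν - 1),
    show (1 - (ν - 1)) / 2 = -ν / 2 + 1 by ring, show 1 + (ν - 1) / 2 = (ν + 1) / 2 by ring]
  by_cases h0 : ν = 0
  · subst h0; simp
  rw [Real.Gamma_add_one (by intro h; exact h0 (by linarith))]
  by_cases hΓ : Real.Gamma (-ν / 2) = 0
  · rw [hΓ]; simp
  field_simp


/-! ### Continuity in the degree; the `σ → ν` limit in Green's formula; the closed form -/

/-- Real form of the majorant: `|Aₙ(σ)| ≤ (R)ₙ(R+1)ₙ/(n!)²` for `|σ| ≤ R`. [folklore] -/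
theorem abs_legendre_coeff_le {σ R : ℝ} (h : |σ| ≤ R) (n : ℕ) :
    |ordinaryHypergeometricCoefficient (-σ) (σ + 1) 1 n| ≤
      ordinaryHypergeometricCoefficient R (R + 1) 1 n := by
  have := norm_legendre_coeffC_le (s := (σ : ℂ)) (R := R) (by rwa [Complex.norm_real, Real.norm_eq_abs]) n
  rwa [← ofReal_legendre_coeff, Complex.norm_real, Real.norm_eq_abs] at this

/-- `σ ↦ Aₙ(σ)` is continuous (a polynomial). [folklore] -/
theorem continuous_legendre_coeff (n : ℕ) :
    Continuous fun σ : ℝ => ordinaryHypergeometricCoefficient (-σ) (σ + 1) 1 n := by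
  simp only [ordinaryHypergeometricCoefficient]
  have ha : Continuous fun σ : ℝ => (ascPochhammer ℝ n).eval (-σ) :=
    (Polynomial.continuous (ascPochhammer ℝ n)).comp (f := fun σ : ℝ => -σ) continuous_neg
  have hb : Continuous fun σ : ℝ => (ascPochhammer ℝ n).eval (σ + 1) :=
    (Polynomial.continuous (ascPochhammer ℝ n)).comp (f := fun σ : ℝ => σ + 1)
      (continuous_id.add continuous_const)
  exact ((continuous_const.mul ha).mul hb).mul continuous_const

/-- The majorant series converges: `Σ (R)ₙ(R+1)ₙ/(n!)² rⁿ < ∞` for `0 ≤ r < 1`, in `HasSum` form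
with nonnegative terms. [folklore] -/
theorem summable_majorant {R r : ℝ} (hR : 0 ≤ R) (hr0 : 0 ≤ r) (hr1 : r < 1) :
    Summable fun n : ℕ => ordinaryHypergeometricCoefficient R (R + 1) 1 n * r ^ n := by
  refine (summable_abs_ordinaryHypergeometricCoefficient_mul_pow R (R + 1) 1 r hr0 hr1).congr
    fun n => ?_
  rw [abs_of_nonneg]
  exact (abs_nonneg _).trans (abs_legendre_coeff_le (σ := R) (abs_of_nonneg hR).le n)

/-- **Continuity of `P_σ(ξ)` in the degree `σ`**, for `−1 < ξ < 3` (dominated convergence on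
Murphy's series). [cite: WhittakerWatson1927, §15.22] -/
theorem continuousAt_legendreP_degree {ξ : ℝ} (h1 : -1 < ξ) (h3 : ξ < 3) (ν : ℝ) :
    ContinuousAt (fun σ : ℝ => legendreP σ ξ) ν := by
  set x : ℝ := (1 - ξ) / 2 with hx
  have hxa : |x| < 1 := abs_half_sub_lt_one h1 h3
  set R : ℝ := |ν| + 1 with hR
  have hfun : (fun σ : ℝ => legendreP σ ξ) = fun σ =>
      ∑' n : ℕ, ordinaryHypergeometricCoefficient (-σ) (σ + 1) 1 n * x ^ n := by
    funext σ; exact legendreP_eq_tsum σ ξ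
  rw [ContinuousAt, hfun, legendreP_eq_tsum]
  refine tendsto_tsum_of_dominated_convergence
    (bound := fun n => ordinaryHypergeometricCoefficient R (R + 1) 1 n * |x| ^ n)
    (summable_majorant (by positivity) (abs_nonneg x) hxa) (fun n => ?_) ?_
  · exact ((continuous_legendre_coeff n).mul continuous_const).continuousAt.tendsto
  · have hball : Metric.ball ν 1 ∈ 𝓝 ν := Metric.ball_mem_nhds ν one_pos
    filter_upwards [hball] with σ hσ n
    rw [Metric.mem_ball, Real.dist_eq] at hσ
    have hσR : |σ| ≤ R := by
      rw [hR]
      have := abs_sub_abs_le_abs_sub σ ν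
      linarith
    rw [Real.norm_eq_abs, abs_mul, abs_pow]
    gcongr
    exact abs_legendre_coeff_le hσR n

/-- A bound for `|P_σ(ξ)|` on `ξ ∈ [0,1]`, uniform in `|σ| ≤ R`:
`|P_σ(ξ)| ≤ Σₙ (R)ₙ(R+1)ₙ/(n!)² 2⁻ⁿ`. [folklore] -/
theorem abs_legendreP_le {σ R ξ : ℝ} (hσ : |σ| ≤ R) (h0 : 0 ≤ ξ) (h1 : ξ ≤ 1) :
    |legendreP σ ξ| ≤ ∑' n : ℕ, ordinaryHypergeometricCoefficient R (R + 1) 1 n * (1 / 2) ^ n := by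
  rw [legendreP_eq_tsum, ← Real.norm_eq_abs]
  refine tsum_of_norm_bounded
    (summable_majorant ((abs_nonneg σ).trans hσ) (by norm_num) (by norm_num)).hasSum
    fun n => ?_
  have hx0 : 0 ≤ (1 - ξ) / 2 := by linarith
  have hx1 : (1 - ξ) / 2 ≤ 1 / 2 := by linarith
  rw [Real.norm_eq_abs, abs_mul, abs_pow, abs_of_nonneg hx0]
  have hM : 0 ≤ ordinaryHypergeometricCoefficient R (R + 1) 1 n :=
    (abs_nonneg _).trans (abs_legendre_coeff_le hσ n)
  gcongr
  exact abs_legendre_coeff_le hσ n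

/-- **Continuity in the degree of `σ ↦ ∫₀¹ P_ν P_σ`** (dominated convergence). [folklore] -/
theorem continuousAt_integral_legendreP_mul (ν μ : ℝ) :
    ContinuousAt (fun σ : ℝ => ∫ ξ in (0 : ℝ)..1, legendreP ν ξ * legendreP σ ξ) μ := by
  set R : ℝ := max |ν| |μ| + 1 with hR
  set S : ℝ := ∑' n : ℕ, ordinaryHypergeometricCoefficient R (R + 1) 1 n * (1 / 2) ^ n with hS
  have hνR : |ν| ≤ R := by rw [hR]; linarith [le_max_left |ν| |μ|]
  have hball : Metric.ball μ 1 ∈ 𝓝 μ := Metric.ball_mem_nhds μ one_pos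
  refine intervalIntegral.continuousAt_of_dominated_interval (bound := fun _ => S * S) ?_ ?_ ?_ ?_
  · refine Filter.Eventually.of_forall fun σ => ?_
    refine ContinuousOn.aestronglyMeasurable ?_ measurableSet_uIoc
    rw [Set.uIoc_of_le zero_le_one]
    exact ((continuousOn_legendreP_Icc ν).mul (continuousOn_legendreP_Icc σ)).mono
      Set.Ioc_subset_Icc_self
  · filter_upwards [hball] with σ hσ
    rw [Metric.mem_ball, Real.dist_eq] at hσ
    have hσR : |σ| ≤ R := by
      rw [hR]
      have := abs_sub_abs_le_abs_sub σ μ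
      linarith [le_max_right |ν| |μ|]
    refine ae_of_all _ fun ξ hξ => ?_
    rw [Set.uIoc_of_le zero_le_one] at hξ
    rw [norm_mul, Real.norm_eq_abs, Real.norm_eq_abs]
    have hS0 : 0 ≤ S := (abs_nonneg _).trans (abs_legendreP_le hνR hξ.1.le hξ.2)
    exact mul_le_mul (abs_legendreP_le hνR hξ.1.le hξ.2) (abs_legendreP_le hσR hξ.1.le hξ.2)
      (abs_nonneg _) hS0
  · exact intervalIntegrable_const
  · refine ae_of_all _ fun ξ hξ => ?_
    rw [Set.uIoc_of_le zero_le_one] at hξ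
    exact (continuousAt_legendreP_degree (by linarith [hξ.1]) (by linarith [hξ.2]) μ).const_mul _

/-- `Γ'(x) = Γ(x) ψ(x)` for real `x > 0` (from Mathlib's complex `Γ` and `ψ = logDeriv Γ`).
[cite: AndrewsAskeyRoy1999, §1.2] -/
theorem hasDerivAt_Gamma_digammaReal {x : ℝ} (hx : 0 < x) :
    HasDerivAt Real.Gamma (Real.Gamma x * digammaReal x) x := by
  have hne : ∀ m : ℕ, (x : ℂ) ≠ -m := by
    intro m h
    have h' := congrArg Complex.re h
    simp only [Complex.ofReal_re, Complex.neg_re, Complex.natCast_re] at h'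
    have : (0 : ℝ) ≤ m := m.cast_nonneg
    linarith
  have hd := (Complex.differentiableAt_Gamma _ hne).hasDerivAt
  have hG : Complex.Gamma (x : ℂ) ≠ 0 := Complex.Gamma_ne_zero_of_re_pos (by simpa using hx)
  have hderiv : deriv Complex.Gamma (x : ℂ) = Complex.Gamma x * Complex.digamma x := by
    rw [Complex.digamma, logDeriv_apply, mul_div_cancel₀ _ hG]
  rw [hderiv] at hd
  have hr := hd.real_of_complex
  have hfun : (fun t : ℝ => (Complex.Gamma (t : ℂ)).re) = Real.Gamma := by
    funext t; rw [Complex.Gamma_ofReal, Complex.ofReal_re]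
  rw [hfun, Complex.Gamma_ofReal, Complex.re_ofReal_mul] at hr
  exact hr

/-- Derivative in the degree of the closed form of `P_σ(0)`:
`d/dσ [cos(πσ/2)Γ((σ+1)/2)/(√πΓ(1+σ/2))] = Γ₁/(√πΓ₂) · (−(π/2) sin(πσ/2) + ½cos(πσ/2)(ψ₁ − ψ₂))`,
`Γ₁ = Γ((σ+1)/2)`, `Γ₂ = Γ(1+σ/2)`, `ψ₁ = ψ((σ+1)/2)`, `ψ₂ = ψ(1+σ/2)`. [folklore] -/
theorem hasDerivAt_legendreP_zero_closedForm {ν : ℝ} (hν : -1 < ν) :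
    HasDerivAt (fun σ : ℝ => Real.cos (π * σ / 2) * Real.Gamma ((σ + 1) / 2) /
        (√π * Real.Gamma (1 + σ / 2)))
      (Real.Gamma ((ν + 1) / 2) / (√π * Real.Gamma (1 + ν / 2)) *
        (-(π / 2) * Real.sin (π * ν / 2) + 1 / 2 * Real.cos (π * ν / 2) *
          (digammaReal ((ν + 1) / 2) - digammaReal (1 + ν / 2)))) ν := by
  have h1 : 0 < (ν + 1) / 2 := by linarith
  have h2 : 0 < 1 + ν / 2 := by linarith
  have hΓ1 : 0 < Real.Gamma ((ν + 1) / 2) := Real.Gamma_pos_of_pos h1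
  have hΓ2 : 0 < Real.Gamma (1 + ν / 2) := Real.Gamma_pos_of_pos h2
  have hsπ : 0 < √π := Real.sqrt_pos.mpr Real.pi_pos
  have hc : HasDerivAt (fun σ : ℝ => Real.cos (π * σ / 2))
      (-Real.sin (π * ν / 2) * (π / 2)) ν := by
    have := (((hasDerivAt_id' ν).const_mul π).div_const 2).cos
    exact this.congr_deriv (by ring)
  have hg1 := (hasDerivAt_Gamma_digammaReal h1).comp ν
    (((hasDerivAt_id' ν).add_const 1).div_const 2)
  have hg2 := (hasDerivAt_Gamma_digammaReal h2).comp ν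
    (((hasDerivAt_id' ν).div_const 2).const_add 1)
  have h := (hc.mul hg1).div (hg2.const_mul √π) (by exact (mul_pos hsπ hΓ2).ne')
  refine h.congr_deriv ?_
  simp only [Pi.mul_apply, Function.comp_apply]
  field_simp
  ring

/-- Derivative in the degree of the closed form of `P_σ'(0)`:
`d/dσ [2sin(πσ/2)Γ(1+σ/2)/(√πΓ((σ+1)/2))] = 2Γ₂/(√πΓ₁) · ((π/2)cos(πσ/2) + ½sin(πσ/2)(ψ₂ − ψ₁))`.
[folklore] -/
theorem hasDerivAt_deriv_legendreP_zero_closedForm {ν : ℝ} (hν : -1 < ν) :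
    HasDerivAt (fun σ : ℝ => 2 * Real.sin (π * σ / 2) * Real.Gamma (1 + σ / 2) /
        (√π * Real.Gamma ((σ + 1) / 2)))
      (2 * Real.Gamma (1 + ν / 2) / (√π * Real.Gamma ((ν + 1) / 2)) *
        (π / 2 * Real.cos (π * ν / 2) + 1 / 2 * Real.sin (π * ν / 2) *
          (digammaReal (1 + ν / 2) - digammaReal ((ν + 1) / 2)))) ν := by
  have h1 : 0 < (ν + 1) / 2 := by linarith
  have h2 : 0 < 1 + ν / 2 := by linarith
  have hΓ1 : 0 < Real.Gamma ((ν + 1) / 2) := Real.Gamma_pos_of_pos h1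
  have hΓ2 : 0 < Real.Gamma (1 + ν / 2) := Real.Gamma_pos_of_pos h2
  have hsπ : 0 < √π := Real.sqrt_pos.mpr Real.pi_pos
  have hs : HasDerivAt (fun σ : ℝ => 2 * Real.sin (π * σ / 2))
      (2 * (Real.cos (π * ν / 2) * (π / 2))) ν := by
    have := ((((hasDerivAt_id' ν).const_mul π).div_const 2).sin).const_mul 2
    exact this.congr_deriv (by ring)
  have hg1 := (hasDerivAt_Gamma_digammaReal h1).comp ν
    (((hasDerivAt_id' ν).add_const 1).div_const 2)
  have hg2 := (hasDerivAt_Gamma_digammaReal h2).comp ν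
    (((hasDerivAt_id' ν).div_const 2).const_add 1)
  have h := (hs.mul hg2).div (hg1.const_mul √π) (by exact (mul_pos hsπ hΓ1).ne')
  refine h.congr_deriv ?_
  simp only [Pi.mul_apply, Function.comp_apply]
  field_simp
  ring

/-- The algebra of the `σ → ν` limit: with `A = c g₁/(q g₂)`, `B = 2 s g₂/(q g₁)` and their
degree-derivatives `A'`, `B'` (see the two lemmas above), `A B' − A' B = 1 + (2sc/p)(ψ₂ − ψ₁)`
given `q² = p`, `s² + c² = 1`. [folklore] -/
theorem green_limit_algebra (c s g₁ g₂ ψ₁ ψ₂ q p : ℝ) (hq : q ≠ 0) (hg₁ : g₁ ≠ 0) (hg₂ : g₂ ≠ 0)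
    (hπ : q ^ 2 = p) (hsc : s ^ 2 + c ^ 2 = 1) :
    c * g₁ / (q * g₂) * (2 * g₂ / (q * g₁) * (p / 2 * c + 1 / 2 * s * (ψ₂ - ψ₁))) -
      g₁ / (q * g₂) * (-(p / 2) * s + 1 / 2 * c * (ψ₁ - ψ₂)) * (2 * s * g₂ / (q * g₁)) =
      1 + 2 * s * c / p * (ψ₂ - ψ₁) := by
  rw [← hπ]
  field_simp
  linear_combination q ^ 2 * hsc

/-- **Zhou 2015, eq. (Pnu_sqr_0to1)** (Gradshteyn–Ryzhik): for real `ν > −1`, `ν ≠ −1/2`,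
`∫₀¹ P_ν(ξ)² dξ = (1/(2ν+1)) {1 + (sin νπ/π)[ψ((ν+2)/2) − ψ((ν+1)/2)]}`. Proof: let `σ → ν` in
Green's formula `(σ−ν)(σ+ν+1)∫₀¹P_νP_σ = P_ν(0)P_σ'(0) − P_σ(0)P_ν'(0)`, using the continuity of
the left integral in `σ` and the `σ`-derivatives of the closed forms of `P_σ(0)`, `P_σ'(0)`.
[cite: Zhou2015, eq. (Pnu_sqr_0to1) (arXiv p. 19)] -/
theorem integral_legendreP_sq {ν : ℝ} (hν : -1 < ν) (hν' : ν ≠ -1 / 2) :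
    ∫ ξ in (0 : ℝ)..1, legendreP ν ξ ^ 2 =
      1 / (2 * ν + 1) * (1 + Real.sin (ν * π) / π *
        (digammaReal ((ν + 2) / 2) - digammaReal ((ν + 1) / 2))) := by
  -- notation
  set A : ℝ → ℝ := fun σ => legendreP σ 0 with hA
  set B : ℝ → ℝ := fun σ => deriv (legendreP σ) 0 with hB
  set cA : ℝ → ℝ := fun σ => Real.cos (π * σ / 2) * Real.Gamma ((σ + 1) / 2) /
    (√π * Real.Gamma (1 + σ / 2)) with hcA
  set cB : ℝ → ℝ := fun σ => 2 * Real.sin (π * σ / 2) * Real.Gamma (1 + σ / 2) /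
    (√π * Real.Gamma ((σ + 1) / 2)) with hcB
  have hAc : ∀ᶠ σ in 𝓝 ν, A σ = cA σ := by
    filter_upwards [Ioi_mem_nhds hν] with σ hσ using legendreP_zero_eq_cos hσ
  have hBc : ∀ᶠ σ in 𝓝 ν, B σ = cB σ := by
    filter_upwards [Ioi_mem_nhds hν] with σ hσ using deriv_legendreP_zero_eq_sin hσ
  have hAν : A ν = cA ν := hAc.self_of_nhds
  have hBν : B ν = cB ν := hBc.self_of_nhds
  -- the numerator of Green's formula as a function of `σ`, and its derivative at `σ = ν`
  set f : ℝ → ℝ := fun σ => A ν * B σ - A σ * B ν with hf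
  obtain ⟨A', hA'⟩ : ∃ A', HasDerivAt cA A' ν := ⟨_, hasDerivAt_legendreP_zero_closedForm hν⟩
  obtain ⟨B', hB'⟩ : ∃ B', HasDerivAt cB B' ν := ⟨_, hasDerivAt_deriv_legendreP_zero_closedForm hν⟩
  have hfd : HasDerivAt f (A ν * B' - A' * B ν) ν := by
    have hA2 : HasDerivAt A A' ν := hA'.congr_of_eventuallyEq hAc
    have hB2 : HasDerivAt B B' ν := hB'.congr_of_eventuallyEq hBc
    exact (hB2.const_mul (A ν)).sub (hA2.mul_const (B ν))
  have hfν : f ν = 0 := by simp only [hf]; ring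
  -- Green's formula, divided
  have hgreen : ∀ᶠ σ in 𝓝[≠] ν, (∫ ξ in (0 : ℝ)..1, legendreP ν ξ * legendreP σ ξ) =
      slope f ν σ / (σ + ν + 1) := by
    have hne : ∀ᶠ σ in 𝓝 ν, σ + ν + 1 ≠ 0 := by
      have hc : ContinuousAt (fun σ : ℝ => σ + ν + 1) ν := by fun_prop
      exact hc.eventually_ne (by show ν + ν + 1 ≠ 0; intro h; apply hν'; linarith)
    filter_upwards [mem_nhdsWithin_of_mem_nhds hne, self_mem_nhdsWithin] with σ hσ hσν
    rw [slope_def_field, hfν, sub_zero]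
    have hg := integral_legendreP_mul_legendreP ν σ
    have hσν' : σ - ν ≠ 0 := sub_ne_zero.mpr hσν
    simp only [hf, hA, hB]
    field_simp
    linear_combination hg
  -- the two limits of `∫₀¹ P_ν P_σ` as `σ → ν`, `σ ≠ ν`
  have hlim1 : Tendsto (fun σ => ∫ ξ in (0 : ℝ)..1, legendreP ν ξ * legendreP σ ξ) (𝓝[≠] ν)
      (𝓝 ((A ν * B' - A' * B ν) / (2 * ν + 1))) := by
    have h1 : Tendsto (slope f ν) (𝓝[≠] ν) (𝓝 (A ν * B' - A' * B ν)) := hfd.tendsto_slope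
    have h2 : Tendsto (fun σ : ℝ => σ + ν + 1) (𝓝[≠] ν) (𝓝 (2 * ν + 1)) := by
      have : Tendsto (fun σ : ℝ => σ + ν + 1) (𝓝 ν) (𝓝 (ν + ν + 1)) :=
        ((continuous_id.add continuous_const).add continuous_const).continuousAt.tendsto
      rw [show ν + ν + 1 = 2 * ν + 1 by ring] at this
      exact this.mono_left nhdsWithin_le_nhds
    have h3 := h1.div h2 (by intro h; apply hν'; linarith)
    exact h3.congr' (hgreen.mono fun σ hσ => hσ.symm)
  have hlim2 : Tendsto (fun σ => ∫ ξ in (0 : ℝ)..1, legendreP ν ξ * legendreP σ ξ) (𝓝[≠] ν)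
      (𝓝 (∫ ξ in (0 : ℝ)..1, legendreP ν ξ ^ 2)) := by
    have := (continuousAt_integral_legendreP_mul ν ν).tendsto.mono_left
      (nhdsWithin_le_nhds (s := {ν}ᶜ))
    simpa only [sq] using this
  have heq := tendsto_nhds_unique hlim2 hlim1
  rw [heq, hAν, hBν, hA'.unique (hasDerivAt_legendreP_zero_closedForm hν),
    hB'.unique (hasDerivAt_deriv_legendreP_zero_closedForm hν)]
  -- the final algebra: `cos² + sin² = 1`, `sin(νπ) = 2 sin(πν/2) cos(πν/2)`, `√π² = π`
  simp only [hcA, hcB]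
  have hΓ1 : 0 < Real.Gamma ((ν + 1) / 2) := Real.Gamma_pos_of_pos (by linarith)
  have hΓ2 : 0 < Real.Gamma (1 + ν / 2) := Real.Gamma_pos_of_pos (by linarith)
  have hsπ : 0 < √π := Real.sqrt_pos.mpr Real.pi_pos
  have hπ : (√π : ℝ) ^ 2 = π := Real.sq_sqrt Real.pi_pos.le
  have h2ν : 2 * ν + 1 ≠ 0 := by intro h; apply hν'; linarith
  have hsin : Real.sin (ν * π) = 2 * Real.sin (π * ν / 2) * Real.cos (π * ν / 2) := by
    rw [show ν * π = 2 * (π * ν / 2) by ring, Real.sin_two_mul]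
  have hψ : digammaReal ((ν + 2) / 2) = digammaReal (1 + ν / 2) := by
    congr 1; ring
  have hsc := Real.sin_sq_add_cos_sq (π * ν / 2)
  rw [hsin, hψ]
  have key := green_limit_algebra (Real.cos (π * ν / 2)) (Real.sin (π * ν / 2))
    (Real.Gamma ((ν + 1) / 2)) (Real.Gamma (1 + ν / 2)) (digammaReal ((ν + 1) / 2))
    (digammaReal (1 + ν / 2)) √π π hsπ.ne' hΓ1.ne' hΓ2.ne' hπ hsc
  rw [key]
  ring

/-- **Conjunct (i) of `Zhou2015_legendreP_sq_integral`, exactly as vendored**: for real `ν > −1`,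
`ν ≠ −1/2`, `π ∫₀¹ [P_ν(ξ)]² dξ = (π/(2ν+1)) {1 + (sin(νπ)/π) [ψ⁽⁰⁾((ν+2)/2) − ψ⁽⁰⁾((ν+1)/2)]}`.
[cite: Zhou2015, eq. (Pnu_sqr_0to1) (arXiv p. 19)] -/
theorem pi_mul_integral_legendreP_sq {ν : ℝ} (hν : -1 < ν) (hν' : ν ≠ -1 / 2) :
    π * ∫ ξ in (0 : ℝ)..1, legendreP ν ξ ^ 2 =
      π / (2 * ν + 1) *
        (1 + Real.sin (ν * π) / π * (digammaReal ((ν + 2) / 2) - digammaReal ((ν + 1) / 2))) := by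
  rw [integral_legendreP_sq hν hν']
  ring

/-- Conjunct (i) of the named fact, in its quantified form. [cite: Zhou2015, eq. (Pnu_sqr_0to1) (arXiv p. 19)] -/
theorem Zhou2015_legendreP_sq_integral_closedForm :
    ∀ ν : ℝ, -1 < ν → ν ≠ -1 / 2 →
      π * ∫ ξ in (0 : ℝ)..1, legendreP ν ξ ^ 2 =
        π / (2 * ν + 1) *
          (1 + Real.sin (ν * π) / π * (digammaReal ((ν + 2) / 2) - digammaReal ((ν + 1) / 2))) :=
  fun _ hν hν' => pi_mul_integral_legendreP_sq hν hν'

open Literature.Analysis.SpecialFunctions.Complex (digamma_one_sub_sub_digamma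
  digamma_add_digamma_add_half)

/-! ### The level-3 value: `∫₀¹ P_{−1/3}² = 3√3 log 2 / π` -/

/-- `1/3 ∉ ℤ` (as a complex number). [folklore] -/
theorem one_third_ne_int (n : ℤ) : (1 / 3 : ℂ) ≠ n := by
  intro h
  have h' := congrArg Complex.re h
  simp only [Complex.div_re, Complex.one_re, Complex.intCast_re] at h'
  norm_num at h'
  have h3 : (3 : ℝ) * n = 1 := by linarith
  have h4 : (3 : ℤ) * n = 1 := by exact_mod_cast h3
  omega

/-- **`ψ(5/6) − ψ(1/3) = 2π/√3 − 2 log 2`** (duplication at `1/3` and reflection at `1/3`).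
[cite: AndrewsAskeyRoy1999, Thm 1.2.7] -/
theorem digammaReal_five_sixths_sub_one_third :
    digammaReal (5 / 6) - digammaReal (1 / 3) = 2 * π / √3 - 2 * Real.log 2 := by
  -- reflection at 1/3
  have hr := digamma_one_sub_sub_digamma (s := 1 / 3) one_third_ne_int
  have h23 : (1 : ℂ) - 1 / 3 = 2 / 3 := by norm_num
  have harg : (π : ℂ) * (1 / 3) = ((Real.pi / 3 : ℝ) : ℂ) := by push_cast; ring
  rw [h23, harg, ← Complex.ofReal_cos, ← Complex.ofReal_sin, Real.cos_pi_div_three,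
    Real.sin_pi_div_three] at hr
  -- duplication at 1/3
  have hd := digamma_add_digamma_add_half (s := 1 / 3) (by
    intro m h
    have h' := congrArg Complex.re h
    simp at h'
    have : (0 : ℝ) ≤ m := m.cast_nonneg
    linarith)
  have h56 : (1 : ℂ) / 3 + 1 / 2 = 5 / 6 := by norm_num
  have h23' : (2 : ℂ) * (1 / 3) = 2 / 3 := by norm_num
  rw [h56, h23'] at hd
  -- combine and take real parts
  have key : Complex.digamma (5 / 6) - Complex.digamma (1 / 3) =
      2 * (π * ((1 / 2 : ℝ) : ℂ) / ((√3 / 2 : ℝ) : ℂ)) - 2 * Complex.log 2 := by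
    linear_combination hd + 2 * hr
  have hre := congrArg Complex.re key
  have e1 : ((5 / 6 : ℝ) : ℂ) = 5 / 6 := by push_cast; ring
  have e2 : ((1 / 3 : ℝ) : ℂ) = 1 / 3 := by push_cast; ring
  simp only [digammaReal, e1, e2]
  rw [Complex.sub_re] at hre
  rw [hre]
  have hlog : Complex.log 2 = ((Real.log 2 : ℝ) : ℂ) := by
    rw [show (2 : ℂ) = ((2 : ℝ) : ℂ) by norm_num, ← Complex.ofReal_log (by norm_num)]
  rw [hlog]
  have h3 : (√3 : ℝ) ≠ 0 := by positivity
  simp only [← Complex.ofReal_ofNat, ← Complex.ofReal_mul, ← Complex.ofReal_div,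
    ← Complex.ofReal_sub, Complex.ofReal_re]
  field_simp

/-- **Conjunct (iv)b of the fact: `∫₀¹ [P_{−1/3}(ξ)]² dξ = (3√3/π) log 2`** (Zhou 2015, Remark 9,
the level-3 display (G2_Hecke3_spec_val) divided by `−2π/(3√3)`). [cite: Zhou2015, Remark 9, eq. (G2_Hecke3_spec_val) (arXiv p. 19)] -/
theorem integral_legendreP_neg_one_third_sq :
    ∫ ξ in (0 : ℝ)..1, legendreP (-1 / 3) ξ ^ 2 = 3 * √3 / π * Real.log 2 := by
  have h := integral_legendreP_sq (ν := -1 / 3) (by norm_num) (by norm_num)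
  rw [h]
  have e1 : ((-1 : ℝ) / 3 + 2) / 2 = 5 / 6 := by norm_num
  have e2 : ((-1 : ℝ) / 3 + 1) / 2 = 1 / 3 := by norm_num
  have e3 : Real.sin (-1 / 3 * π) = -(√3 / 2) := by
    rw [show (-1 : ℝ) / 3 * π = -(π / 3) by ring, Real.sin_neg, Real.sin_pi_div_three]
  rw [e1, e2, e3, digammaReal_five_sixths_sub_one_third]
  have h3 : (√3 : ℝ) ≠ 0 := by positivity
  field_simp
  ring



open Literature.Analysis.SpecialFunctions.Complex (hasSum_one_div_sub_one_div_digamma)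

/-! ### Digamma differences as series and as integrals (towards the level-1 and level-2 values) -/

/-- **`ψ(x+a) − ψ(x) = Σₖ [1/(x+k) − 1/(x+a+k)]`** for real `x > 0`, `a ≥ 0` (difference of two
instances of Andrews–Askey–Roy (1.2.13)). [cite: AndrewsAskeyRoy1999, Thm 1.2.5 (1.2.13)] -/
theorem hasSum_inv_sub_inv_digammaReal {x a : ℝ} (hx : 0 < x) (ha : 0 ≤ a) :
    HasSum (fun k : ℕ => 1 / (x + k) - 1 / (x + a + k))
      (digammaReal (x + a) - digammaReal x) := by
  have h1 := hasSum_one_div_sub_one_div_digamma (w := (x : ℂ)) (by simpa using hx)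
  have h2 := hasSum_one_div_sub_one_div_digamma (w := ((x + a : ℝ) : ℂ))
    (by simp only [Complex.ofReal_re]; linarith)
  have h := Complex.reCLM.hasSum (h2.sub h1)
  have hf : (fun k : ℕ => Complex.reCLM ((1 / ((k : ℂ) + 1) - 1 / (((x + a : ℝ) : ℂ) + k)) -
      (1 / ((k : ℂ) + 1) - 1 / ((x : ℂ) + k)))) = fun k : ℕ => 1 / (x + k) - 1 / (x + a + k) := by
    funext k
    rw [Complex.reCLM_apply,
      show (1 / ((k : ℂ) + 1) - 1 / (((x + a : ℝ) : ℂ) + k)) - (1 / ((k : ℂ) + 1) - 1 / ((x : ℂ) + k)) =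
        ((1 / (x + k) - 1 / (x + a + k) : ℝ) : ℂ) by push_cast; ring, Complex.ofReal_re]
  rw [hf, Complex.reCLM_apply] at h
  convert h using 1
  simp only [digammaReal, Complex.sub_re, Complex.add_re, Complex.ofReal_re]
  push_cast
  ring

/-- Termwise integration of `Σₖ t^{qk}(tⁱ − tʲ) = (tⁱ − tʲ)/(1 − t^q)` over `[0, 1]`
(`i ≤ j ≤ q`, `q ≥ 1`): `Σₖ [1/(qk+i+1) − 1/(qk+j+1)] = ∫₀¹ (tⁱ − tʲ)/(1 − t^q) dt`. [folklore] -/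
theorem hasSum_inv_sub_inv_eq_integral {q i j : ℕ} (hq : 0 < q) (hij : i ≤ j) (hjq : j ≤ q) :
    HasSum (fun k : ℕ => 1 / ((q : ℝ) * k + i + 1) - 1 / ((q : ℝ) * k + j + 1))
      (∫ t in (0 : ℝ)..1, (t ^ i - t ^ j) / (1 - t ^ q)) := by
  set F : ℕ → ℝ → ℝ := fun k t => t ^ (q * k) * (t ^ i - t ^ j) with hF
  set g : ℝ → ℝ := fun t => (t ^ i - t ^ j) / (1 - t ^ q) with hg
  -- pointwise facts on `(0, 1]`
  have hnonneg : ∀ t ∈ Set.Ioc (0 : ℝ) 1, 0 ≤ t ^ i - t ^ j := fun t ht =>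
    sub_nonneg.mpr (pow_le_pow_of_le_one ht.1.le ht.2 hij)
  have hle : ∀ t ∈ Set.Ioc (0 : ℝ) 1, t ^ i - t ^ j ≤ 1 - t ^ q := fun t ht => by
    have h1 : t ^ i ≤ 1 := pow_le_one₀ ht.1.le ht.2
    have h2 : t ^ q ≤ t ^ j := pow_le_pow_of_le_one ht.1.le ht.2 hjq
    linarith
  have hsum : ∀ t ∈ Set.Ioc (0 : ℝ) 1, HasSum (fun k => F k t) (g t) := by
    intro t ht
    rcases ht.2.eq_or_lt with rfl | hlt
    · simp only [hF, hg, one_pow, sub_self, mul_zero, div_zero]; exact hasSum_zero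
    · have htq : t ^ q < 1 := pow_lt_one₀ ht.1.le hlt hq.ne'
      have h := (hasSum_geometric_of_lt_one (pow_nonneg ht.1.le q) htq).mul_left (t ^ i - t ^ j)
      have e : (fun k => F k t) = fun k : ℕ => (t ^ i - t ^ j) * (t ^ q) ^ k := by
        funext k; simp only [hF]; rw [← pow_mul]; ring
      have ev : g t = (t ^ i - t ^ j) * (1 - t ^ q)⁻¹ := by simp only [hg, div_eq_mul_inv]
      rw [e, ev]; exact h
  have hmain := intervalIntegral.hasSum_integral_of_dominated_convergence (μ := volume)
    (a := 0) (b := 1) (F := F) (f := g) F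
    (fun k => by
      apply Continuous.aestronglyMeasurable
      simp only [hF]; fun_prop)
    (fun k => ae_of_all _ fun t ht => by
      rw [Set.uIoc_of_le zero_le_one] at ht
      rw [Real.norm_eq_abs, abs_of_nonneg]
      exact mul_nonneg (pow_nonneg ht.1.le _) (hnonneg t ht))
    (ae_of_all _ fun t ht => by
      rw [Set.uIoc_of_le zero_le_one] at ht
      exact (hsum t ht).summable)
    (by
      -- `∑' k, F k t = g t` on `(0,1]`, and `g` is bounded by `1` there
      have heq : Set.EqOn g (fun t => ∑' k, F k t) (Set.uIoc (0 : ℝ) 1) := fun t ht => by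
        rw [Set.uIoc_of_le zero_le_one] at ht
        exact ((hsum t ht).tsum_eq).symm
      have hgi : IntervalIntegrable g volume 0 1 := by
        rw [intervalIntegrable_iff]
        refine Measure.integrableOn_of_bounded (M := 1) (by simp) ?_ ?_
        · apply Measurable.aestronglyMeasurable
          simp only [hg]; fun_prop
        · rw [ae_restrict_iff' measurableSet_uIoc]
          refine ae_of_all _ fun t ht => ?_
          rw [Set.uIoc_of_le zero_le_one] at ht
          rw [Real.norm_eq_abs]
          simp only [hg]
          rcases ht.2.eq_or_lt with rfl | hlt
          · simp
          · have hpos : 0 < 1 - t ^ q := sub_pos.mpr (pow_lt_one₀ ht.1.le hlt hq.ne')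
            rw [abs_of_nonneg (div_nonneg (hnonneg t ht) hpos.le), div_le_one hpos]
            exact hle t ht
      exact hgi.congr heq)
    (ae_of_all _ fun t ht => by
      rw [Set.uIoc_of_le zero_le_one] at ht
      exact hsum t ht)
  -- evaluate the termwise integrals
  have hFk : ∀ k : ℕ, ∫ t in (0 : ℝ)..1, F k t =
      1 / ((q : ℝ) * k + i + 1) - 1 / ((q : ℝ) * k + j + 1) := by
    intro k
    have e : (fun t => F k t) = fun t : ℝ => t ^ (q * k + i) - t ^ (q * k + j) := by
      funext t; simp only [hF, pow_add]; ring
    rw [e, intervalIntegral.integral_sub (intervalIntegral.intervalIntegrable_pow _)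
      (intervalIntegral.intervalIntegrable_pow _), integral_pow, integral_pow]
    push_cast
    simp
  simpa only [hFk] using hmain

/-! ### Two elementary integrals: `∫₀¹ t²/(1+t⁴)` and `∫₀¹ t⁴/(1+t⁶)` -/

/-- **`∫₀¹ t²/(1+t⁴) dt = (π − 2 log(1+√2))/(4√2)`** (antiderivative
`(1/(4√2)) log((t²−√2t+1)/(t²+√2t+1)) + (1/(2√2))(arctan(√2t+1) + arctan(√2t−1))`). [folklore] -/
theorem integral_sq_div_one_add_pow_four :
    ∫ t in (0 : ℝ)..1, t ^ 2 / (1 + t ^ 4) = (π - 2 * Real.log (1 + √2)) / (4 * √2) := by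
  set s : ℝ := √2 with hs_def
  have hs : s ^ 2 = 2 := Real.sq_sqrt (by norm_num)
  have hs0 : 0 < s := Real.sqrt_pos.mpr (by norm_num)
  -- the quadratic factors of `1 + t⁴`
  have hp₁ : ∀ t : ℝ, 0 < t ^ 2 - s * t + 1 := fun t => by nlinarith [sq_nonneg (s * t - 1)]
  have hp₂ : ∀ t : ℝ, 0 < t ^ 2 + s * t + 1 := fun t => by nlinarith [sq_nonneg (s * t + 1)]
  have hprod : ∀ t : ℝ, (t ^ 2 - s * t + 1) * (t ^ 2 + s * t + 1) = 1 + t ^ 4 := fun t => by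
    linear_combination (-t ^ 2) * hs
  -- the antiderivative
  set F : ℝ → ℝ := fun t => 1 / (4 * s) * (Real.log (t ^ 2 - s * t + 1) - Real.log (t ^ 2 + s * t + 1)) +
    1 / (2 * s) * (Real.arctan (s * t + 1) + Real.arctan (s * t - 1)) with hF
  have hderiv : ∀ t : ℝ, HasDerivAt F (t ^ 2 / (1 + t ^ 4)) t := by
    intro t
    have hq₁ : 1 + (s * t - 1) ^ 2 = 2 * (t ^ 2 - s * t + 1) := by linear_combination t ^ 2 * hs
    have hq₂ : 1 + (s * t + 1) ^ 2 = 2 * (t ^ 2 + s * t + 1) := by linear_combination t ^ 2 * hs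
    have h1 : HasDerivAt (fun t : ℝ => t ^ 2 - s * t + 1) (2 * t - s) t := by
      simpa using ((hasDerivAt_pow 2 t).sub ((hasDerivAt_id' t).const_mul s)).add_const 1
    have h2 : HasDerivAt (fun t : ℝ => t ^ 2 + s * t + 1) (2 * t + s) t := by
      simpa using ((hasDerivAt_pow 2 t).add ((hasDerivAt_id' t).const_mul s)).add_const 1
    have hlog : HasDerivAt (fun t : ℝ => Real.log (t ^ 2 - s * t + 1) - Real.log (t ^ 2 + s * t + 1))
        (2 * s * (t ^ 2 - 1) / (1 + t ^ 4)) t := by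
      have h := (h1.log (hp₁ t).ne').sub (h2.log (hp₂ t).ne')
      refine h.congr_deriv ?_
      have hp1t := (hp₁ t).ne'
      have hp2t := (hp₂ t).ne'
      rw [← hprod t]
      set p₁ := t ^ 2 - s * t + 1 with hp1def
      set p₂ := t ^ 2 + s * t + 1 with hp2def
      rw [div_sub_div _ _ hp1t hp2t, div_eq_div_iff (mul_ne_zero hp1t hp2t) (mul_ne_zero hp1t hp2t)]
      simp only [hp1def, hp2def]
      ring
    have h3 : HasDerivAt (fun t : ℝ => s * t + 1) s t := by
      simpa using ((hasDerivAt_id' t).const_mul s).add_const 1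
    have h4 : HasDerivAt (fun t : ℝ => s * t - 1) s t := by
      simpa using ((hasDerivAt_id' t).const_mul s).sub_const 1
    have harc : HasDerivAt (fun t : ℝ => Real.arctan (s * t + 1) + Real.arctan (s * t - 1))
        (s * (t ^ 2 + 1) / (1 + t ^ 4)) t := by
      have h := h3.arctan.add h4.arctan
      refine h.congr_deriv ?_
      have hp1t := (hp₁ t).ne'
      have hp2t := (hp₂ t).ne'
      rw [hq₁, hq₂, ← hprod t]
      set p₁ := t ^ 2 - s * t + 1 with hp1def
      set p₂ := t ^ 2 + s * t + 1 with hp2def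
      have e4 : (4 : ℝ) ≠ 0 := by norm_num
      have e2 : (2 : ℝ) ≠ 0 := by norm_num
      rw [div_mul_eq_mul_div, div_mul_eq_mul_div, div_add_div _ _ (by positivity) (by positivity),
        div_eq_div_iff (by positivity) (mul_ne_zero hp1t hp2t)]
      simp only [hp1def, hp2def]
      ring
    have h := (hlog.const_mul (1 / (4 * s))).add (harc.const_mul (1 / (2 * s)))
    refine h.congr_deriv ?_
    have h14 : (0 : ℝ) < 1 + t ^ 4 := by positivity
    field_simp
    ring
  -- the fundamental theorem of calculus
  have hint : IntervalIntegrable (fun t : ℝ => t ^ 2 / (1 + t ^ 4)) volume 0 1 := by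
    apply Continuous.intervalIntegrable
    exact Continuous.div (by fun_prop) (by fun_prop) fun t => by positivity
  rw [intervalIntegral.integral_eq_sub_of_hasDerivAt (fun t _ => hderiv t) hint]
  -- evaluate `F 1 - F 0`
  have h2s : 0 < 2 - s := by nlinarith
  have hlog2 : Real.log (2 - s) - Real.log (2 + s) = -2 * Real.log (1 + s) := by
    have hfac : (2 - s) * (1 + s) ^ 2 = 2 + s := by linear_combination (-s) * hs
    have : Real.log (2 + s) = Real.log (2 - s) + 2 * Real.log (1 + s) := by
      rw [← hfac, Real.log_mul h2s.ne' (by positivity), Real.log_pow]; push_cast; ring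
    rw [this]; ring
  have harc2 : Real.arctan (s + 1) + Real.arctan (s - 1) = π / 2 := by
    have hinv : s - 1 = (s + 1)⁻¹ := by
      rw [inv_eq_one_div, eq_div_iff (by positivity)]; linear_combination hs
    rw [hinv, Real.arctan_inv_of_pos (by positivity)]; ring
  have hF1 : F 1 = 1 / (4 * s) * (-2 * Real.log (1 + s)) + 1 / (2 * s) * (π / 2) := by
    simp only [hF]
    rw [show (1 : ℝ) ^ 2 - s * 1 + 1 = 2 - s by ring, show (1 : ℝ) ^ 2 + s * 1 + 1 = 2 + s by ring,
      show s * 1 + 1 = s + 1 by ring, show s * 1 - 1 = s - 1 by ring, hlog2, harc2]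
  have hF0 : F 0 = 0 := by
    simp only [hF]
    rw [show (0 : ℝ) ^ 2 - s * 0 + 1 = 1 by ring, show (0 : ℝ) ^ 2 + s * 0 + 1 = 1 by ring,
      show s * 0 + 1 = 1 by ring, show s * 0 - 1 = -1 by ring, Real.arctan_neg, Real.log_one]
    ring
  rw [hF1, hF0]
  field_simp
  ring

/-- **`∫₀¹ t⁴/(1+t⁶) dt = (π − √3 log(2+√3))/6`** (partial fractions
`t⁴/(1+t⁶) = (1/3)/(1+t²) + (1/3)(2t²−1)/(t⁴−t²+1)` and the antiderivative
`(1/3)arctan t + (1/(4√3)) log((t²−√3t+1)/(t²+√3t+1)) + (1/6)(arctan(2t+√3) + arctan(2t−√3))`).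
[folklore] -/
theorem integral_pow_four_div_one_add_pow_six :
    ∫ t in (0 : ℝ)..1, t ^ 4 / (1 + t ^ 6) = (π - √3 * Real.log (2 + √3)) / 6 := by
  set s : ℝ := √3 with hs_def
  have hs : s ^ 2 = 3 := Real.sq_sqrt (by norm_num)
  have hs0 : 0 < s := Real.sqrt_pos.mpr (by norm_num)
  have hp₁ : ∀ t : ℝ, 0 < t ^ 2 - s * t + 1 := fun t => by nlinarith [sq_nonneg (2 * t - s)]
  have hp₂ : ∀ t : ℝ, 0 < t ^ 2 + s * t + 1 := fun t => by nlinarith [sq_nonneg (2 * t + s)]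
  have hprod : ∀ t : ℝ, (t ^ 2 - s * t + 1) * (t ^ 2 + s * t + 1) = t ^ 4 - t ^ 2 + 1 := fun t => by
    linear_combination (-t ^ 2) * hs
  have hQ : ∀ t : ℝ, (0 : ℝ) < t ^ 4 - t ^ 2 + 1 := fun t => by nlinarith [sq_nonneg (t ^ 2 - 1), sq_nonneg t]
  set F : ℝ → ℝ := fun t => 1 / 3 * Real.arctan t +
    1 / (4 * s) * (Real.log (t ^ 2 - s * t + 1) - Real.log (t ^ 2 + s * t + 1)) +
    1 / 6 * (Real.arctan (2 * t + s) + Real.arctan (2 * t - s)) with hF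
  have hderiv : ∀ t : ℝ, HasDerivAt F (t ^ 4 / (1 + t ^ 6)) t := by
    intro t
    have hq₁ : 1 + (2 * t - s) ^ 2 = 4 * (t ^ 2 - s * t + 1) := by linear_combination hs
    have hq₂ : 1 + (2 * t + s) ^ 2 = 4 * (t ^ 2 + s * t + 1) := by linear_combination hs
    have h1 : HasDerivAt (fun t : ℝ => t ^ 2 - s * t + 1) (2 * t - s) t := by
      simpa using ((hasDerivAt_pow 2 t).sub ((hasDerivAt_id' t).const_mul s)).add_const 1
    have h2 : HasDerivAt (fun t : ℝ => t ^ 2 + s * t + 1) (2 * t + s) t := by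
      simpa using ((hasDerivAt_pow 2 t).add ((hasDerivAt_id' t).const_mul s)).add_const 1
    have hlog : HasDerivAt (fun t : ℝ => Real.log (t ^ 2 - s * t + 1) - Real.log (t ^ 2 + s * t + 1))
        (2 * s * (t ^ 2 - 1) / (t ^ 4 - t ^ 2 + 1)) t := by
      have h := (h1.log (hp₁ t).ne').sub (h2.log (hp₂ t).ne')
      refine h.congr_deriv ?_
      have hp1t := (hp₁ t).ne'
      have hp2t := (hp₂ t).ne'
      rw [← hprod t]
      set p₁ := t ^ 2 - s * t + 1 with hp1def
      set p₂ := t ^ 2 + s * t + 1 with hp2def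
      rw [div_sub_div _ _ hp1t hp2t, div_eq_div_iff (mul_ne_zero hp1t hp2t) (mul_ne_zero hp1t hp2t)]
      simp only [hp1def, hp2def]
      ring
    have h3 : HasDerivAt (fun t : ℝ => 2 * t + s) 2 t := by
      simpa using ((hasDerivAt_id' t).const_mul 2).add_const s
    have h4 : HasDerivAt (fun t : ℝ => 2 * t - s) 2 t := by
      simpa using ((hasDerivAt_id' t).const_mul 2).sub_const s
    have harc : HasDerivAt (fun t : ℝ => Real.arctan (2 * t + s) + Real.arctan (2 * t - s))
        ((t ^ 2 + 1) / (t ^ 4 - t ^ 2 + 1)) t := by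
      have h := h3.arctan.add h4.arctan
      refine h.congr_deriv ?_
      have hp1t := (hp₁ t).ne'
      have hp2t := (hp₂ t).ne'
      rw [hq₁, hq₂, ← hprod t]
      set p₁ := t ^ 2 - s * t + 1 with hp1def
      set p₂ := t ^ 2 + s * t + 1 with hp2def
      have e4 : (4 : ℝ) ≠ 0 := by norm_num
      have e2 : (2 : ℝ) ≠ 0 := by norm_num
      rw [div_mul_eq_mul_div, div_mul_eq_mul_div, div_add_div _ _ (by positivity) (by positivity),
        div_eq_div_iff (by positivity) (mul_ne_zero hp1t hp2t)]
      simp only [hp1def, hp2def]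
      ring
    have h := (((Real.hasDerivAt_arctan t).const_mul (1 / 3)).add (hlog.const_mul (1 / (4 * s)))).add
      (harc.const_mul (1 / 6))
    refine h.congr_deriv ?_
    have h6 : (1 : ℝ) + t ^ 6 = (1 + t ^ 2) * (t ^ 4 - t ^ 2 + 1) := by ring
    have h12 : (0 : ℝ) < 1 + t ^ 2 := by positivity
    have hQt' : (t ^ 4 - t ^ 2 + 1 : ℝ) ≠ 0 := (hQ t).ne'
    rw [h6]
    set Q := t ^ 4 - t ^ 2 + 1 with hQdef
    set R := (1 : ℝ) + t ^ 2 with hRdef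
    have hR0 : R ≠ 0 := h12.ne'
    have hs0' : s ≠ 0 := hs0.ne'
    field_simp
    simp only [hQdef, hRdef]
    ring
  have hint : IntervalIntegrable (fun t : ℝ => t ^ 4 / (1 + t ^ 6)) volume 0 1 := by
    apply Continuous.intervalIntegrable
    exact Continuous.div (by fun_prop) (by fun_prop) fun t => by positivity
  rw [intervalIntegral.integral_eq_sub_of_hasDerivAt (fun t _ => hderiv t) hint]
  have h2s : 0 < 2 - s := by nlinarith
  have hlog2 : Real.log (2 - s) - Real.log (2 + s) = -2 * Real.log (2 + s) := by
    have hfac : (2 - s) = (2 + s)⁻¹ := by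
      rw [inv_eq_one_div, eq_div_iff (by positivity)]; linear_combination (-1 : ℝ) * hs
    rw [hfac, Real.log_inv]; ring
  have harc2 : Real.arctan (2 + s) + Real.arctan (2 - s) = π / 2 := by
    have hinv : 2 - s = (2 + s)⁻¹ := by
      rw [inv_eq_one_div, eq_div_iff (by positivity)]; linear_combination (-1 : ℝ) * hs
    rw [hinv, Real.arctan_inv_of_pos (by positivity)]; ring
  have hF1 : F 1 = 1 / 3 * (π / 4) + 1 / (4 * s) * (-2 * Real.log (2 + s)) + 1 / 6 * (π / 2) := by
    simp only [hF]
    rw [show (1 : ℝ) ^ 2 - s * 1 + 1 = 2 - s by ring, show (1 : ℝ) ^ 2 + s * 1 + 1 = 2 + s by ring,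
      show 2 * 1 + s = 2 + s by ring, show 2 * 1 - s = 2 - s by ring, hlog2, harc2, Real.arctan_one]
  have hF0 : F 0 = 0 := by
    simp only [hF]
    rw [show (0 : ℝ) ^ 2 - s * 0 + 1 = 1 by ring, show (0 : ℝ) ^ 2 + s * 0 + 1 = 1 by ring,
      show 2 * 0 + s = s by ring, show 2 * 0 - s = -s by ring, Real.arctan_neg, Real.log_one,
      Real.arctan_zero]
    ring
  rw [hF1, hF0]
  field_simp
  linear_combination (24 * Real.log (2 + s)) * hs

/-! ### Gauss's digamma values at eighths and twelfths; the level-2 and level-1 values -/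

/-- Lebesgue-almost every real number is `≠ 1`. [folklore] -/
theorem ae_ne_one : ∀ᵐ t : ℝ, t ≠ 1 := by
  rw [ae_iff]; simp

/-- **`ψ(7/8) − ψ(3/8) = π√2 − 2√2 log(1+√2)`** (the case `p/q ∈ {3/8, 7/8}` of Gauss's digamma
theorem, via `ψ(7/8) − ψ(3/8) = 8 Σₖ [1/(8k+3) − 1/(8k+7)] = 8∫₀¹ t²/(1+t⁴) dt`).
[cite: AndrewsAskeyRoy1999, Thm 1.2.7] -/
theorem digammaReal_seven_eighths_sub_three_eighths :
    digammaReal (7 / 8) - digammaReal (3 / 8) = π * √2 - 2 * √2 * Real.log (1 + √2) := by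
  have h1 := hasSum_inv_sub_inv_digammaReal (x := 3 / 8) (a := 1 / 2) (by norm_num) (by norm_num)
  rw [show (3 : ℝ) / 8 + 1 / 2 = 7 / 8 by norm_num] at h1
  have h2 := (hasSum_inv_sub_inv_eq_integral (q := 8) (i := 2) (j := 6) (by norm_num) (by norm_num)
    (by norm_num)).mul_left 8
  have hf : (fun k : ℕ => 1 / (3 / 8 + (k : ℝ)) - 1 / (7 / 8 + (k : ℝ))) =
      fun k : ℕ => 8 * (1 / ((8 : ℕ) * (k : ℝ) + (2 : ℕ) + 1) - 1 / ((8 : ℕ) * (k : ℝ) + (6 : ℕ) + 1)) := by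
    funext k
    have hk : (0 : ℝ) ≤ k := k.cast_nonneg
    push_cast
    field_simp
    ring
  rw [hf] at h1
  have heq := h1.unique h2
  have hI : ∫ t in (0 : ℝ)..1, (t ^ 2 - t ^ 6) / (1 - t ^ 8) = ∫ t in (0 : ℝ)..1, t ^ 2 / (1 + t ^ 4) := by
    refine intervalIntegral.integral_congr_ae ?_
    filter_upwards [ae_ne_one] with t ht hmem
    rw [Set.uIoc_of_le zero_le_one] at hmem
    have hlt : t < 1 := lt_of_le_of_ne hmem.2 ht
    have h4 : (0 : ℝ) < 1 - t ^ 4 := sub_pos.mpr (pow_lt_one₀ hmem.1.le hlt (by norm_num))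
    have h4' : (0 : ℝ) < 1 + t ^ 4 := by positivity
    rw [div_eq_div_iff (by nlinarith) h4'.ne']
    ring
  rw [heq, hI, integral_sq_div_one_add_pow_four]
  have hs : (√2 : ℝ) ^ 2 = 2 := Real.sq_sqrt (by norm_num)
  have hs0 : (0 : ℝ) < √2 := Real.sqrt_pos.mpr (by norm_num)
  field_simp
  linear_combination (-4 * (π - 2 * Real.log (1 + √2))) * hs

/-- **Conjunct (iii)b of the fact: `∫₀¹ [P_{−1/4}(ξ)]² dξ = (4/π) log(1+√2)`** (Zhou 2015, Remark 9,
the level-2 display (G2_Hecke2_spec_val) divided by `−π/√2`). [cite: Zhou2015, Remark 9, eq. (G2_Hecke2_spec_val) (arXiv p. 19)] -/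
theorem integral_legendreP_neg_one_quarter_sq :
    ∫ ξ in (0 : ℝ)..1, legendreP (-1 / 4) ξ ^ 2 = 4 / π * Real.log (1 + √2) := by
  have h := integral_legendreP_sq (ν := -1 / 4) (by norm_num) (by norm_num)
  rw [h]
  have e1 : ((-1 : ℝ) / 4 + 2) / 2 = 7 / 8 := by norm_num
  have e2 : ((-1 : ℝ) / 4 + 1) / 2 = 3 / 8 := by norm_num
  have e3 : Real.sin (-1 / 4 * π) = -(√2 / 2) := by
    rw [show (-1 : ℝ) / 4 * π = -(π / 4) by ring, Real.sin_neg, Real.sin_pi_div_four]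
  rw [e1, e2, e3, digammaReal_seven_eighths_sub_three_eighths]
  have hs : (√2 : ℝ) ^ 2 = 2 := Real.sq_sqrt (by norm_num)
  have hs0 : (0 : ℝ) < √2 := Real.sqrt_pos.mpr (by norm_num)
  field_simp
  linear_combination (2 * Real.log (1 + √2) - π) * hs

/-- **`ψ(11/12) − ψ(5/12) = 2π − 2√3 log(2+√3)`** (the case `p/q ∈ {5/12, 11/12}` of Gauss's
digamma theorem, via `ψ(11/12) − ψ(5/12) = 12 Σₖ [1/(12k+5) − 1/(12k+11)] = 12∫₀¹ t⁴/(1+t⁶) dt`).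
[cite: AndrewsAskeyRoy1999, Thm 1.2.7] -/
theorem digammaReal_eleven_twelfths_sub_five_twelfths :
    digammaReal (11 / 12) - digammaReal (5 / 12) = 2 * π - 2 * √3 * Real.log (2 + √3) := by
  have h1 := hasSum_inv_sub_inv_digammaReal (x := 5 / 12) (a := 1 / 2) (by norm_num) (by norm_num)
  rw [show (5 : ℝ) / 12 + 1 / 2 = 11 / 12 by norm_num] at h1
  have h2 := (hasSum_inv_sub_inv_eq_integral (q := 12) (i := 4) (j := 10) (by norm_num) (by norm_num)
    (by norm_num)).mul_left 12
  have hf : (fun k : ℕ => 1 / (5 / 12 + (k : ℝ)) - 1 / (11 / 12 + (k : ℝ))) =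
      fun k : ℕ => 12 * (1 / ((12 : ℕ) * (k : ℝ) + (4 : ℕ) + 1) - 1 / ((12 : ℕ) * (k : ℝ) + (10 : ℕ) + 1)) := by
    funext k
    have hk : (0 : ℝ) ≤ k := k.cast_nonneg
    push_cast
    field_simp
    ring
  rw [hf] at h1
  have heq := h1.unique h2
  have hI : ∫ t in (0 : ℝ)..1, (t ^ 4 - t ^ 10) / (1 - t ^ 12) = ∫ t in (0 : ℝ)..1, t ^ 4 / (1 + t ^ 6) := by
    refine intervalIntegral.integral_congr_ae ?_
    filter_upwards [ae_ne_one] with t ht hmem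
    rw [Set.uIoc_of_le zero_le_one] at hmem
    have hlt : t < 1 := lt_of_le_of_ne hmem.2 ht
    have h6 : (0 : ℝ) < 1 - t ^ 6 := sub_pos.mpr (pow_lt_one₀ hmem.1.le hlt (by norm_num))
    have h6' : (0 : ℝ) < 1 + t ^ 6 := by positivity
    rw [div_eq_div_iff (by nlinarith) h6'.ne']
    ring
  rw [heq, hI, integral_pow_four_div_one_add_pow_six]
  ring

/-- **Conjunct (ii)b of the fact: `∫₀¹ [P_{−1/6}(ξ)]² dξ = (3√3/(2π)) log(2+√3)`** (Zhou 2015,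
Remark 9, the level-1 display (G2_ell3_i_spec_val) divided by `−8π/3`). [cite: Zhou2015, Remark 9, eq. (G2_ell3_i_spec_val) (arXiv p. 19)] -/
theorem integral_legendreP_neg_one_sixth_sq :
    ∫ ξ in (0 : ℝ)..1, legendreP (-1 / 6) ξ ^ 2 = 3 * √3 / (2 * π) * Real.log (2 + √3) := by
  have h := integral_legendreP_sq (ν := -1 / 6) (by norm_num) (by norm_num)
  rw [h]
  have e1 : ((-1 : ℝ) / 6 + 2) / 2 = 11 / 12 := by norm_num
  have e2 : ((-1 : ℝ) / 6 + 1) / 2 = 5 / 12 := by norm_num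
  have e3 : Real.sin (-1 / 6 * π) = -(1 / 2) := by
    rw [show (-1 : ℝ) / 6 * π = -(π / 6) by ring, Real.sin_neg, Real.sin_pi_div_six]
  rw [e1, e2, e3, digammaReal_eleven_twelfths_sub_five_twelfths]
  field_simp
  ring


/-! ### What remains: the fact reduces to the three Green's-function evaluations -/

/-- **Reduction of the named fact to Zhou's three Green's-function values.** With conjunct (i) and
the three Legendre-square integrals proved above, `Zhou2015_legendreP_sq_integral` is equivalent to
the three CM evaluations of the weight-4 Green's functions printed in Remark 9 (in the tree's
normalisation `higherGreen N 2 1 = 2 G₂^{ℌ/Γ̄₀(N)}`):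
`higherGreen 1 2 1 ρ i = −8√3 log(2+√3)`, `higherGreen 2 2 1 ((i−1)/2) (i/√2) = −(8/√2) log(1+√2)`,
`higherGreen 3 2 1 ((3+i√3)/6) (i/√3) = −4 log 2` — the content of Zhou's Theorem (eqs.
(G2_z_z'_arb), (G2Hecke234_Pnu)) at these points, not proved here. (The converse implications are
`Zhou2015_legendreP_sq_integral.green_level_one/two/three`.) [cite: Zhou2015, Remark 9, eqs. (G2_ell3_i_spec_val)–(G2_Hecke3_spec_val) (arXiv p. 19)] -/
theorem Zhou2015_legendreP_sq_integral_of_green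
    (h₁ : higherGreen 1 2 1 cmRho UpperHalfPlane.I = -(8 * √3) * Real.log (2 + √3))
    (h₂ : higherGreen 2 2 1 cmLevelTwo cmLevelTwo' = -(8 / √2) * Real.log (1 + √2))
    (h₃ : higherGreen 3 2 1 cmLevelThree cmLevelThree' = -4 * Real.log 2) :
    Zhou2015_legendreP_sq_integral := by
  have hπ : π ≠ 0 := Real.pi_ne_zero
  have h3 : (√3 : ℝ) ≠ 0 := by positivity
  have h3sq : (√3 : ℝ) ^ 2 = 3 := Real.sq_sqrt (by norm_num)
  have h2 : (√2 : ℝ) ≠ 0 := by positivity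
  refine ⟨Zhou2015_legendreP_sq_integral_closedForm, ⟨?_, integral_legendreP_neg_one_sixth_sq⟩,
    ⟨?_, integral_legendreP_neg_one_quarter_sq⟩, ⟨?_, integral_legendreP_neg_one_third_sq⟩⟩
  · rw [integral_legendreP_neg_one_sixth_sq, h₁]
    field_simp
    ring
  · rw [integral_legendreP_neg_one_quarter_sq, h₂]
    field_simp
    ring
  · rw [integral_legendreP_neg_one_third_sq, h₃]
    field_simp

/-- The fact is **equivalent** to the three Green's-function values (given the analysis of this
file). [cite: Zhou2015, Remark 9 (arXiv p. 19)] -/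
theorem Zhou2015_legendreP_sq_integral_iff_green :
    Zhou2015_legendreP_sq_integral ↔
      (higherGreen 1 2 1 cmRho UpperHalfPlane.I = -(8 * √3) * Real.log (2 + √3) ∧
        higherGreen 2 2 1 cmLevelTwo cmLevelTwo' = -(8 / √2) * Real.log (1 + √2) ∧
        higherGreen 3 2 1 cmLevelThree cmLevelThree' = -4 * Real.log 2) := by
  constructor
  · intro h
    refine ⟨?_, h.green_level_two, h.green_level_three⟩
    rw [h.green_level_one]
    have h3 : (√3 : ℝ) ≠ 0 := by positivity
    have h3sq : (√3 : ℝ) ^ 2 = 3 := Real.sq_sqrt (by norm_num)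
    field_simp
    rw [h3sq]
    ring
  · rintro ⟨h₁, h₂, h₃⟩
    exact Zhou2015_legendreP_sq_integral_of_green h₁ h₂ h₃

/-! ### Heine's integrals in closed form: `Q₀(t) = ½ log((t+1)/(t−1))`, `Q₁(t) = (t/2) log((t+1)/(t−1)) − 1` -/

/-- The logarithmic antiderivative behind Heine's integral: with `b = √(t²−1)`, `c = t − b`
(`t > 1`), `H(u) = log(1+c+(1−c)e⁻ᵘ) − log(1−c+(1+c)e⁻ᵘ)` satisfies `H'(u) = 1/(t + b cosh u)`.
[folklore] -/
theorem hasDerivAt_heine_log {t : ℝ} (ht : 1 < t) (u : ℝ) :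
    HasDerivAt (fun u : ℝ => Real.log (1 + (t - √(t ^ 2 - 1)) + (1 - (t - √(t ^ 2 - 1))) * Real.exp (-u)) -
        Real.log (1 - (t - √(t ^ 2 - 1)) + (1 + (t - √(t ^ 2 - 1))) * Real.exp (-u)))
      (t + √(t ^ 2 - 1) * Real.cosh u)⁻¹ u := by
  set b : ℝ := √(t ^ 2 - 1) with hb_def
  have ht2 : 0 < t ^ 2 - 1 := by nlinarith
  have hb2 : b ^ 2 = t ^ 2 - 1 := Real.sq_sqrt ht2.le
  have hb0 : 0 < b := Real.sqrt_pos.mpr ht2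
  have hbt : b < t := by nlinarith
  have hc1 : t - b < 1 := by nlinarith
  have hD : 0 < t + b * Real.cosh u := by have := Real.one_le_cosh u; nlinarith
  set x : ℝ := Real.exp (-u) with hx
  have hx0 : 0 < x := Real.exp_pos _
  have hAx : 0 < 1 + (t - b) + (1 - (t - b)) * x := by
    have : 0 < 1 - (t - b) := by linarith
    positivity
  have hBx : 0 < 1 - (t - b) + (1 + (t - b)) * x := by
    have : 0 < 1 - (t - b) := by linarith
    have : 0 < 1 + (t - b) := by linarith
    positivity
  have he : HasDerivAt (fun u : ℝ => Real.exp (-u)) (x * (-1)) u := by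
    simpa [hx] using (hasDerivAt_neg u).exp
  have h1 : HasDerivAt (fun u : ℝ => 1 + (t - b) + (1 - (t - b)) * Real.exp (-u))
      ((1 - (t - b)) * (x * (-1))) u := (he.const_mul _).const_add _
  have h2 : HasDerivAt (fun u : ℝ => 1 - (t - b) + (1 + (t - b)) * Real.exp (-u))
      ((1 + (t - b)) * (x * (-1))) u := (he.const_mul _).const_add _
  have hH := (h1.log hAx.ne').sub (h2.log hBx.ne')
  refine hH.congr_deriv ?_
  have hcosh : Real.cosh u = (x⁻¹ + x) / 2 := by
    rw [Real.cosh_eq, hx, Real.exp_neg, inv_inv]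
  rw [← hx, hcosh]
  have hDx : 0 < t + b * ((x⁻¹ + x) / 2) := by rw [← hcosh]; exact hD
  rw [div_sub_div _ _ hAx.ne' hBx.ne', inv_eq_one_div,
    div_eq_div_iff (mul_ne_zero hAx.ne' hBx.ne') hDx.ne']
  field_simp
  linear_combination (-(2 + 4 * x + 2 * x ^ 2)) * hb2

/-- The limit of the logarithmic antiderivative: `H(u) → log(1+c) − log(1−c)` as `u → ∞`.
[folklore] -/
theorem tendsto_heine_log {t : ℝ} (ht : 1 < t) :
    Tendsto (fun u : ℝ => Real.log (1 + (t - √(t ^ 2 - 1)) + (1 - (t - √(t ^ 2 - 1))) * Real.exp (-u)) -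
        Real.log (1 - (t - √(t ^ 2 - 1)) + (1 + (t - √(t ^ 2 - 1))) * Real.exp (-u))) atTop
      (𝓝 (Real.log (1 + (t - √(t ^ 2 - 1))) - Real.log (1 - (t - √(t ^ 2 - 1))))) := by
  set b : ℝ := √(t ^ 2 - 1) with hb_def
  have ht2 : 0 < t ^ 2 - 1 := by nlinarith
  have hb2 : b ^ 2 = t ^ 2 - 1 := Real.sq_sqrt ht2.le
  have hb0 : 0 < b := Real.sqrt_pos.mpr ht2
  have hbt : b < t := by nlinarith
  have hc1 : t - b < 1 := by nlinarith
  have hA : 0 < 1 + (t - b) := by linarith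
  have hB : 0 < 1 - (t - b) := by linarith
  have hx := Real.tendsto_exp_neg_atTop_nhds_zero
  have h1 : Tendsto (fun u : ℝ => Real.log (1 + (t - b) + (1 - (t - b)) * Real.exp (-u))) atTop
      (𝓝 (Real.log (1 + (t - b)))) := by
    have := ((hx.const_mul (1 - (t - b))).const_add (1 + (t - b))).log (by simp; exact hA.ne')
    simpa using this
  have h2 : Tendsto (fun u : ℝ => Real.log (1 - (t - b) + (1 + (t - b)) * Real.exp (-u))) atTop
      (𝓝 (Real.log (1 - (t - b)))) := by
    have := ((hx.const_mul (1 + (t - b))).const_add (1 - (t - b))).log (by simp; exact hB.ne')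
    simpa using this
  exact h1.sub h2

/-- The value of the logarithmic antiderivative at infinity is `½ log((t+1)/(t−1))`:
`2 (log(1+c) − log(1−c)) = log((t+1)/(t−1))` for `c = t − √(t²−1)`, `t > 1`. [folklore] -/
theorem two_mul_heine_log_limit {t : ℝ} (ht : 1 < t) :
    2 * (Real.log (1 + (t - √(t ^ 2 - 1))) - Real.log (1 - (t - √(t ^ 2 - 1)))) =
      Real.log ((t + 1) / (t - 1)) := by
  set b : ℝ := √(t ^ 2 - 1) with hb_def
  have ht2 : 0 < t ^ 2 - 1 := by nlinarith
  have hb2 : b ^ 2 = t ^ 2 - 1 := Real.sq_sqrt ht2.le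
  have hb0 : 0 < b := Real.sqrt_pos.mpr ht2
  have hbt : b < t := by nlinarith
  have hc1 : t - b < 1 := by nlinarith
  have hA : 0 < 1 + (t - b) := by linarith
  have hB : 0 < 1 - (t - b) := by linarith
  have hsq : ((1 + (t - b)) / (1 - (t - b))) ^ 2 = (t + 1) / (t - 1) := by
    rw [div_pow, div_eq_div_iff (pow_ne_zero 2 hB.ne') (by linarith)]
    linear_combination (-2 : ℝ) * hb2
  rw [← hsq, Real.log_pow, Real.log_div hA.ne' hB.ne']
  push_cast
  ring

/-- **Heine's integral for `Q₀` in closed form**: for `t > 1`,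
`greenQ 1 t = ∫₀^∞ du/(t + √(t²−1) cosh u) = ½ log((t+1)/(t−1)) = Q₀(t)` (the weight-2 kernel).
[cite: WhittakerWatson1927, §15.3] -/
theorem greenQ_one_eq {t : ℝ} (ht : 1 < t) :
    greenQ 1 t = 1 / 2 * Real.log ((t + 1) / (t - 1)) := by
  have h0 : Real.log (1 + (t - √(t ^ 2 - 1)) + (1 - (t - √(t ^ 2 - 1))) * Real.exp (-0)) -
      Real.log (1 - (t - √(t ^ 2 - 1)) + (1 + (t - √(t ^ 2 - 1))) * Real.exp (-0)) = 0 := by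
    rw [neg_zero, Real.exp_zero, mul_one, mul_one,
      show 1 + (t - √(t ^ 2 - 1)) + (1 - (t - √(t ^ 2 - 1))) =
        1 - (t - √(t ^ 2 - 1)) + (1 + (t - √(t ^ 2 - 1))) by ring, sub_self]
  have hint : IntegrableOn (fun u : ℝ => (t + √(t ^ 2 - 1) * Real.cosh u)⁻¹) (Ioi 0) := by
    simpa only [pow_one] using integrableOn_greenQ_integrand ht (s := 1) le_rfl
  have hFTC := integral_Ioi_of_hasDerivAt_of_tendsto
    (hasDerivAt_heine_log ht 0).continuousAt.continuousWithinAt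
    (fun u _ => hasDerivAt_heine_log ht u) hint (tendsto_heine_log ht)
  rw [greenQ]
  simp only [pow_one]
  rw [hFTC, h0, sub_zero, ← two_mul_heine_log_limit ht]
  ring

/-- **Heine's integral for `Q₁` in closed form**: for `t > 1`,
`greenQ 2 t = ∫₀^∞ (t + √(t²−1) cosh u)⁻² du = (t/2) log((t+1)/(t−1)) − 1 = Q₁(t)`, the Legendre
function of the second kind of degree `1` — the kernel of the weight-4 Green's functions
`higherGreen N 2 m`. Proof: with `b = √(t²−1)`, an antiderivative of the integrand is
`t·H(u) − b·sinh u/(t + b cosh u)` with `H` as in `hasDerivAt_heine_log`. [cite: WhittakerWatson1927, §15.3] -/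
theorem greenQ_two_eq {t : ℝ} (ht : 1 < t) :
    greenQ 2 t = t / 2 * Real.log ((t + 1) / (t - 1)) - 1 := by
  set b : ℝ := √(t ^ 2 - 1) with hb_def
  have ht2 : 0 < t ^ 2 - 1 := by nlinarith
  have hb2 : b ^ 2 = t ^ 2 - 1 := Real.sq_sqrt ht2.le
  have hb0 : 0 < b := Real.sqrt_pos.mpr ht2
  have hD : ∀ u : ℝ, 0 < t + b * Real.cosh u := fun u => by
    have := Real.one_le_cosh u; nlinarith
  set H : ℝ → ℝ := fun u => Real.log (1 + (t - b) + (1 - (t - b)) * Real.exp (-u)) -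
    Real.log (1 - (t - b) + (1 + (t - b)) * Real.exp (-u)) with hH
  set f : ℝ → ℝ := fun u => t * H u - b * (Real.sinh u / (t + b * Real.cosh u)) with hf
  have hderiv : ∀ u : ℝ, HasDerivAt f (((t + b * Real.cosh u) ^ 2)⁻¹) u := by
    intro u
    have hHd : HasDerivAt H (t + b * Real.cosh u)⁻¹ u := hasDerivAt_heine_log ht u
    have hK := (Real.hasDerivAt_sinh u).div ((Real.hasDerivAt_cosh u).const_mul b |>.const_add t)
      (hD u).ne'
    have h := (hHd.const_mul t).sub (hK.const_mul b)
    have hfun : f = (fun u => t * H u) - fun u => b * ((Real.sinh / fun x => t + b * Real.cosh x) u) := by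
      funext v; simp only [hf, Pi.sub_apply, Pi.div_apply]
    rw [hfun]
    refine h.congr_deriv ?_
    have hDu := (hD u).ne'
    have hsq : Real.sinh u ^ 2 = Real.cosh u ^ 2 - 1 := Real.sinh_sq u
    field_simp
    linear_combination (-1 : ℝ) * hb2 + b ^ 2 * hsq
  have hf0 : f 0 = 0 := by
    simp only [hf, hH, neg_zero, Real.exp_zero, mul_one, Real.sinh_zero, zero_div, mul_zero, sub_zero]
    rw [show 1 + (t - b) + (1 - (t - b)) = 1 - (t - b) + (1 + (t - b)) by ring, sub_self, mul_zero]
  have hlim : Tendsto f atTop (𝓝 (t * (Real.log (1 + (t - b)) - Real.log (1 - (t - b))) - b * b⁻¹)) := by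
    have hx := Real.tendsto_exp_neg_atTop_nhds_zero
    -- `sinh u/(t + b cosh u) = φ(e⁻ᵘ)` with `φ x = (1 − x²)/(2tx + b(1 + x²))`
    have hφ : ContinuousAt (fun x : ℝ => (1 - x ^ 2) / (2 * t * x + b * (1 + x ^ 2))) 0 := by
      refine ContinuousAt.div (by fun_prop) (by fun_prop) ?_
      simp [hb0.ne']
    have h3 : Tendsto (fun u : ℝ => Real.sinh u / (t + b * Real.cosh u)) atTop (𝓝 b⁻¹) := by
      have hc := hφ.tendsto.comp hx
      simp only [Function.comp_def] at hc
      have hval : (1 - (0 : ℝ) ^ 2) / (2 * t * 0 + b * (1 + 0 ^ 2)) = b⁻¹ := by simp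
      rw [hval] at hc
      refine hc.congr fun u => ?_
      have hxu' : Real.exp u = (Real.exp (-u))⁻¹ := by rw [Real.exp_neg, inv_inv]
      rw [Real.sinh_eq, Real.cosh_eq, hxu']
      have hxu : 0 < Real.exp (-u) := Real.exp_pos _
      have hDen : 0 < 2 * t * Real.exp (-u) + b * (1 + Real.exp (-u) ^ 2) := by positivity
      field_simp
    have := ((tendsto_heine_log ht).const_mul t).sub (h3.const_mul b)
    simpa only [hf, hH] using this
  have hFTC := integral_Ioi_of_hasDerivAt_of_tendsto (hderiv 0).continuousAt.continuousWithinAt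
    (fun u _ => hderiv u) (integrableOn_greenQ_integrand ht (s := 2) (by norm_num)) hlim
  rw [greenQ, hFTC, hf0, sub_zero, mul_inv_cancel₀ hb0.ne', ← two_mul_heine_log_limit ht]
  ring

/-! ### Gauss's digamma theorem, complex-logarithm form -/

/-- Orthogonality of characters of `ℤ/q`: `Σ_{n<q} ζ^{nr} = q` if `q ∣ r`, `0` otherwise, for a
primitive `q`-th root of unity `ζ`. [folklore] -/
theorem sum_pow_mul_eq {ζ : ℂ} {q : ℕ} (hζ : IsPrimitiveRoot ζ q) (r : ℕ) :
    ∑ n ∈ Finset.range q, ζ ^ (n * r) = if q ∣ r then (q : ℂ) else 0 := by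
  have hx : ∀ n, ζ ^ (n * r) = (ζ ^ r) ^ n := fun n => by rw [← pow_mul, mul_comm]
  simp_rw [hx]
  split_ifs with h
  · rw [(hζ.pow_eq_one_iff_dvd r).mpr h]; simp
  · have hne : ζ ^ r ≠ 1 := fun h1 => h ((hζ.pow_eq_one_iff_dvd r).mp h1)
    rw [geom_sum_eq hne, ← pow_mul, mul_comm, pow_mul, hζ.pow_eq_one, one_pow, sub_self, zero_div]

/-- The congruence behind Simpson's dissection: for `r < q`,
`q ∣ r + (q − 1)m ↔ m % q = r`. [folklore] -/
theorem dvd_dissect_iff {q r m : ℕ} (hq : 0 < q) (hr : r < q) :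
    q ∣ (r + (q - 1) * m) ↔ m % q = r := by
  have hkey : r + (q - 1) * m + m = r + q * m := by
    have : (q - 1) * m + m = q * m := by
      rw [Nat.sub_mul, one_mul, Nat.sub_add_cancel (Nat.le_mul_of_pos_left m hq)]
    omega
  have hmod : (r + (q - 1) * m + m) % q = r := by
    rw [hkey, Nat.add_mul_mod_self_left, Nat.mod_eq_of_lt hr]
  constructor
  · intro h
    have h0 : (r + (q - 1) * m) % q = 0 := Nat.mod_eq_zero_of_dvd h
    have : (r + (q - 1) * m + m) % q = m % q := by
      rw [Nat.add_mod, h0, zero_add, Nat.mod_mod]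
    rw [← this, hmod]
  · intro h
    apply Nat.dvd_of_mod_eq_zero
    have := Nat.sub_mod_eq_zero_of_mod_eq (hmod.trans h.symm)
    simpa using this

/-- **Simpson's dissection / partial fractions of `t^r/(1 − t^q)` over the `q`-th roots of unity**:
for real `0 ≤ t < 1`, `r < q` and `ζ = e^{2πi/q}`,
`q t^r/(1 − t^q) = Σ_{n<q} ζ^{nr}/(1 − ζ^{(q−1)n} t)`. [cite: AndrewsAskeyRoy1999, §1.2 (proof of Thm 1.2.7)] -/
theorem dissection {q r : ℕ} (hq : 0 < q) (hr : r < q) {t : ℝ} (ht0 : 0 ≤ t) (ht1 : t < 1) :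
    (q : ℂ) * (t : ℂ) ^ r / (1 - (t : ℂ) ^ q) =
      ∑ n ∈ Finset.range q, Complex.exp (2 * π * Complex.I / q) ^ (n * r) /
        (1 - Complex.exp (2 * π * Complex.I / q) ^ ((q - 1) * n) * t) := by
  set ζ : ℂ := Complex.exp (2 * π * Complex.I / q) with hζ_def
  have hζ : IsPrimitiveRoot ζ q := Complex.isPrimitiveRoot_exp q hq.ne'
  have hζ1 : ‖ζ‖ = 1 := hζ.norm'_eq_one hq.ne'
  have htC : ‖(t : ℂ)‖ = t := by rw [Complex.norm_real, Real.norm_eq_abs, abs_of_nonneg ht0]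
  -- each partial fraction as a geometric series
  have hgeo : ∀ n : ℕ, HasSum (fun m : ℕ => ζ ^ (n * r) * ((ζ ^ ((q - 1) * n) * t) ^ m))
      (ζ ^ (n * r) / (1 - ζ ^ ((q - 1) * n) * t)) := by
    intro n
    have hlt : ‖ζ ^ ((q - 1) * n) * (t : ℂ)‖ < 1 := by
      rw [norm_mul, norm_pow, hζ1, one_pow, one_mul, htC]; exact ht1
    rw [div_eq_mul_inv]
    exact (hasSum_geometric_of_norm_lt_one hlt).mul_left _
  have hR := hasSum_sum fun n (_ : n ∈ Finset.range q) => hgeo n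
  -- the left side as a lacunary geometric series
  have htq : t ^ q < 1 := pow_lt_one₀ ht0 ht1 hq.ne'
  have hL0 : HasSum (fun k : ℕ => (q : ℂ) * (t : ℂ) ^ (q * k + r)) ((q : ℂ) * (t : ℂ) ^ r / (1 - (t : ℂ) ^ q)) := by
    have hlt : ‖((t : ℂ) ^ q)‖ < 1 := by rw [norm_pow, htC]; exact htq
    have h := (hasSum_geometric_of_norm_lt_one hlt).mul_left ((q : ℂ) * (t : ℂ) ^ r)
    rw [div_eq_mul_inv]
    refine (show (fun k : ℕ => (q : ℂ) * (t : ℂ) ^ (q * k + r)) =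
      fun k => (q : ℂ) * (t : ℂ) ^ r * (((t : ℂ) ^ q) ^ k) from ?_) ▸ h
    funext k; rw [pow_add, pow_mul]; ring
  -- transport along `k ↦ qk + r`
  set f : ℕ → ℂ := fun m => if m % q = r then (q : ℂ) * (t : ℂ) ^ m else 0 with hf
  have hinj : Function.Injective fun k : ℕ => q * k + r := fun a b h => by
    simp only at h
    exact Nat.eq_of_mul_eq_mul_left hq (by omega : q * a = q * b)
  have hoff : ∀ m ∉ Set.range (fun k : ℕ => q * k + r), f m = 0 := by
    intro m hm
    simp only [hf]
    rw [if_neg]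
    intro hmr
    apply hm
    refine ⟨m / q, ?_⟩
    have := Nat.div_add_mod m q
    simp only
    omega
  have hcomp : (f ∘ fun k : ℕ => q * k + r) = fun k => (q : ℂ) * (t : ℂ) ^ (q * k + r) := by
    funext k
    simp only [Function.comp_apply, hf]
    rw [if_pos]
    rw [Nat.add_comm, Nat.add_mul_mod_self_left, Nat.mod_eq_of_lt hr]
  have hL : HasSum f ((q : ℂ) * (t : ℂ) ^ r / (1 - (t : ℂ) ^ q)) := by
    rw [← hinj.hasSum_iff hoff, hcomp]; exact hL0
  -- the right side's general term equals `f m`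
  have hterm : (fun m : ℕ => ∑ n ∈ Finset.range q, ζ ^ (n * r) * ((ζ ^ ((q - 1) * n) * t) ^ m)) = f := by
    funext m
    have e : ∀ n ∈ Finset.range q, ζ ^ (n * r) * ((ζ ^ ((q - 1) * n) * (t : ℂ)) ^ m) =
        ζ ^ (n * (r + (q - 1) * m)) * (t : ℂ) ^ m := by
      intro n _
      rw [mul_pow, ← pow_mul, mul_add, pow_add]; ring
    rw [Finset.sum_congr rfl e, ← Finset.sum_mul, sum_pow_mul_eq hζ]
    simp only [hf, dvd_dissect_iff hq hr]
    split_ifs <;> simp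
  rw [hterm] at hR
  exact hL.unique hR

/-- `∫₀¹ dt/(1 − αt) = −α⁻¹ log(1 − α)` for a complex `α ≠ 0`, `α ≠ 1` with `‖α‖ ≤ 1` (the path
`1 − αt`, `t ∈ [0,1]`, stays in the slit plane). [folklore] -/
theorem integral_inv_one_sub_mul {α : ℂ} (hα0 : α ≠ 0) (hα1 : α ≠ 1) (hα : ‖α‖ ≤ 1) :
    ∫ t in (0 : ℝ)..1, (1 - α * t)⁻¹ = -α⁻¹ * Complex.log (1 - α) := by
  -- the path stays in the slit plane
  have hslit : ∀ t : ℝ, 0 ≤ t → t ≤ 1 → (1 - α * t) ∈ Complex.slitPlane := by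
    intro t ht0 ht1
    rw [Complex.mem_slitPlane_iff]
    have hre : (1 - α * (t : ℂ)).re = 1 - α.re * t := by simp
    have him : (1 - α * (t : ℂ)).im = -(α.im * t) := by simp
    rw [hre, him]
    by_cases hi : α.im = 0
    · left
      have hre1 : α.re ≤ 1 := (Complex.re_le_norm α).trans hα
      have hre' : α.re ≠ 1 := by
        intro h
        apply hα1
        apply Complex.ext <;> simp [h, hi]
      rcases lt_or_eq_of_le ht1 with hlt | rfl
      · nlinarith [abs_le.mp ((Complex.abs_re_le_norm α).trans hα)]
      · rw [mul_one]; exact sub_pos.mpr (lt_of_le_of_ne hre1 hre')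
    · rcases eq_or_lt_of_le ht0 with rfl | hpos
      · left; simp
      · right; exact neg_ne_zero.mpr (mul_ne_zero hi (by exact_mod_cast hpos.ne'))
  have hne : ∀ t : ℝ, 0 ≤ t → t ≤ 1 → (1 - α * t) ≠ 0 := fun t ht0 ht1 =>
    Complex.slitPlane_ne_zero (hslit t ht0 ht1)
  -- antiderivative
  have hderiv : ∀ t ∈ Set.uIcc (0 : ℝ) 1,
      HasDerivAt (fun t : ℝ => -α⁻¹ * Complex.log (1 - α * t)) ((1 - α * (t : ℂ))⁻¹) t := by
    intro t ht
    rw [Set.uIcc_of_le zero_le_one] at ht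
    have h1 : HasDerivAt (fun w : ℂ => 1 - α * w) (-α) (t : ℂ) := by
      simpa using ((hasDerivAt_id (t : ℂ)).const_mul α).const_sub 1
    have h2 := ((Complex.hasDerivAt_log (hslit t ht.1 ht.2)).comp (t : ℂ) h1).const_mul (-α⁻¹)
    have h3 := h2.comp_ofReal
    refine h3.congr_deriv ?_
    field_simp [hne t ht.1 ht.2]
  have hcont : ContinuousOn (fun t : ℝ => (1 - α * (t : ℂ))⁻¹) (Set.uIcc 0 1) := by
    refine ContinuousOn.inv₀ (by fun_prop) fun t ht => ?_
    rw [Set.uIcc_of_le zero_le_one] at ht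
    exact hne t ht.1 ht.2
  rw [intervalIntegral.integral_eq_sub_of_hasDerivAt hderiv (hcont.intervalIntegrable)]
  simp

/-- `Γ'/Γ` is real on the positive real axis: `ψ(x) = ψ_ℝ(x)` for real `x > 0`. [folklore] -/
theorem digamma_ofReal_eq_digammaReal {x : ℝ} (hx : 0 < x) :
    Complex.digamma (x : ℂ) = ((digammaReal x : ℝ) : ℂ) := by
  have h := hasSum_one_div_sub_one_div_digamma (w := (x : ℂ)) (by simpa using hx)
  have him := Complex.imCLM.hasSum h
  have hzero : (fun k : ℕ => Complex.imCLM (1 / ((k : ℂ) + 1) - 1 / ((x : ℂ) + k))) = fun _ => 0 := by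
    funext k
    rw [Complex.imCLM_apply, show (1 / ((k : ℂ) + 1) - 1 / ((x : ℂ) + k)) =
      ((1 / ((k : ℝ) + 1) - 1 / (x + k) : ℝ) : ℂ) by push_cast; ring, Complex.ofReal_im]
  rw [hzero, Complex.imCLM_apply] at him
  have him0 : (Complex.digamma (x : ℂ) + Real.eulerMascheroniConstant).im = 0 :=
    him.unique hasSum_zero
  apply Complex.ext
  · simp [digammaReal]
  · simp only [Complex.add_im, Complex.ofReal_im, add_zero] at him0
    simp [him0]

/-- The integral `∫₀¹ (t^{p−1} − t^{q−1})/(1 − t^q) dt` over the roots of unity: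
`= −(1/q) Σ_{n=1}^{q−1} (ζ^{np} − 1) log(1 − ζ^{(q−1)n})`, `ζ = e^{2πi/q}`, `1 ≤ p ≤ q`.
[cite: AndrewsAskeyRoy1999, §1.2 (proof of Thm 1.2.7)] -/
theorem integral_dissection {q p : ℕ} (hp : 1 ≤ p) (hpq : p ≤ q) :
    ((∫ t in (0 : ℝ)..1, (t ^ (p - 1) - t ^ (q - 1)) / (1 - t ^ q) : ℝ) : ℂ) =
      -(1 / (q : ℂ)) * ∑ n ∈ Finset.Ico 1 q, (Complex.exp (2 * π * Complex.I / q) ^ (n * p) - 1) *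
        Complex.log (1 - Complex.exp (2 * π * Complex.I / q) ^ ((q - 1) * n)) := by
  have hq : 0 < q := hp.trans hpq
  set ζ : ℂ := Complex.exp (2 * π * Complex.I / q) with hζ_def
  have hζ : IsPrimitiveRoot ζ q := Complex.isPrimitiveRoot_exp q hq.ne'
  have hζ1 : ‖ζ‖ = 1 := hζ.norm'_eq_one hq.ne'
  -- the roots `α_n = ζ^{(q-1)n}`, `n ∈ [1, q)`: `α_n ≠ 0, 1`, `‖α_n‖ = 1`, `α_n⁻¹ = ζ^n`
  have hαn : ∀ n ∈ Finset.Ico 1 q, ζ ^ ((q - 1) * n) ≠ 1 := by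
    intro n hn h
    rw [Finset.mem_Ico] at hn
    rw [hζ.pow_eq_one_iff_dvd] at h
    have hcop : Nat.Coprime q (q - 1) := by
      have := Nat.coprime_self_sub_right (m := 1) (n := q) hq
      simpa using this
    have := (hcop.dvd_of_dvd_mul_left h)
    exact absurd (Nat.le_of_dvd (by omega) this) (by omega)
  have hαinv : ∀ n : ℕ, (ζ ^ ((q - 1) * n))⁻¹ = ζ ^ n := by
    intro n
    rw [inv_eq_iff_eq_inv, eq_comm, inv_eq_of_mul_eq_one_left]
    rw [← pow_add, show (q - 1) * n + n = q * n by
      rw [Nat.sub_mul, one_mul, Nat.sub_add_cancel (Nat.le_mul_of_pos_left n hq)],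
      pow_mul, hζ.pow_eq_one, one_pow]
  -- pointwise dissection of the integrand on `[0, 1)`
  have hpt : ∀ t : ℝ, 0 ≤ t → t < 1 →
      (((t ^ (p - 1) - t ^ (q - 1)) / (1 - t ^ q) : ℝ) : ℂ) =
        (1 / (q : ℂ)) * ∑ n ∈ Finset.Ico 1 q,
          (ζ ^ (n * (p - 1)) - ζ ^ (n * (q - 1))) * (1 - ζ ^ ((q - 1) * n) * t)⁻¹ := by
    intro t ht0 ht1
    have h1 := dissection hq (by omega : p - 1 < q) ht0 ht1
    have h2 := dissection hq (by omega : q - 1 < q) ht0 ht1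
    rw [← hζ_def] at h1 h2
    have hq0 : (q : ℂ) ≠ 0 := by exact_mod_cast hq.ne'
    have htq : (1 : ℂ) - (t : ℂ) ^ q ≠ 0 := by
      have : (t : ℝ) ^ q < 1 := pow_lt_one₀ ht0 ht1 hq.ne'
      intro h
      have h' : ((1 - t ^ q : ℝ) : ℂ) = 0 := by push_cast; exact h
      have := Complex.ofReal_eq_zero.mp h'
      linarith
    -- drop the `n = 0` terms (they cancel) and combine
    rw [Finset.range_eq_Ico, Finset.sum_eq_sum_Ico_succ_bot hq] at h1 h2
    simp only [zero_mul, pow_zero, mul_zero, one_mul] at h1 h2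
    push_cast
    rw [sub_div, show (t : ℂ) ^ (p - 1) / (1 - (t : ℂ) ^ q) =
        (1 / (q : ℂ)) * ((q : ℂ) * (t : ℂ) ^ (p - 1) / (1 - (t : ℂ) ^ q)) by field_simp,
      show (t : ℂ) ^ (q - 1) / (1 - (t : ℂ) ^ q) =
        (1 / (q : ℂ)) * ((q : ℂ) * (t : ℂ) ^ (q - 1) / (1 - (t : ℂ) ^ q)) by field_simp, h1, h2]
    rw [← mul_sub, add_sub_add_left_eq_sub, ← Finset.sum_sub_distrib]
    congr 1
    refine Finset.sum_congr rfl fun n _ => ?_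
    rw [div_eq_mul_inv, div_eq_mul_inv]; ring
  -- integrate
  rw [← intervalIntegral.integral_ofReal]
  have hcongr : ∫ t in (0 : ℝ)..1, (((t ^ (p - 1) - t ^ (q - 1)) / (1 - t ^ q) : ℝ) : ℂ) =
      ∫ t in (0 : ℝ)..1, (1 / (q : ℂ)) * ∑ n ∈ Finset.Ico 1 q,
        (ζ ^ (n * (p - 1)) - ζ ^ (n * (q - 1))) * (1 - ζ ^ ((q - 1) * n) * t)⁻¹ := by
    refine intervalIntegral.integral_congr_ae ?_
    have hae : ∀ᵐ t : ℝ, t ≠ 1 := by rw [ae_iff]; simp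
    filter_upwards [hae] with t ht hmem
    rw [Set.uIoc_of_le zero_le_one] at hmem
    exact hpt t hmem.1.le (lt_of_le_of_ne hmem.2 ht)
  rw [hcongr, intervalIntegral.integral_const_mul]
  have hint : ∀ n ∈ Finset.Ico 1 q, IntervalIntegrable
      (fun t : ℝ => (ζ ^ (n * (p - 1)) - ζ ^ (n * (q - 1))) * (1 - ζ ^ ((q - 1) * n) * t)⁻¹) volume 0 1 := by
    intro n hn
    refine (ContinuousOn.intervalIntegrable ?_)
    refine ContinuousOn.mul continuousOn_const (ContinuousOn.inv₀ (by fun_prop) fun t ht => ?_)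
    rw [Set.uIcc_of_le zero_le_one] at ht
    -- `1 - α t ≠ 0`
    intro h0
    have : ‖ζ ^ ((q - 1) * n) * (t : ℂ)‖ = 1 := by
      have : ζ ^ ((q - 1) * n) * (t : ℂ) = 1 := by linear_combination (-1 : ℂ) * h0
      rw [this, norm_one]
    rw [norm_mul, norm_pow, hζ1, one_pow, one_mul, Complex.norm_real, Real.norm_eq_abs,
      abs_of_nonneg ht.1] at this
    -- so `t = 1` and `α = 1`
    have ht1 : t = 1 := this
    rw [ht1, Complex.ofReal_one, mul_one, sub_eq_zero] at h0
    exact hαn n hn h0.symm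
  rw [intervalIntegral.integral_finsetSum hint]
  rw [Finset.mul_sum, Finset.mul_sum]
  refine Finset.sum_congr rfl fun n hn => ?_
  have hI := integral_inv_one_sub_mul (α := ζ ^ ((q - 1) * n)) (pow_ne_zero _ (hζ.ne_zero hq.ne'))
    (hαn n hn) (by rw [norm_pow, hζ1, one_pow])
  rw [hαinv n] at hI
  simp only [intervalIntegral.integral_const_mul, hI]
  have : (ζ ^ (n * (p - 1)) - ζ ^ (n * (q - 1))) * ζ ^ n = ζ ^ (n * p) - 1 := by
    have e1 : ζ ^ (n * (p - 1)) * ζ ^ n = ζ ^ (n * p) := by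
      rw [← pow_add, show n * (p - 1) + n = n * p by
        rw [Nat.mul_sub, mul_one, Nat.sub_add_cancel (Nat.le_mul_of_pos_right n hp)]]
    have e2 : ζ ^ (n * (q - 1)) * ζ ^ n = 1 := by
      rw [← pow_add, show n * (q - 1) + n = q * n by
        rw [Nat.mul_sub, mul_one, Nat.sub_add_cancel (Nat.le_mul_of_pos_right n hq), mul_comm],
        pow_mul, hζ.pow_eq_one, one_pow]
    rw [sub_mul, e1, e2]
  linear_combination (-(1 / (q : ℂ)) * Complex.log (1 - ζ ^ ((q - 1) * n))) * this

/-- **Gauss's digamma theorem, complex-logarithm form**: for integers `1 ≤ p ≤ q`,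
`ψ(p/q) = −γ + Σ_{n=1}^{q−1} (ζ^{np} − 1) log(1 − ζ^{(q−1)n})` with `ζ = e^{2πi/q}` (so
`ζ^{(q−1)n} = ζ^{−n}`; principal logarithms). This is the line
"`ψ(p/q) = −γ − log q + Σ ω^{−np} log(1 − ωⁿ)`" of Andrews–Askey–Roy's proof of Thm 1.2.7 (up to the
reindexing `n ↦ q − n` and `Σ_{n=1}^{q−1} log(1 − ωⁿ) = log q`), obtained here without Abel's theorem
from `ψ(p/q) = −γ − q ∫₀¹ (t^{p−1} − t^{q−1})/(1 − t^q) dt` and the dissection of the integrand over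
the `q`-th roots of unity. [cite: AndrewsAskeyRoy1999, Thm 1.2.7 (proof)] -/
theorem digamma_rat_eq_sum_log {p q : ℕ} (hp : 1 ≤ p) (hpq : p ≤ q) :
    Complex.digamma ((p : ℂ) / q) = -(Real.eulerMascheroniConstant : ℂ) +
      ∑ n ∈ Finset.Ico 1 q, (Complex.exp (2 * π * Complex.I / q) ^ (n * p) - 1) *
        Complex.log (1 - Complex.exp (2 * π * Complex.I / q) ^ ((q - 1) * n)) := by
  have hq : 0 < q := hp.trans hpq
  have hqR : (0 : ℝ) < q := by exact_mod_cast hq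
  have hx : (0 : ℝ) < p / q := div_pos (by exact_mod_cast hp) hqR
  have ha : (0 : ℝ) ≤ 1 - p / q := by
    rw [sub_nonneg, div_le_one hqR]; exact_mod_cast hpq
  -- `ψ_ℝ(1) − ψ_ℝ(p/q) = q ∫₀¹ (t^{p-1} − t^{q-1})/(1 − t^q)`
  have h1 := hasSum_inv_sub_inv_digammaReal hx ha
  rw [show (p : ℝ) / q + (1 - p / q) = 1 by ring] at h1
  have h2 := (hasSum_inv_sub_inv_eq_integral (q := q) (i := p - 1) (j := q - 1) hq (by omega)
    (by omega)).mul_left (q : ℝ)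
  have hf : (fun k : ℕ => 1 / ((p : ℝ) / q + k) - 1 / (1 + (k : ℝ))) = fun k : ℕ =>
      (q : ℝ) * (1 / ((q : ℝ) * k + ((p - 1 : ℕ) : ℝ) + 1) - 1 / ((q : ℝ) * k + ((q - 1 : ℕ) : ℝ) + 1)) := by
    funext k
    have hk : (0 : ℝ) ≤ k := k.cast_nonneg
    have hp0 : (0 : ℝ) < p := by exact_mod_cast hp
    push_cast [Nat.cast_sub hp, Nat.cast_sub (hp.trans hpq)]
    rw [show (q : ℝ) * k + ((p : ℝ) - 1) + 1 = q * k + p by ring,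
      show (q : ℝ) * k + ((q : ℝ) - 1) + 1 = q * k + q by ring]
    have h3 : (q : ℝ) * k + p ≠ 0 := by positivity
    have h4 : (q : ℝ) * k + q ≠ 0 := by positivity
    have h5 : (p : ℝ) / q + k ≠ 0 := by positivity
    have h6 : (1 : ℝ) + k ≠ 0 := by positivity
    have hq0 : (q : ℝ) ≠ 0 := hqR.ne'
    field_simp
    ring
  rw [hf] at h1
  have hreal := h1.unique h2
  have hψ1 : digammaReal 1 = -Real.eulerMascheroniConstant := by
    simp [digammaReal, Complex.digamma_one]
  rw [hψ1] at hreal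
  -- move to `ℂ`
  have hcast : ((p : ℂ) / q) = (((p : ℝ) / q : ℝ) : ℂ) := by push_cast; ring
  rw [hcast, digamma_ofReal_eq_digammaReal hx,
    show digammaReal ((p : ℝ) / q) = -Real.eulerMascheroniConstant -
      (q : ℝ) * ∫ t in (0 : ℝ)..1, (t ^ (p - 1) - t ^ (q - 1)) / (1 - t ^ q) by linarith [hreal]]
  push_cast
  rw [integral_dissection hp hpq]
  have hq0 : (q : ℂ) ≠ 0 := by exact_mod_cast hq.ne'
  field_simp
  ring

/-! ### Gauss's digamma theorem, real form (Andrews–Askey–Roy (1.2.19)) -/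

/-- `|1 − e^{iφ}|² = 2 − 2cos φ`. [folklore] -/
theorem norm_one_sub_exp_mul_I_sq (φ : ℝ) :
    ‖(1 : ℂ) - Complex.exp (φ * Complex.I)‖ ^ 2 = 2 - 2 * Real.cos φ := by
  rw [Complex.sq_norm, Complex.normSq_apply]
  simp [Complex.exp_ofReal_mul_I_re, Complex.exp_ofReal_mul_I_im]
  nlinarith [Real.sin_sq_add_cos_sq φ]

/-- Powers of `ζ = e^{2πi/q}` as points on the unit circle: `ζ^m = e^{i·2πm/q}`. [folklore] -/
theorem rootOfUnity_pow_eq_exp (q m : ℕ) :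
    Complex.exp (2 * π * Complex.I / q) ^ m = Complex.exp ((2 * π * m / q : ℝ) * Complex.I) := by
  rw [← Complex.exp_nat_mul]
  congr 1
  push_cast
  ring

/-- `ζ^{n(q−p)} = e^{−i·2πnp/q}` for `p ≤ q`. [folklore] -/
theorem rootOfUnity_pow_mul_sub (q : ℕ) {p : ℕ} (hq : 0 < q) (hpq : p ≤ q) (n : ℕ) :
    Complex.exp (2 * π * Complex.I / q) ^ (n * (q - p)) =
      Complex.exp (-(2 * π * (n * p : ℕ) / q : ℝ) * Complex.I) := by
  rw [← Complex.exp_nat_mul]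
  have hq0 : (q : ℂ) ≠ 0 := by exact_mod_cast hq.ne'
  rw [show ((n * (q - p) : ℕ) : ℂ) * (2 * π * Complex.I / q) =
      (n : ℕ) * (2 * π * Complex.I) + (-(2 * π * (n * p : ℕ) / q : ℝ) * Complex.I) by
    push_cast [Nat.cast_sub hpq]
    field_simp
    ring, Complex.exp_add, Complex.exp_nat_mul_two_pi_mul_I, one_mul]

/-- The cyclotomic product in norm: `Σ_{n=1}^{q−1} log(2 − 2cos(2πn/q)) = 2 log q`
(from `Π_{n=1}^{q−1} (1 − ζⁿ) = q`). [folklore] -/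
theorem sum_log_two_sub_two_cos {q : ℕ} (hq : 0 < q) :
    ∑ n ∈ Finset.Ico 1 q, Real.log (2 - 2 * Real.cos (2 * π * n / q)) = 2 * Real.log q := by
  set ζ : ℂ := Complex.exp (2 * π * Complex.I / q) with hζ_def
  have hζ : IsPrimitiveRoot ζ q := Complex.isPrimitiveRoot_exp q hq.ne'
  have hζ' : IsPrimitiveRoot ζ ((q - 1) + 1) := by rwa [Nat.sub_add_cancel hq]
  have hprod := hζ'.prod_one_sub_pow_eq_order
  -- norms
  have hnorm : ∏ k ∈ Finset.range (q - 1), ‖(1 : ℂ) - ζ ^ (k + 1)‖ ^ 2 = (q : ℝ) ^ 2 := by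
    rw [Finset.prod_pow, ← norm_prod, hprod]
    push_cast [Nat.cast_sub hq]
    simp
  have hterm : ∀ k : ℕ, ‖(1 : ℂ) - ζ ^ (k + 1)‖ ^ 2 = 2 - 2 * Real.cos (2 * π * ((k + 1 : ℕ) : ℝ) / q) := by
    intro k
    rw [hζ_def, rootOfUnity_pow_eq_exp, norm_one_sub_exp_mul_I_sq]
  simp_rw [hterm] at hnorm
  have hpos : ∀ k ∈ Finset.range (q - 1), (2 - 2 * Real.cos (2 * π * ((k + 1 : ℕ) : ℝ) / q)) ≠ 0 := by
    intro k hk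
    rw [← hterm k]
    refine pow_ne_zero 2 (norm_ne_zero_iff.mpr (sub_ne_zero.mpr ?_))
    intro h
    have := (hζ.pow_eq_one_iff_dvd (k + 1)).mp h.symm
    rw [Finset.mem_range] at hk
    exact absurd (Nat.le_of_dvd (Nat.succ_pos k) this) (by omega)
  have hlog := congrArg Real.log hnorm
  rw [Real.log_prod hpos, Real.log_pow] at hlog
  push_cast at hlog
  rw [Finset.sum_Ico_eq_sum_range, show q - 1 = q - 1 from rfl]
  convert hlog using 2 with k hk
  push_cast
  ring_nf

/-- **Gauss's digamma theorem** (Andrews–Askey–Roy, Thm 1.2.7 in the form (1.2.19)): for integers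
`1 ≤ p < q`,
`ψ(p/q) = −γ − log q − (π/2) cot(πp/q) + ½ Σ_{n=1}^{q−1} cos(2πnp/q) log(2 − 2cos(2πn/q))`.
Proof: add the complex-logarithm forms at `p` and `q − p` and take real parts (`|1 − ζ^{−n}|² =
2 − 2cos(2πn/q)`, `Π_{n=1}^{q−1}|1 − ζⁿ|² = q²`), then subtract the reflection formula
`ψ(1 − p/q) − ψ(p/q) = π cot(πp/q)`. [cite: AndrewsAskeyRoy1999, Thm 1.2.7, (1.2.19)] -/
theorem digammaReal_rat {p q : ℕ} (hp : 1 ≤ p) (hpq : p < q) :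
    digammaReal (p / q) = -Real.eulerMascheroniConstant - Real.log q -
      π / 2 * (Real.cos (π * p / q) / Real.sin (π * p / q)) +
      1 / 2 * ∑ n ∈ Finset.Ico 1 q, Real.cos (2 * π * n * p / q) * Real.log (2 - 2 * Real.cos (2 * π * n / q)) := by
  have hq : 0 < q := by omega
  have hqR : (0 : ℝ) < q := by exact_mod_cast hq
  have hx : (0 : ℝ) < p / q := div_pos (by exact_mod_cast hp) hqR
  have hx' : (0 : ℝ) < (q - p : ℕ) / q := div_pos (by exact_mod_cast Nat.sub_pos_of_lt hpq) hqR
  set ζ : ℂ := Complex.exp (2 * π * Complex.I / q) with hζ_def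
  -- the two complex-log forms, as real parts
  have hP := digamma_rat_eq_sum_log hp hpq.le
  have hQ := digamma_rat_eq_sum_log (p := q - p) (q := q) (by omega) (Nat.sub_le q p)
  rw [← hζ_def] at hP hQ
  have hcastP : ((p : ℂ) / q) = (((p : ℝ) / q : ℝ) : ℂ) := by push_cast; ring
  have hcastQ : (((q - p : ℕ) : ℂ) / q) = ((((q - p : ℕ) : ℝ) / q : ℝ) : ℂ) := by push_cast; ring
  rw [hcastP, digamma_ofReal_eq_digammaReal hx] at hP
  rw [hcastQ, digamma_ofReal_eq_digammaReal hx'] at hQ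
  have hre : digammaReal (p / q) + digammaReal (((q - p : ℕ) : ℝ) / q) =
      -2 * Real.eulerMascheroniConstant +
        ∑ n ∈ Finset.Ico 1 q, (2 * Real.cos (2 * π * n * p / q) - 2) *
          Real.log ‖(1 : ℂ) - ζ ^ ((q - 1) * n)‖ := by
    have h := congrArg Complex.re (congrArg₂ (· + ·) hP hQ)
    simp only [Complex.add_re, Complex.ofReal_re, Complex.neg_re, Complex.re_sum] at h
    rw [h]
    have hS : ∑ i ∈ Finset.Ico 1 q, ((ζ ^ (i * p) - 1) * Complex.log (1 - ζ ^ ((q - 1) * i))).re +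
        ∑ i ∈ Finset.Ico 1 q, ((ζ ^ (i * (q - p)) - 1) * Complex.log (1 - ζ ^ ((q - 1) * i))).re =
        ∑ n ∈ Finset.Ico 1 q, (2 * Real.cos (2 * π * n * p / q) - 2) *
          Real.log ‖(1 : ℂ) - ζ ^ ((q - 1) * n)‖ := by
      rw [← Finset.sum_add_distrib]
      refine Finset.sum_congr rfl fun n hn => ?_
      -- `ζ^{np} + ζ^{n(q-p)} - 2 = 2cos θ - 2` is real
      have hreal : (ζ ^ (n * p) - 1) + (ζ ^ (n * (q - p)) - 1) =
          (((2 * Real.cos (2 * π * n * p / q) - 2 : ℝ)) : ℂ) := by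
        set θ : ℝ := 2 * π * n * p / q with hθ
        have e1 : ζ ^ (n * p) = Complex.exp (θ * Complex.I) := by
          rw [hζ_def, rootOfUnity_pow_eq_exp]
          congr 1
          rw [hθ]
          push_cast
          ring
        have e2 : ζ ^ (n * (q - p)) = Complex.exp (-θ * Complex.I) := by
          rw [hζ_def, rootOfUnity_pow_mul_sub q hq hpq.le n]
          congr 1
          rw [hθ]
          push_cast
          ring
        have h2cos := Complex.two_cos (θ : ℂ)
        rw [e1, e2]
        push_cast
        linear_combination (-1 : ℂ) * h2cos
      rw [← Complex.add_re, ← add_mul, hreal, Complex.re_ofReal_mul, Complex.log_re]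
    linarith [hS]
  -- `log |1 - ζ^{(q-1)n}| = ½ log(2 - 2cos(2πn/q))`
  have hlognorm : ∀ n : ℕ, Real.log ‖(1 : ℂ) - ζ ^ ((q - 1) * n)‖ =
      1 / 2 * Real.log (2 - 2 * Real.cos (2 * π * n / q)) := by
    intro n
    have h2 : ‖(1 : ℂ) - ζ ^ ((q - 1) * n)‖ ^ 2 = 2 - 2 * Real.cos (2 * π * n / q) := by
      rw [hζ_def, show (q - 1) * n = n * (q - 1) by ring, rootOfUnity_pow_mul_sub q hq (by omega) n,
        ← Complex.ofReal_neg, norm_one_sub_exp_mul_I_sq, Real.cos_neg]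
      push_cast
      ring_nf
    rw [← h2, Real.log_pow]
    push_cast
    ring
  simp_rw [hlognorm] at hre
  -- reflection: `ψ(1 - p/q) - ψ(p/q) = π cot(π p/q)`
  have hrefl := Literature.Analysis.SpecialFunctions.Complex.digamma_one_sub_sub_digamma
    (s := (((p : ℝ) / q : ℝ) : ℂ)) (by
      intro m h
      have h' := congrArg Complex.re h
      simp only [Complex.ofReal_re, Complex.intCast_re] at h'
      -- `0 < p/q < 1` is not an integer
      have h1 : (p : ℝ) / q < 1 := by rw [div_lt_one hqR]; exact_mod_cast hpq
      rcases lt_or_ge m 1 with hm | hm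
      · have : (m : ℝ) ≤ 0 := by exact_mod_cast (by omega : m ≤ 0)
        linarith
      · have : (1 : ℝ) ≤ m := by exact_mod_cast hm
        linarith)
  have h1s : (1 : ℂ) - (((p : ℝ) / q : ℝ) : ℂ) = ((((q - p : ℕ) : ℝ) / q : ℝ) : ℂ) := by
    have hq0 : (q : ℂ) ≠ 0 := by exact_mod_cast hq.ne'
    push_cast [Nat.cast_sub hpq.le]
    rw [sub_div, div_self hq0]
  rw [h1s, digamma_ofReal_eq_digammaReal hx, digamma_ofReal_eq_digammaReal hx'] at hrefl
  have hrefl' := congrArg Complex.re hrefl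
  have harg : (π : ℂ) * (((p : ℝ) / q : ℝ) : ℂ) = ((π * p / q : ℝ) : ℂ) := by push_cast; ring
  rw [harg, ← Complex.ofReal_cos, ← Complex.ofReal_sin] at hrefl'
  simp only [Complex.sub_re, Complex.ofReal_re] at hrefl'
  rw [show ((π : ℂ) * ((Real.cos (π * p / q) : ℝ) : ℂ) / ((Real.sin (π * p / q) : ℝ) : ℂ)).re =
      π * Real.cos (π * p / q) / Real.sin (π * p / q) by
    rw [← Complex.ofReal_mul, ← Complex.ofReal_div]; exact Complex.ofReal_re _] at hrefl'
  -- the `log q` term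
  have hlogq := sum_log_two_sub_two_cos hq
  -- combine: `2ψ(p/q) = (ψ(p/q) + ψ(1-p/q)) - (ψ(1-p/q) - ψ(p/q))`
  have key : 2 * digammaReal (p / q) = (-2 * Real.eulerMascheroniConstant +
      ∑ n ∈ Finset.Ico 1 q, (2 * Real.cos (2 * π * n * p / q) - 2) *
        (1 / 2 * Real.log (2 - 2 * Real.cos (2 * π * n / q)))) -
      π * Real.cos (π * p / q) / Real.sin (π * p / q) := by
    linarith [hre, hrefl']
  have hsplit : ∑ n ∈ Finset.Ico 1 q, (2 * Real.cos (2 * π * n * p / q) - 2) *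
      (1 / 2 * Real.log (2 - 2 * Real.cos (2 * π * n / q))) =
      ∑ n ∈ Finset.Ico 1 q, Real.cos (2 * π * n * p / q) * Real.log (2 - 2 * Real.cos (2 * π * n / q)) -
        ∑ n ∈ Finset.Ico 1 q, Real.log (2 - 2 * Real.cos (2 * π * n / q)) := by
    rw [← Finset.sum_sub_distrib]
    refine Finset.sum_congr rfl fun n _ => ?_
    ring
  rw [hsplit, hlogq] at key
  linear_combination (1 / 2 : ℝ) * key


/-- **Gauss's value `ψ(1/3) = −γ − (3/2) log 3 − π/(2√3)`** (the case `p/q = 1/3` of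
`digammaReal_rat`). [cite: AndrewsAskeyRoy1999, Thm 1.2.7] -/
theorem digammaReal_one_third :
    digammaReal (1 / 3) = -Real.eulerMascheroniConstant - 3 / 2 * Real.log 3 - π / (2 * √3) := by
  have h := digammaReal_rat (p := 1) (q := 3) le_rfl (by norm_num)
  push_cast at h
  rw [h, show Finset.Ico 1 3 = {1, 2} by decide, Finset.sum_pair (by norm_num)]
  simp only [Nat.cast_one, Nat.cast_ofNat, mul_one]
  have c1 : Real.cos (2 * π / 3) = -(1 / 2) := by
    rw [show 2 * π / 3 = π - π / 3 by ring, Real.cos_pi_sub, Real.cos_pi_div_three]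
  have c2 : Real.cos (2 * π * 2 / 3) = -(1 / 2) := by
    rw [show 2 * π * 2 / 3 = π / 3 + π by ring, Real.cos_add_pi, Real.cos_pi_div_three]
  rw [c1, c2, Real.cos_pi_div_three, Real.sin_pi_div_three]
  have hlog : Real.log (2 - 2 * (-(1 / 2))) = Real.log 3 := by norm_num
  rw [hlog]
  have h3 : (√3 : ℝ) ≠ 0 := by positivity
  field_simp
  ring

/-- **Gauss's value `ψ(1/6) = −γ − 2 log 2 − (3/2) log 3 − (√3/2)π`** (the case `p/q = 1/6` of
`digammaReal_rat`). [cite: AndrewsAskeyRoy1999, Thm 1.2.7] -/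
theorem digammaReal_one_sixth :
    digammaReal (1 / 6) = -Real.eulerMascheroniConstant - 2 * Real.log 2 - 3 / 2 * Real.log 3 -
      √3 / 2 * π := by
  have h := digammaReal_rat (p := 1) (q := 6) le_rfl (by norm_num)
  push_cast at h
  rw [h, show Finset.Ico 1 6 = {1, 2, 3, 4, 5} by decide]
  rw [Finset.sum_insert (by norm_num), Finset.sum_insert (by norm_num), Finset.sum_insert (by norm_num),
    Finset.sum_pair (by norm_num)]
  simp only [Nat.cast_one, Nat.cast_ofNat, mul_one]
  have c1 : Real.cos (2 * π / 6) = 1 / 2 := by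
    rw [show 2 * π / 6 = π / 3 by ring, Real.cos_pi_div_three]
  have c2 : Real.cos (2 * π * 2 / 6) = -(1 / 2) := by
    rw [show 2 * π * 2 / 6 = π - π / 3 by ring, Real.cos_pi_sub, Real.cos_pi_div_three]
  have c3 : Real.cos (2 * π * 3 / 6) = -1 := by
    rw [show 2 * π * 3 / 6 = π by ring, Real.cos_pi]
  have c4 : Real.cos (2 * π * 4 / 6) = -(1 / 2) := by
    rw [show 2 * π * 4 / 6 = π / 3 + π by ring, Real.cos_add_pi, Real.cos_pi_div_three]
  have c5 : Real.cos (2 * π * 5 / 6) = 1 / 2 := by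
    rw [show 2 * π * 5 / 6 = -(π / 3) + 2 * π by ring, Real.cos_add_two_pi, Real.cos_neg,
      Real.cos_pi_div_three]
  have hcot : Real.cos (π / 6) / Real.sin (π / 6) = √3 := by
    rw [Real.cos_pi_div_six, Real.sin_pi_div_six]; ring
  rw [c1, c2, c3, c4, c5, hcot]
  have hlog4 : Real.log (2 - 2 * (-1)) = 2 * Real.log 2 := by
    rw [show (2 : ℝ) - 2 * (-1) = 2 ^ 2 by norm_num, Real.log_pow]; push_cast; ring
  have hlog3 : Real.log (2 - 2 * (-(1 / 2))) = Real.log 3 := by norm_num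
  have hlog1 : Real.log (2 - 2 * (1 / 2)) = 0 := by norm_num
  have hlog6 : Real.log 6 = Real.log 2 + Real.log 3 := by
    rw [show (6 : ℝ) = 2 * 3 by norm_num, Real.log_mul (by norm_num) (by norm_num)]
  rw [hlog4, hlog3, hlog1, hlog6]
  ring


/-! ### Gauss's digamma theorem in the `log(2 sin)` form; `ψ(2/3)`, `ψ(5/6)` -/

/-- **Gauss's digamma theorem in the printed `log(2 sin)` form** (Andrews–Askey–Roy (1.2.16), with the
symmetric full sum `Σ_{n=1}^{q−1}` in place of the folded `2Σ'_{n≤⌊q/2⌋}` — the terms `n` and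
`q − n` coincide): for `1 ≤ p < q`,
`ψ(p/q) = −γ − (π/2)cot(πp/q) − log q + Σ_{n=1}^{q−1} cos(2πnp/q) log(2 sin(πn/q))`.
[cite: AndrewsAskeyRoy1999, Thm 1.2.7, (1.2.16)] -/
theorem digammaReal_rat_log_sin {p q : ℕ} (hp : 1 ≤ p) (hpq : p < q) :
    digammaReal (p / q) = -Real.eulerMascheroniConstant -
      π / 2 * (Real.cos (π * p / q) / Real.sin (π * p / q)) - Real.log q +
      ∑ n ∈ Finset.Ico 1 q, Real.cos (2 * π * n * p / q) * Real.log (2 * Real.sin (π * n / q)) := by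
  have hq : 0 < q := by omega
  have hqR : (0 : ℝ) < q := by exact_mod_cast hq
  rw [digammaReal_rat hp hpq]
  have hterm : ∀ n ∈ Finset.Ico 1 q,
      Real.log (2 - 2 * Real.cos (2 * π * n / q)) = 2 * Real.log (2 * Real.sin (π * n / q)) := by
    intro n hn
    rw [Finset.mem_Ico] at hn
    have hsin : 0 < Real.sin (π * n / q) := by
      apply Real.sin_pos_of_pos_of_lt_pi
      · have : (0 : ℝ) < n := by exact_mod_cast hn.1
        positivity
      · rw [div_lt_iff₀ hqR]
        have : (n : ℝ) < q := by exact_mod_cast hn.2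
        nlinarith [Real.pi_pos]
    rw [show 2 - 2 * Real.cos (2 * π * n / q) = (2 * Real.sin (π * n / q)) ^ 2 by
      rw [show 2 * π * (n : ℝ) / q = 2 * (π * n / q) by ring, Real.cos_two_mul]
      nlinarith [Real.sin_sq_add_cos_sq (π * n / q)], Real.log_pow]
    push_cast
    ring
  rw [Finset.mul_sum]
  have hsum : ∑ n ∈ Finset.Ico 1 q, 1 / 2 * (Real.cos (2 * π * n * p / q) *
      Real.log (2 - 2 * Real.cos (2 * π * n / q))) =
      ∑ n ∈ Finset.Ico 1 q, Real.cos (2 * π * n * p / q) * Real.log (2 * Real.sin (π * n / q)) := by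
    refine Finset.sum_congr rfl fun n hn => ?_
    rw [hterm n hn]
    ring
  rw [hsum]
  ring

/-- **`ψ(2/3) = −γ − (3/2) log 3 + π/(2√3)`** (reflection from `ψ(1/3)`). [cite: AndrewsAskeyRoy1999, Thm 1.2.7] -/
theorem digammaReal_two_thirds :
    digammaReal (2 / 3) = -Real.eulerMascheroniConstant - 3 / 2 * Real.log 3 + π / (2 * √3) := by
  have h := digammaReal_rat (p := 2) (q := 3) (by norm_num) (by norm_num)
  push_cast at h
  rw [h, show Finset.Ico 1 3 = {1, 2} by decide, Finset.sum_pair (by norm_num)]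
  simp only [Nat.cast_one, Nat.cast_ofNat, mul_one]
  have c1 : Real.cos (2 * π * 2 / 3) = -(1 / 2) := by
    rw [show 2 * π * 2 / 3 = π / 3 + π by ring, Real.cos_add_pi, Real.cos_pi_div_three]
  have c2 : Real.cos (2 * π * 2 * 2 / 3) = -(1 / 2) := by
    rw [show 2 * π * 2 * 2 / 3 = 2 * π / 3 + 2 * π by ring, Real.cos_add_two_pi,
      show 2 * π / 3 = π - π / 3 by ring, Real.cos_pi_sub, Real.cos_pi_div_three]
  have c1' : Real.cos (2 * π / 3) = -(1 / 2) := by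
    rw [show 2 * π / 3 = π - π / 3 by ring, Real.cos_pi_sub, Real.cos_pi_div_three]
  have hcot : Real.cos (π * 2 / 3) / Real.sin (π * 2 / 3) = -(1 / √3) := by
    rw [show π * 2 / 3 = π - π / 3 by ring, Real.cos_pi_sub, Real.sin_pi_sub, Real.cos_pi_div_three,
      Real.sin_pi_div_three]
    have h3 : (√3 : ℝ) ≠ 0 := by positivity
    field_simp
  rw [c1, c2, c1', hcot]
  have hlog : Real.log (2 - 2 * (-(1 / 2))) = Real.log 3 := by norm_num
  rw [hlog]
  have h3 : (√3 : ℝ) ≠ 0 := by positivity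
  field_simp
  ring

/-- **`ψ(5/6) = −γ − 2 log 2 − (3/2) log 3 + (√3/2)π`**. [cite: AndrewsAskeyRoy1999, Thm 1.2.7] -/
theorem digammaReal_five_sixths :
    digammaReal (5 / 6) = -Real.eulerMascheroniConstant - 2 * Real.log 2 - 3 / 2 * Real.log 3 +
      √3 / 2 * π := by
  have h := digammaReal_five_sixths_sub_one_third
  rw [digammaReal_one_third] at h
  have h3 : (√3 : ℝ) ≠ 0 := by positivity
  have h3sq : (√3 : ℝ) ^ 2 = 3 := Real.sq_sqrt (by norm_num)
  have key : digammaReal (5 / 6) = 2 * π / √3 - 2 * Real.log 2 +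
      (-Real.eulerMascheroniConstant - 3 / 2 * Real.log 3 - π / (2 * √3)) := by linarith
  rw [key]
  field_simp
  linear_combination (-π) * h3sq

end LegendreP

end Literature.NumberTheory.Automorphic
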